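import Literature.NumberTheory.LFunctions.RealZerosPintzTatuzawa
import Literature.NumberTheory.LFunctions.GreatestRealZeroElementary
import Literature.NumberTheory.LFunctions.DirichletConvOneChiSum
import Literature.NumberTheory.QuadraticFields.LenstraPomerancePrescribedCoefficient
import Literature.NumberTheory.QuadraticFields.DedekindZetaReducedForms
import Literature.NumberTheory.QuadraticFields.QuadraticDedekindZetaOddPrimitive
import Literature.NumberTheory.QuadraticFields.ImaginaryResiduePiForm
import Literature.NumberTheory.QuadraticFields.BinaryQuadraticFormsPrimeRepresentation
import Mathlib.NumberTheory.ZetaValues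
import Mathlib.NumberTheory.EulerProduct.Basic
import Mathlib.NumberTheory.SmoothNumbers
import Mathlib.Analysis.SpecificLimits.Normed
import HarnessLib

/-!
# Pintz 1976 (II), Theorem 1 — `L'(1) ∼ L(1)/δ ∼ Σ_{n ≤ D²} g(n)/n ≥ ∏_{p∣D}(1+1/p)(π²/6 − o(1))`
# under `L(1) = o(1/log D)` — PROVED; and Theorem 2 — `δ ∼ 6h(−D)/(π ∏_{p∣D}(1+1/p) √D)` under
# `h(−D) ≤ log D/(2 log log D)` — PROVED (Parts H–K)

Topic `Literature/NumberTheory/LFunctions` (namespace `Literature.NumberTheory.LFunctions`, helpers in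
the statement file's grouping sub-namespace `Pintz1976`). PROOF LAYER for the statement file
`GreatestRealZeroElementary.lean` (cells `parity-realchar` — SIEGEL INSTRUMENT, conditionals column,
the «`L(1) ↔ δ`» dictionary — and `landau-siegel` §C). The named fact

* `pintz1976_theorem1` — J. Pintz, *Elementary methods in the theory of L-functions, II. On the
  greatest real zero of a real L-function*, Acta Arith. **31** (1976) 273–289, Theorem 1 (p. 275,
  (1.16)–(1.17)): "Let `χ` be a real non-principal character modulo `D`, for which
  `L(1) = o(1/log D)`. Then for the Siegel-zero `1 − δ` of `L(s)` (which exists by the theorem of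
  Hecke [11]) with the notation `g(n) = Σ_{d∣n} χ(d)`:
  `L'(1) ∼ L(1)/δ ∼ Σ_{n ≤ D²} g(n)/n ≥ ∏_{p∣D}(1 + 1/p)(π²/6 − o(1))`" (typed with `ε`/`η`/`D₀`
  quantifiers for `o(1)`/`∼`, for primitive real `χ`, the conclusions asserted for the greatest
  real zero `1 − δ` together with the existence of a real zero in `[1 − 1/log D, 1)`)

is discharged here as `theorem pintz1976_theorem1_holds : pintz1976_theorem1`. The statement file is untouched; the typed
`Prop` is proved literally. Everything in this file is PROVED (theorems only; no definition, no
named fact, no new hypothesis).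

## Source and road (as printed, §2 pp. 279–282)

Source READ first-hand: the journal scan `matwbn.icm.edu.pl/ksiazki/aa/aa31/aa3139.pdf` (image-only;
pp. 274–281, 284–287 rendered by the typing seat littype-FP2-2 g4/g6, pp. 273, 282–283, 288–289
rendered by g11; renders under `run/shared/lean/pub/parity-realchar/littype-FP2-2/`).

PRINT (pp. 279–282): "Proof of Theorem 1. First we prove the easy LEMMA 1. For an arbitrary
`x ≥ 4√D log²D` (2.1) `Σ_{n≤x} g(n)/n = L'(1) + (log x + c)L(1) + 5ϑ√(√D log D log x/x)` … If
`L(1) = o(1/log D)` then from Lemma 1 we get (2.3) `Σ_{n≤D²} g(n)/n = L'(1) + o(1)`. Next … an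
arbitrary `n ≤ D²` can be written as `n = ar = abm` … (2.7) `g(n) = ∏_{p^α∥n}(1 + χ(p) + … + χ^α(p))
= g(a)g(b)g(m) ≥ 0`. Hence (2.8) `Σ_{n≤D²} g(n)/n ≥ Σ_{ql²≤D², μ(q)≠0, q∣D} g(ql²)/(ql²) ≥ Σ 1/(ql²)
≥ Σ_{q∣D, μ(q)≠0} 1/q · Σ_{l²≤D} 1/l² = ∏_{p∣D}(1+1/p)(π²/6 − o(1))`. Next we assert LEMMA 2. For an
arbitrary `τ` with `0 < τ < 1` there exists a `c_τ` … such that for all `x ≥ 3√D log D/τ` (2.9)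
`Σ_{n≤x} g(n)/n^{1−τ} = (c_τ − 1/τ)L(1−τ) + (1/τ)x^τ L(1) + 2x^τ ϑ√(3√D log D/(τx))`. This is Lemma 0
of [14] with … Pólya's inequality … setting `τ = δ` and `x = D²` and multiplying (2.9) by `x^{−δ}`
we get (2.10) `Σ_{n≤D²} (g(n)/n)(n/x)^δ = L(1)/δ + 2ϑ√(3√D log D/(δD²)) = … ∼ L(1)/δ`. Since by the
theorem of Hecke [11] we have `δ = o(1/log D)`, it follows (2.11) `1 ≥ (n/x)^δ ≥ 1/x^δ = 1/D^{2δ} =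
1/e^{2δ log D} = 1 − o(1)`. Thus as `g(n) ≥ 0`, from (2.10) and (2.11) we get (2.12)
`L(1)/δ ∼ Σ (g(n)/n)(n/x)^δ = Σ (g(n)/n)(1 − o(1)) ∼ Σ_{n≤D²} g(n)/n`. The assertion of Theorem 1
follows from (2.3), (2.8) and (2.12)."

HERE, in the same order (Parts A–G):

* **Part A (dictionary).** `Pintz1976.g χ = RealChar.charDivisorSum χ` (the tree's `r = χ ∗ 1`),
  `gSum χ N = Σ_{n ∈ [1,N]} g(n)/n` at naturals, `gSum χ (D²)`.
* **Part B ((2.7)–(2.8)).** `prod_mul_sum_inv_sq_le_gSum`: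
  `∏_{p∣D}(1 + 1/p) · Σ_{l ≤ √D} 1/l² ≤ Σ_{n ≤ D²} g(n)/n` — squarefree divisors of `D` indexed by
  subsets of its prime factors (`Finset.prod_one_add`), the map `(T, l) ↦ (∏_{p∈T} p)·l²` is injective
  (parities of valuations), and `g(ql²) ≥ 1` by multiplicativity and `g(p^α) = Σ_{j≤α} χ(p)^j` with
  `χ(p) = −1` only at even `α` (`one_le_g_kernel_mul_sq`).
* **Part C (Lemma 2 at the zero, (2.9)–(2.10)).** `sum_charDivisorSum_rpow_of_zero`: for real
  primitive `χ` mod `q ≥ 2`, `A = √q(1+log q)`, `N ≥ A`, `0 < τ < ½`, `L(1−τ,χ) = 0`: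
  `|Σ_{k≤N} g(k)k^{−(1−τ)} − L(1)N^τ/τ| ≤ 5√A N^{−(½−τ)}(1 + 1/(½−τ))` — the engine of the sibling
  discharges of Pintz 1977 VIII (`Pintz1977RealZeros.continuation_eq`, `sum_mul_rpow_neg_eq_continuation`,
  `abs_tail_le'`, `abs_sum_charDivisorSum_sub_le_of_partialSum_le`, Pólya–Vinogradov) applied to
  `F = ζ·L(·,χ)` at its real zero, exactly as `Pintz1977RealZeros.landau_sum_rpow_of_zero` does for
  `j = 3`; and `weighted_sum_bracket` (the weights `(k/N)^τ ∈ [N^{−τ}, 1]`, (2.11)).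
* **Part D (Hecke).** `exists_realZero_of_lOne_le`: `L(1) ≤ ½e^{−3/2} b`, `0 < b ≤ 1/log D`,
  `D ≥ D₀` ⟹ a real zero in `[1 − b, 1)` — contrapositive of the tree's DISCHARGED Pintz 1977 VIII
  Theorem 2 (`pintz1977RealZeros_theorem2_holds`, `η = ½`).
* **Part E ((2.3)).** `abs_gSum_sq_sub_le`: `|Σ_{n≤D²} g(n)/n − L'(1) − (2 log D + γ)L(1)| ≤
  8√D(1+log D)(2 log D+1)/(D+1) + 4/D` — the tree's Montgomery–Vaughan Exercise 11.2.3(g)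
  (`DirichletAbel.norm_sum_divisorSum_div_sub_le_polyaVinogradov`) at `N = D²`, `Y = D`.
* **Part F (limits).** The two error terms are `≤ 1228/D^{1/8}` (`errors_le`, via `log x ≤ 8x^{1/8}`),
  `Σ_{l≤L} 1/l² → π²/6` (`hasSum_zeta_two`), `∏(1+1/p) ≥ 1`, `Σ_{l≤L}1/l² ≥ 1`.
* **Part G (assembly).** With `e = min(ε,1)/64`, `η = ½e^{−3/2}e`: `L(1) log D ≤ η` gives (Hecke) a zero
  in `[1 − e/log D, 1)`, hence `δ log D ≤ e` and `(D²)^{−δ} ≥ 1 − 2e`; (2.10)+(2.11) give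
  `|L(1)/δ − S| ≤ 2eS + e` (`S = Σ_{n≤D²} g(n)/n ≥ 1`); (2.3) gives `|S − L'(1) − (2log D+γ)L(1)| ≤ e`
  with `(2 log D + γ)L(1) ≤ 3η`; the budget lemma `ratios_of_budget` turns these into
  `|δL'(1)/L(1) − 1| ≤ ε`, `|(L(1)/δ)/S − 1| ≤ ε`; and (2.8) + `ζ(2)` give the third relation.

DECLARED DEVIATIONS from print: (i) Lemma 1 enters in the `O`-form of Montgomery–Vaughan 11.2.3(g)
(PROVED in the tree), not with the printed constant `5` of (2.1), in accordance with the READING NOTE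
on `pintz1976_lemma1` in the statement file (p. 280 does not deliver `5`; Theorem 1 only uses the
`o(1)` form (2.3)); (ii) Lemma 2 is used only at the zero `1 − τ = 1 − δ`, where the term
`(c_τ − 1/τ)L(1 − τ)` vanishes, and is proved there from the continuation identity with the explicit
Pólya–Vinogradov partial-sum bound `√D(1 + log D)` of the tree (any `A ≍ √D log D` gives the same
`o(1)`); (iii) "the theorem of Hecke [11]" with `δ = o(1/log D)` is the kernel form
`L(1) > ½e^{−3/2}β` off zeros in `[1−β,1]` (Pintz 1977 VIII Thm 2, discharged in the tree), giving the
explicit `δ log D ≤ 2e^{3/2} · L(1) log D`; (iv) `D₀(ε)`, `η(ε)` are obtained from explicit but crude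
inequalities and limits, not computed — the print only claims "effective" (p. 275). No constant or
quantifier of the typed statement is changed.

## Appended (same seat): Part H — towards Theorem 2, the class-number-free step (3.5)–(3.6)

PRINT (p. 283, (3.5)): "applying Lemma 1 with `x = D/4` and `x = D⁴` we get
`(Σ_{√D/2 < p ≤ D², χ(p)=1} 1/p)² ≤ Σ_{D/4 < n ≤ D⁴} g(n)/n = L(1) log(4D³) + O(√(√D log²D/D)) = o(1)`."
PROVED here: `Pintz1976.card_filter_mul_eq_le_g` (`#{(p,p′) split : pp′ = n} ≤ g(n)`),
`Pintz1976.sq_sum_inv_le_sum_g_div` (`(Σ_{p∈P} 1/p)² ≤ Σ_{N₁<n≤N₂} g(n)/n`),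
`Pintz1976.abs_gSum_natCast_sub_le` / `sum_Ioc_g_div_le` (Lemma 1 = MV 11.2.3(g) at a general `N`,
and twice), `Pintz1976.sq_sum_inv_splitPrimes_le` (for `⌊D^{1/4}⌋ ≥ 4`:
`(Σ_{√D/2<p≤D², χ(p)=1} 1/p)² ≤ 4L(1) log D + 3556(1+log r)²/r`, `r = ⌊√⌊√D⌋⌋`, parameters
`(N, Y) = (⌊D/4⌋, ⌊√D⌋·r)` and `(D⁴, D²)`), and the `ε`/`η`/`D₀` form
`Pintz1976.sum_inv_splitPrimes_le`: **for every `ε > 0` there are `η > 0`, `D₀` with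
`Σ_{√D/2 < p ≤ D², χ(p) = 1} 1/p ≤ ε` whenever `D ≥ D₀`, `χ` is primitive real mod `D` and
`L(1,χ) log D ≤ η`** (under (1.16) almost all primes in `(√D/2, D²]` are inert or ramified, in the
`1/p`-measure).

## Appended (same seat): Parts I–K — Theorem 2 PROVED (`pintz1976_theorem2_holds`)

PRINT (Theorem 2, p. 276): "If `−D < 0` is a fundamental discriminant, for which
`h(−D) ≤ log D/(2 log log D)` (1.18), then for the Siegel zero of `L(s, χ_D)` (which exists according
to Theorem 7 of [14]) we have `L(1)/δ ∼ (π²/6)∏_{p∣D}(1 + 1/p) ⟺ δ ∼ 6h(−D)/(π ∏_{p∣D}(1 + 1/p) √D)`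
(1.19)." Proof §3 (pp. 282–283): by Theorem 1 it suffices to show
`S = Σ_{n≤D²} g(n)/n ≤ (1 + o(1))(π²/6)∏_{p∣D}(1 + 1/p)` (3.1); "if `1 ≤ n ≤ √D/2` and all prime
divisors of `n` have `(−D/p) = 1` then `n ∈ H(−D)`, where `|H(−D)| ≤ h(−D)` (see for example
Davenport [3], Hilfssatz 1)" (3.2); hence a split prime has `p^h > √D/2` (3.3) and
`Σ_{p ≤ √D/2 split} 1/p ≤ h (√D/2)^{−1/h} ≤ 2/log log D` (3.4); with (3.5)–(3.6) and the Euler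
product, `S ≤ ∏_{p≤D²}(1 + g(p)/p + g(p²)/p² + …) ≤ e^{4Σ_{split p ≤ D²} 1/p}(π²/6)∏_{p∣D}(1 + 1/p)`
(3.7).
HERE: **Part I** — (3.2) is the tree's Lenstra–Pomerance 1992 Lemma 2.10
(`BinaryQuadraticForm.exists_mem_reducedForms_fst_eq`: such an `n` is the first coefficient of a
reduced primitive form of discriminant `d_K`) with `#(reduced forms of discriminant d_K) = h_K`
(`Quadratic.card_reducedForms_eq_classNumber`, Cox Thm. 7.7) and the Kronecker values of the odd
real primitive character mod `|d_K|` (`Quadratic.kroneckerValues_of_odd_primitive`):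
`Pintz1976.card_le_classNumber_of_splitFactors`, then (3.3) `lt_four_mul_pow_classNumber_sq`, (3.4)
`sum_inv_smallSplitPrimes_le`, `mul_rpow_le_two_div_loglog`. **Part J** — (3.7)
`Pintz1976.gSum_sq_le_exp_mul_prod`: `S ≤ exp(4 Σ_{p ≤ D², χ(p)=1} 1/p) · (π²/6) ∏_{p∣D}(1 + 1/p)`
for every real `χ` mod `D` (Mathlib's Euler product over the smooth numbers,
`EulerProduct.summable_and_hasSum_smoothNumbers_prod_primesBelow_tsum`; local factors
`hasSum_charDivisorSum_primePow_div`; `∏_{p}(1 − p^{−2})^{−1} ≤ ζ(2) = π²/6` by `hasSum_zeta_two`).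
**Part K** — `Pintz1976.theorem2_aux` / `pintz1976_theorem2_holds`: Theorem 1 at `e = min(ε,1)/42`
(its hypothesis `L(1) log D ≤ η` follows from (1.18) by the class number formula `L(1) = π h_K/√D`,
`Quadratic.LFunction_one_eq_of_discr_neg_of_eq` with `w_K = 2`), Parts H, I, J, and the reciprocal
ratio for the second form of (1.19).

READING NOTES (Theorem 2): (v) the typed statement takes `K` imaginary quadratic with `D = |d_K|`,
`h = h_K` (Mathlib's `NumberField.classNumber`; `= h(−D)` by Cox Thm. 7.7, tree
`card_reducedForms_eq_classNumber`) and `χ` any odd real primitive character mod `D` (it is `χ_D`: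
`kroneckerValues_of_odd_primitive`), and asserts (1.19) for the greatest real zero — as in the print
("Owing to Theorem 1 it is sufficient to show (1.19) for the greatest real zero", p. 282); (vi) (3.2)
is cited by Pintz from Davenport [3] (Hilfssatz 1); the tree's proved form is Lenstra–Pomerance 1992
Lemma 2.10 (same statement: `b² ≡ d_K (mod 4n)` is solvable when every prime factor of `n` splits,
and `(n, b, c)` is reduced for `n ≤ √|d_K|/2`); (vii) the constant in (3.4) here is `2/log log D` as
printed (`(4/D)^{1/(2h)} ≤ 4/log D` for `h ≤ log D/(2 log log D)`).

## Appended (same seat): Part L — (6.1) PROVED and Theorem 5 ⇐ Theorem 4 (PROVED glue)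

`Pintz1976.gSum_sq_le_exp_sum_one_add_re`: `Σ_{n≤D²} g(n)/n ≤ (π²/6)e^{2π²/3} exp(Σ_{p≤D²}(1+χ(p))/p)`
for every real `χ` mod `D` ((6.1) p. 288, via the Euler product of Part J with
`E_p ≤ exp((1+χ(p))/p + 4/p²)` instead of the printed `d(m²)` majorant), and
`Pintz1976.theorem5_of_theorem4 : pintz1976_theorem4 → pintz1976_theorem5` (§6 p. 288: Theorem 1 at
`ε = ½` — (1.30) gives `L(1) log D ≤ 1/log D ≤ η` — and (6.1)). `pintz1976_theorem4` (hence Lemma 3,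
§5) remains the one unproved input of Theorem 5.

WHAT THIS IS NOT: no claim that any character with `L(1) = o(1/log D)` (equivalently, a Siegel zero)
or any field with `h(−D) ≤ log D/(2 log log D)` exists; nothing here bears on parity. The remaining
facts of the statement file (`pintz1976_theorem3`/`_schinzel`, `theorem4`, `theorem5`, `lemma1`,
`lemma3`) are not discharged here (`theorem5` is reduced to `theorem4`).

## References

* [Pintz1976ElementaryII] J. Pintz, Acta Arith. 31 (1976) 273–289: Theorem 1 p. 275 (1.16)–(1.17);
  Lemma 1 (2.1) p. 279, (2.3)–(2.6) p. 280, (2.7)–(2.10) and Lemma 2 p. 281, (2.11)–(2.12) p. 282;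
  Theorem 2 p. 276 (1.18)–(1.19), §3 (3.1)–(3.4) p. 282, (3.5)–(3.7) p. 283 (Parts H–K); Theorem 5
  pp. 278–279 (1.30)–(1.31), §6 (6.1) p. 288 (Part L).
* [LenstraPomerance1992] H. W. Lenstra Jr., C. Pomerance, *A rigorous time bound for factoring
  integers*, J. AMS 5 (1992), §2 Lemma 2.10 (tree `LenstraPomerancePrescribedCoefficient.lean`) —
  Pintz's reference for (3.2) is Davenport, *Multiplicative number theory* [3], Hilfssatz 1.
* [Cox2013] D. A. Cox, *Primes of the form x² + ny²*, 2nd ed., Thm. 7.7(ii) (`h(d_K) = h_K`, tree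
  `DedekindZetaReducedForms.lean`).
* [MontgomeryVaughan2007] Theorem 9.13 (Kronecker values of real primitive characters, tree
  `QuadraticDedekindZetaOddPrimitive.lean`); [NeukirchANT1999] Ch. VII (5.11) (class number formula,
  tree `QuadraticDedekindZetaKronecker.lean`).
* [Pintz1977ElementaryVIII] J. Pintz, Acta Arith. 33 (1977) 89–98: Theorem 2 (Hecke) p. 89, Lemma 2
  (3.12) p. 93 (the engine; tree `RealZerosPintzContinuation.lean`, `RealZerosPintzTatuzawa.lean`,
  `RealZerosRealLFunctionsElementaryProofs.lean`).
* [MontgomeryVaughan2007] H. L. Montgomery, R. C. Vaughan, *Multiplicative Number Theory I*, CUP 2007: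
  §11.2.1 Exercise 3(g) (tree `DirichletConvOneChiSum.lean`), §9.4 (Pólya–Vinogradov).
-/

noncomputable section

open Complex Filter Topology Set MeasureTheory Finset ArithmeticFunction

namespace Literature.NumberTheory.LFunctions

namespace Pintz1976

open DirichletAbel RealChar Pintz1977RealZeros

/-! ## Part A. Dictionary: `g = 1 ∗ χ` is the tree's `charDivisorSum`, and `Σ_{n ≤ x} g(n)/n` at
natural arguments -/

section Dictionary

variable {D : ℕ} [NeZero D] (χ : DirichletCharacter ℂ D)

/-- `g(n) = Σ_{d ∣ n} χ(d)` (real part) is the tree's real arithmetic function `r = χ ∗ 1`.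
[cite: Pintz1976ElementaryII, §2 p. 279] -/
theorem g_eq_charDivisorSum (n : ℕ) : g χ n = charDivisorSum χ n := by
  rw [g, charDivisorSum_apply, Complex.re_sum]
  refine sum_congr rfl fun d hd => ?_
  rw [reChar_apply χ (Nat.pos_of_mem_divisors hd).ne']

/-- `g(n) ≥ 0` for a real character (`χ² = 1`). [cite: Pintz1976ElementaryII, §2 (2.7) p. 281] -/
theorem g_nonneg (hq : χ ^ 2 = 1) (n : ℕ) : 0 ≤ g χ n := by
  rw [g_eq_charDivisorSum]; exact charDivisorSum_nonneg χ hq n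

/-- `Σ_{n ≤ N} g(n)/n` at a natural number `N`. [cite: Pintz1976ElementaryII, §1 (1.17)] -/
theorem gSum_natCast (N : ℕ) : gSum χ (N : ℝ) = ∑ n ∈ Icc 1 N, g χ n / (n : ℝ) := by
  rw [gSum, Nat.floor_natCast]

/-- `Σ_{n ≤ D²} g(n)/n` as a finite sum over `1 ≤ n ≤ D²`. [cite: Pintz1976ElementaryII, §1 (1.17)] -/
theorem gSum_sq : gSum χ ((D : ℝ) ^ 2) = ∑ n ∈ Icc 1 (D ^ 2), g χ n / (n : ℝ) := by
  rw [show ((D : ℝ) ^ 2) = ((D ^ 2 : ℕ) : ℝ) by push_cast; ring, gSum_natCast]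

/-- `Σ_{n ≤ N} g(n)/n ≥ 0`. [cite: Pintz1976ElementaryII, §2 (2.7) p. 281] -/
theorem gSum_natCast_nonneg (hq : χ ^ 2 = 1) (N : ℕ) : 0 ≤ gSum χ (N : ℝ) := by
  rw [gSum_natCast]
  exact sum_nonneg fun n _ => div_nonneg (g_nonneg χ hq n) (Nat.cast_nonneg _)

end Dictionary

/-! ## Part B. The lower bound (2.8):
`Σ_{n ≤ D²} g(n)/n ≥ Σ_{q ∣ D, μ(q) ≠ 0} Σ_{l² ≤ D} g(q l²)/(q l²) ≥ ∏_{p ∣ D}(1 + 1/p) · Σ_{l ≤ √D} 1/l²`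

PRINT (p. 281): "an arbitrary `n ≤ D²` can be written as `n = a r = a b m` … `g(n) = ∏_{p^α ∥ n}
(1 + χ(p) + … + χ^α(p))` (2.7). Hence `Σ_{n ≤ D²} g(n)/n ≥ Σ_{q l² ≤ D², μ(q) ≠ 0, q ∣ D} g(q l²)/(q l²)
≥ Σ 1/(q l²) ≥ Σ_{q ∣ D, μ(q) ≠ 0} 1/q · Σ_{l² ≤ D} 1/l² = ∏_{p ∣ D}(1 + 1/p)(π²/6 − o(1))` (2.8)."
HERE: the squarefree divisors `q` of `D` are indexed by the subsets `T` of the prime factors of `D`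
(`q = ∏_{p ∈ T} p`), the map `(T, l) ↦ (∏_{p∈T} p) · l²` is injective (parity of valuations), and
`g(q l²) ≥ 1` because a prime with `χ(p) = −1` divides `q l²` to an even power. -/

section LowerBound

variable {D : ℕ} [NeZero D] (χ : DirichletCharacter ℂ D)

/-- The valuation of a product of distinct primes: for `T` a set of primes and `r` prime,
`v_r(∏_{p ∈ T} p) = 1` if `r ∈ T` and `0` otherwise. [folklore] -/
private theorem factorization_prod_primes {T : Finset ℕ} (hT : ∀ p ∈ T, p.Prime) (r : ℕ) :
    (∏ p ∈ T, p).factorization r = if r ∈ T then 1 else 0 := by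
  rw [Nat.factorization_prod fun p hp => (hT p hp).ne_zero, Finset.sum_apply']
  have : ∀ p ∈ T, (p.factorization : ℕ →₀ ℕ) r = if p = r then 1 else 0 := by
    intro p hp
    rw [(hT p hp).factorization, Finsupp.single_apply]
  rw [sum_congr rfl this, sum_ite_eq' T r]

/-- The valuation of `(∏_{p ∈ T} p) · l²` at a prime `r`: `[r ∈ T] + 2 v_r(l)` (`l ≠ 0`). [folklore] -/
private theorem factorization_kernel_mul_sq {T : Finset ℕ} (hT : ∀ p ∈ T, p.Prime) {l : ℕ}
    (hl : l ≠ 0) (r : ℕ) :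
    ((∏ p ∈ T, p) * l ^ 2).factorization r = (if r ∈ T then 1 else 0) + 2 * l.factorization r := by
  have hP : (∏ p ∈ T, p) ≠ 0 := prod_ne_zero_iff.mpr fun p hp => (hT p hp).ne_zero
  rw [Nat.factorization_mul hP (pow_ne_zero 2 hl), Finsupp.add_apply, factorization_prod_primes hT,
    Nat.factorization_pow, Finsupp.smul_apply, smul_eq_mul]

/-- Injectivity of `(T, l) ↦ (∏_{p∈T} p) · l²` on pairs (set of primes, positive integer): the
squarefree kernel and the square part of an integer are determined by the parities of its
valuations. [folklore] -/
private theorem kernel_mul_sq_injOn (P : Finset ℕ) (hP : ∀ p ∈ P, p.Prime) (L : ℕ) :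
    Set.InjOn (fun x : Finset ℕ × ℕ => (∏ p ∈ x.1, p) * x.2 ^ 2)
      ↑(P.powerset ×ˢ Finset.Icc 1 L) := by
  intro x hx y hy hxy
  rw [mem_coe, Finset.mem_product, Finset.mem_powerset, Finset.mem_Icc] at hx hy
  have hTx : ∀ p ∈ x.1, p.Prime := fun p hp => hP p (hx.1 hp)
  have hTy : ∀ p ∈ y.1, p.Prime := fun p hp => hP p (hy.1 hp)
  have hlx : x.2 ≠ 0 := by have := hx.2.1; omega
  have hly : y.2 ≠ 0 := by have := hy.2.1; omega
  simp only at hxy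
  -- compare valuations
  have hval : ∀ r, (if r ∈ x.1 then 1 else 0) + 2 * x.2.factorization r =
      (if r ∈ y.1 then 1 else 0) + 2 * y.2.factorization r := by
    intro r
    rw [← factorization_kernel_mul_sq hTx hlx, ← factorization_kernel_mul_sq hTy hly, hxy]
  -- the sets agree
  have hT : x.1 = y.1 := by
    ext r
    have h := hval r
    constructor
    · intro hr
      by_contra hr'
      rw [if_pos hr, if_neg hr'] at h; omega
    · intro hr
      by_contra hr'
      rw [if_neg hr', if_pos hr] at h; omega
  -- hence the squares agree
  have hprod : (∏ p ∈ x.1, p) ≠ 0 := prod_ne_zero_iff.mpr fun p hp => (hTx p hp).ne_zero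
  rw [hT] at hxy hprod
  have hsq : x.2 ^ 2 = y.2 ^ 2 := Nat.eq_of_mul_eq_mul_left (Nat.pos_of_ne_zero hprod) hxy
  have h2 : x.2 = y.2 := Nat.pow_left_injective (by norm_num) hsq
  exact Prod.ext hT h2

/-- `Σ_{j ≤ k} x^j ≥ 1` for `x ∈ {0, 1}`, and for `x = −1` when `k` is even. [folklore] -/
private theorem one_le_geom_sum_of_trichotomy {x : ℝ} {k : ℕ} (hx : x = 0 ∨ x = 1 ∨ x = -1)
    (heven : x = -1 → Even k) : 1 ≤ ∑ j ∈ Finset.range (k + 1), x ^ j := by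
  rcases hx with h | h | h
  · rw [h, zero_geom_sum, if_neg (Nat.succ_ne_zero k)]
  · rw [h]; simp
  · have hk := heven h
    rw [h, neg_one_geom_sum, if_neg (by simpa [Nat.even_add_one] using hk)]

/-- **`g(q l²) ≥ 1`** for `q = ∏_{p ∈ T} p` a squarefree divisor of the modulus (`T ⊆` prime
factors of `D`) and `l ≥ 1`: by (2.7), `g(n) = ∏_{p^α ∥ n}(1 + χ(p) + ⋯ + χ(p)^α)`, and a prime with
`χ(p) = −1` does not divide `D`, hence divides `q l²` to an even power, so its factor is `1`; primes
with `χ(p) = 0` contribute `1` and primes with `χ(p) = 1` contribute `α + 1`.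
[cite: Pintz1976ElementaryII, §2 (2.7)–(2.8) p. 281] -/
theorem one_le_g_kernel_mul_sq (hq : χ ^ 2 = 1) {T : Finset ℕ} (hT : T ⊆ D.primeFactors)
    {l : ℕ} (hl : l ≠ 0) : 1 ≤ g χ ((∏ p ∈ T, p) * l ^ 2) := by
  have hTp : ∀ p ∈ T, p.Prime := fun p hp => Nat.prime_of_mem_primeFactors (hT hp)
  have hP0 : (∏ p ∈ T, p) ≠ 0 := prod_ne_zero_iff.mpr fun p hp => (hTp p hp).ne_zero
  set n := (∏ p ∈ T, p) * l ^ 2 with hn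
  have hn0 : n ≠ 0 := mul_ne_zero hP0 (pow_ne_zero 2 hl)
  rw [g_eq_charDivisorSum,
    (isMultiplicative_charDivisorSum χ hq).multiplicative_factorization _ hn0, Finsupp.prod]
  rw [show (1 : ℝ) = ∏ r ∈ n.factorization.support, (1 : ℝ) by simp]
  refine prod_le_prod (fun _ _ => zero_le_one) fun r hr => ?_
  rw [Nat.support_factorization] at hr
  have hrp : r.Prime := Nat.prime_of_mem_primeFactors hr
  rw [charDivisorSum_prime_pow χ hq hrp]
  refine one_le_geom_sum_of_trichotomy (reChar_trichotomy χ hq r) fun hm1 => ?_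
  -- `χ(r) = −1` forces `r ∉ T` (primes in `T` divide `D`, where `χ` vanishes), so `v_r(n)` is even
  have hrT : r ∉ T := by
    intro hrT
    have hrD : r ∣ D := Nat.dvd_of_mem_primeFactors (hT hrT)
    have hunit : ¬ IsUnit ((r : ℕ) : ZMod D) := by
      rw [ZMod.isUnit_iff_coprime]
      intro hcop
      have : r = 1 := Nat.Coprime.eq_one_of_dvd hcop hrD
      exact hrp.one_lt.ne' this
    have h0 : reChar χ r = 0 := by
      rw [reChar_apply χ hrp.ne_zero, χ.map_nonunit hunit, Complex.zero_re]
    rw [h0] at hm1; norm_num at hm1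
  rw [hn, factorization_kernel_mul_sq hTp hl, if_neg hrT, zero_add]
  exact even_two_mul _

/-- **(2.8), the lower bound for `Σ_{n ≤ D²} g(n)/n`**: for a real character `χ` mod `D ≥ 1`,
`Σ_{n ≤ D²} g(n)/n ≥ ∏_{p ∣ D}(1 + 1/p) · Σ_{l ≤ √D} 1/l²`.
[cite: Pintz1976ElementaryII, §2 (2.8) p. 281] -/
theorem prod_mul_sum_inv_sq_le_gSum (hq : χ ^ 2 = 1) :
    (∏ p ∈ D.primeFactors, (1 + 1 / (p : ℝ))) * (∑ l ∈ Icc 1 (Nat.sqrt D), 1 / (l : ℝ) ^ 2) ≤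
      gSum χ ((D : ℝ) ^ 2) := by
  classical
  set P := D.primeFactors with hPdef
  have hPp : ∀ p ∈ P, p.Prime := fun p hp => Nat.prime_of_mem_primeFactors hp
  set S := P.powerset ×ˢ Finset.Icc 1 (Nat.sqrt D) with hSdef
  set φ : Finset ℕ × ℕ → ℕ := fun x => (∏ p ∈ x.1, p) * x.2 ^ 2 with hφdef
  have hD0 : D ≠ 0 := NeZero.ne D
  -- the left-hand side as a sum over `S`
  have hlhs : (∏ p ∈ P, (1 + 1 / (p : ℝ))) * (∑ l ∈ Icc 1 (Nat.sqrt D), 1 / (l : ℝ) ^ 2) =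
      ∑ x ∈ S, (∏ p ∈ x.1, 1 / (p : ℝ)) * (1 / (x.2 : ℝ) ^ 2) := by
    rw [prod_one_add, hSdef, sum_product, sum_mul]
    refine sum_congr rfl fun T _ => ?_
    rw [mul_sum]
  rw [hlhs, gSum_sq]
  -- each term is dominated by `g(φ x)/φ x`
  have hterm : ∀ x ∈ S, (∏ p ∈ x.1, 1 / (p : ℝ)) * (1 / (x.2 : ℝ) ^ 2) ≤
      g χ (φ x) / (φ x : ℝ) := by
    intro x hx
    rw [hSdef, Finset.mem_product, Finset.mem_powerset, Finset.mem_Icc] at hx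
    have hl0 : x.2 ≠ 0 := by omega
    have hTp : ∀ p ∈ x.1, p.Prime := fun p hp => hPp p (hx.1 hp)
    have hprodpos : 0 < ∏ p ∈ x.1, (p : ℝ) :=
      prod_pos fun p hp => by exact_mod_cast (hTp p hp).pos
    have hl0r : 0 < (x.2 : ℝ) := by exact_mod_cast Nat.pos_of_ne_zero hl0
    have hφpos : 0 < (φ x : ℝ) := by
      rw [hφdef]; push_cast; positivity
    have hone : (∏ p ∈ x.1, 1 / (p : ℝ)) * (1 / (x.2 : ℝ) ^ 2) = 1 / (φ x : ℝ) := by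
      rw [hφdef, prod_div_distrib, prod_const_one]; push_cast
      field_simp
    rw [hone]
    exact div_le_div_of_nonneg_right (one_le_g_kernel_mul_sq χ hq hx.1 hl0) hφpos.le
  refine (sum_le_sum hterm).trans ?_
  -- reindex by the injective map `φ` and enlarge the index set to `[1, D²]`
  have hinj : Set.InjOn φ ↑S := kernel_mul_sq_injOn P hPp (Nat.sqrt D)
  rw [← sum_image (f := fun n => g χ n / (n : ℝ)) hinj]
  refine sum_le_sum_of_subset_of_nonneg ?_ fun n _ _ =>
    div_nonneg (g_nonneg χ hq n) (Nat.cast_nonneg _)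
  intro n hn
  rw [Finset.mem_image] at hn
  obtain ⟨x, hx, rfl⟩ := hn
  rw [hSdef, Finset.mem_product, Finset.mem_powerset, Finset.mem_Icc] at hx
  have hl0 : x.2 ≠ 0 := by omega
  have hTp : ∀ p ∈ x.1, p.Prime := fun p hp => hPp p (hx.1 hp)
  have hP0 : 0 < ∏ p ∈ x.1, p := prod_pos fun p hp => (hTp p hp).pos
  rw [Finset.mem_Icc]
  constructor
  · exact Nat.one_le_iff_ne_zero.mpr (mul_ne_zero hP0.ne' (pow_ne_zero 2 hl0))
  · -- `∏_{p ∈ T} p ≤ ∏_{p ∣ D} p ≤ D` and `l² ≤ D`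
    have h1 : ∏ p ∈ x.1, p ≤ D := by
      refine le_trans ?_ (Nat.le_of_dvd (Nat.pos_of_ne_zero hD0) (Nat.prod_primeFactors_dvd D))
      exact prod_le_prod_of_subset_of_one_le' hx.1 fun p hp _ => (hPp p hp).one_lt.le
    have h2 : x.2 ^ 2 ≤ D := Nat.le_sqrt'.mp hx.2.2
    calc φ x = (∏ p ∈ x.1, p) * x.2 ^ 2 := rfl
      _ ≤ D * D := Nat.mul_le_mul h1 h2
      _ = D ^ 2 := (pow_two D).symm

end LowerBound

/-! ## Part C. Lemma 2 of part II (= Lemma 0 of part I with Pólya–Vinogradov) at the real zero: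
`Σ_{n ≤ x} g(n) n^{−(1−τ)} = (1/τ) x^τ L(1) + O(x^τ √(A/x))` when `L(1 − τ) = 0`

PRINT (p. 281, (2.9)–(2.10)): "LEMMA 2. For an arbitrary `τ` with `0 < τ < 1` there exists a
`c_τ`, `0 < c_τ < 1`, such that for all `x ≥ 3√D log D/τ` the relation
`Σ_{n ≤ x} g(n)/n^{1−τ} = (c_τ − 1/τ) L(1 − τ) + (1/τ) x^τ L(1) + 2x^τ ϑ √(3√D log D/(τ x))` holds.
This is Lemma 0 of [14] with the only change that in the proof the trivial estimate
`|Σ_a^b χ(d)| < D` must be replaced by Pólya's inequality … setting `τ = δ` and `x = D²` and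
multiplying (2.9) by `x^{−δ}` we get (2.10) `Σ_{n ≤ D²} (g(n)/n)(n/x)^δ = L(1)/δ + 2ϑ√(3√D log D/(δD²))`."
HERE the term `(c_τ − 1/τ) L(1 − τ)` is only ever used at the zero `1 − τ = 1 − δ`, so we prove
the identity AT A REAL ZERO directly from the engine of `RealZerosPintzContinuation.lean`
(Pintz 1977 VIII, Lemma 2 (3.12): the continued function `ζ(s)L(s,χ) = a s/(s−1) + s I(s)`
vanishes at `s = 1 − τ`) and of `RealZerosPintzTatuzawa.lean` (the identity at a real point,
`sum_mul_rpow_neg_eq_continuation`, and the tail bound `abs_tail_le'`), with the Lemma-1 remainder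
`|Σ_{n ≤ t} g(n) − L(1) t| ≤ 5√(A t)` (`A = √q(1 + log q)`, Pólya–Vinogradov) of the same engine —
exactly as `Pintz1977RealZeros.landau_sum_rpow_of_zero` does for `j = 3`. -/

section EngineAtZero

variable {q : ℕ} [NeZero q] (χ : DirichletCharacter ℂ q)

omit [NeZero q] in
/-- `Finset.Icc 1 n = Finset.Ioc 0 n` in `ℕ`. [folklore] -/
private theorem Icc_one_eq_Ioc_zero' (n : ℕ) : Finset.Icc 1 n = Finset.Ioc 0 n := by
  ext k; simp only [Finset.mem_Icc, Finset.mem_Ioc]; omega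

/-- **Pintz's Lemma 2 at a real zero, `j = 1` (the printed (2.9)–(2.10) at `τ = δ`).** For a real
primitive `χ` mod `q ≥ 2`, `A = √q(1 + log q)`, a natural number `N ≥ A` and `0 < τ < 1/2` with
`L(1 − τ, χ) = 0`:
`|Σ_{k ≤ N} g(k) k^{−(1−τ)} − L(1, χ) N^τ/τ| ≤ 5√A · N^{−(1/2−τ)} (1 + 1/(1/2 − τ))`.
[cite: Pintz1976ElementaryII, Lemma 2 (2.9)–(2.10) p. 281]
[cite: Pintz1977ElementaryVIII, Lemma 2 (3.12) p. 93] -/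
theorem sum_charDivisorSum_rpow_of_zero (hprim : χ.IsPrimitive) (hq : χ ^ 2 = 1) (hq2 : 2 ≤ q)
    {N : ℕ} (hNA : Real.sqrt q * (1 + Real.log q) ≤ N) {τ : ℝ} (hτ0 : 0 < τ) (hτ : τ < 1 / 2)
    (hz : χ.LFunction ((1 - τ : ℝ) : ℂ) = 0) :
    |∑ k ∈ Icc 1 N, charDivisorSum χ k * (k : ℝ) ^ (-(1 - τ)) -
        (χ.LFunction 1).re * (N : ℝ) ^ τ / τ| ≤
      5 * Real.sqrt (Real.sqrt q * (1 + Real.log q)) * (N : ℝ) ^ (-(1 / 2 - τ)) *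
        (1 + 1 / (1 / 2 - τ)) := by
  -- the character is non-principal
  have hχ : χ ≠ 1 := by
    rintro rfl
    rw [DirichletCharacter.isPrimitive_def, DirichletCharacter.conductor_one] at hprim
    omega
  -- the data of the engine (kept opaque)
  obtain ⟨f, hfdef⟩ : ∃ f : ℕ → ℝ, ∀ n, f n = charDivisorSum χ n := ⟨_, fun _ => rfl⟩
  obtain ⟨a, hadef⟩ : ∃ a : ℝ, a = (χ.LFunction 1).re := ⟨_, rfl⟩
  obtain ⟨R, hR⟩ : ∃ R : ℝ → ℝ, ∀ t, R t = (∑ k ∈ Icc 1 ⌊t⌋₊, f k) - a * t := ⟨_, fun _ => rfl⟩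
  obtain ⟨I, hI⟩ : ∃ I : ℂ → ℂ,
      ∀ s, I s = ∫ t in Ioi (1 : ℝ), ((R t : ℝ) : ℂ) * (t : ℂ) ^ (-(s + 1)) := ⟨_, fun _ => rfl⟩
  have hff : f = fun n => charDivisorSum χ n := funext hfdef
  have hf : ∀ n, 0 ≤ f n := fun n => by rw [hfdef]; exact charDivisorSum_nonneg χ hq n
  have hf0 : f 0 = 0 := by rw [hfdef]; simp
  -- numerics
  have hq1 : (1 : ℝ) ≤ q := by exact_mod_cast (le_trans (by norm_num) hq2)
  set A : ℝ := Real.sqrt q * (1 + Real.log q) with hAdef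
  have hlogq : 0 ≤ Real.log q := Real.log_nonneg hq1
  have hA1 : 1 ≤ A := by
    have h1 : 1 ≤ Real.sqrt q := Real.one_le_sqrt.mpr hq1
    rw [hAdef]; nlinarith
  have hA0 : 0 < A := by linarith
  have hN1r : (1 : ℝ) ≤ N := hA1.trans hNA
  have hN1 : 1 ≤ N := by exact_mod_cast hN1r
  -- the two remainder bounds (`κ = 1/2`)
  have hPV : ∀ n, ‖partialSum χ n‖ ≤ A := fun n => norm_partialSum_le_polyaVinogradov χ hq2 hprim n
  have hRb : ∀ t : ℝ, 1 ≤ t → |R t| ≤ 5 * q * t ^ (1 - (1 / 2 : ℝ)) := by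
    intro t ht
    have h := abs_sum_charDivisorSum_sub_le χ hχ hq (zero_lt_one.trans_le ht)
    rw [show (1 : ℝ) - 1 / 2 = 1 / 2 by norm_num, ← Real.sqrt_eq_rpow, hR, Icc_one_eq_Ioc_zero',
      hff, hadef]
    exact h
  have hB : ∀ t : ℝ, (N : ℝ) ≤ t → |R t| ≤ 5 * Real.sqrt A * t ^ (1 - (1 / 2 : ℝ)) := by
    intro t ht
    have hAt : A ≤ t := hNA.trans ht
    have h := abs_sum_charDivisorSum_sub_le_of_partialSum_le χ hχ hA1 hPV hAt
    rw [show (1 : ℝ) - 1 / 2 = 1 / 2 by norm_num, ← Real.sqrt_eq_rpow, hR, Icc_one_eq_Ioc_zero',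
      hff, hadef, mul_assoc, ← Real.sqrt_mul hA0.le]
    exact h
  -- the continued function `G = ζ₁ · L(χ)` and the identity `G = a s + s(s−1) I(s)` on `Re s > 1/2`
  obtain ⟨G, hG⟩ : ∃ G : ℂ → ℂ, ∀ s, G s = riemannZeta₁ s * χ.LFunction s := ⟨_, fun _ => rfl⟩
  have hGfun : G = fun s => riemannZeta₁ s * χ.LFunction s := funext hG
  have hGd : DifferentiableOn ℂ G {s : ℂ | 1 - (1 / 2 : ℝ) < s.re} := by
    rw [hGfun]
    exact (differentiable_riemannZeta₁.mul
      (DirichletCharacter.differentiable_LFunction hχ)).differentiableOn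
  have hGL : ∀ s : ℂ, 1 < s.re → G s = (s - 1) * LSeries (fun n => (f n : ℂ)) s := by
    intro s hs; rw [hG, hff]; exact zeta₁_mul_LFunction_eq χ hq hs
  have hκ : (0 : ℝ) ≤ 1 / 2 := by norm_num
  -- the real point `σ = 1 − τ`
  set σ : ℝ := 1 - τ with hσdef
  have hσκ : 1 - (1 / 2 : ℝ) < σ := by rw [hσdef]; linarith only [hτ]
  have hσ1 : σ < 1 := by rw [hσdef]; linarith only [hτ0]
  have hσκ' : 1 - (1 / 2 : ℝ) < ((σ : ℂ)).re := by simpa using hσκ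
  have hσ1' : (σ : ℂ) ≠ 1 := by
    intro h; have := congrArg Complex.re h; simp at this; linarith only [this, hσ1]
  -- `F(σ) = ζ(σ) L(σ, χ) = 0`, hence `Φ(σ) = aσ/(σ−1) + σ I(σ) = 0`
  have hΦ0 : (a : ℂ) * σ / ((σ : ℂ) - 1) + σ * I σ = 0 := by
    have hs1' : (σ : ℂ) - 1 ≠ 0 := sub_ne_zero.mpr hσ1'
    have hGs := continuation_eq hf hR hRb hκ hI hGd hGL hσκ'
    rw [hG] at hGs
    have : riemannZeta σ * χ.LFunction σ = a * σ / ((σ : ℂ) - 1) + σ * I σ := by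
      rw [riemannZeta_eq_inv_sub_mul hσ1', mul_assoc, hGs]
      field_simp
    rw [← this, hz, mul_zero]
  have hΦre : a * σ / (σ - 1) + σ * ∫ t in Ioi (1 : ℝ), R t * t ^ (-(σ + 1)) = 0 := by
    have h := congrArg Complex.re hΦ0
    rw [remainderIntegral_ofReal hI σ] at h
    have e1 : ((a : ℂ) * σ / ((σ : ℂ) - 1)) = (((a * σ / (σ - 1) : ℝ)) : ℂ) := by push_cast; ring
    rw [e1, ← Complex.ofReal_mul, ← Complex.ofReal_add, Complex.ofReal_re, Complex.zero_re] at h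
    exact h
  -- the identity and the tail bounds
  have hid := sum_mul_rpow_neg_eq_continuation hf0 hR hRb hI hσκ hσ1 hN1
  have hα : 0 < σ + 1 / 2 - 1 := by linarith only [hσκ]
  have hBN : ∀ t : ℝ, (N : ℝ) ≤ t → |R t| ≤ 5 * Real.sqrt A * t ^ (1 - (1 / 2 : ℝ)) := hB
  obtain ⟨hT1, hT2⟩ := abs_tail_le' hN1 hBN hR hα
  have hακ : σ + 1 / 2 - 1 = 1 / 2 - τ := by rw [hσdef]; ring
  have h1σ : 1 - σ = τ := by rw [hσdef]; ring
  have hsum : ∑ k ∈ Icc 1 N, charDivisorSum χ k * (k : ℝ) ^ (-(1 - τ)) =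
      ∑ k ∈ Icc 1 N, f k * (k : ℝ) ^ (-σ) := by
    refine sum_congr rfl fun k _ => ?_; rw [hfdef]
  rw [hsum, hid, hΦre, zero_add, h1σ, ← hadef]
  have hσ0 : 0 ≤ σ := by rw [hσdef]; linarith only [hτ]
  have hN0r : (0 : ℝ) < N := by linarith
  have hsA0 : 0 ≤ 5 * Real.sqrt A := by positivity
  set J : ℝ := ∫ t in Ioi (N : ℝ), R t * t ^ (-(σ + 1)) with hJ
  rw [show a * (N : ℝ) ^ τ / τ + R N * (N : ℝ) ^ (-σ) - σ * J - a * (N : ℝ) ^ τ / τ =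
      R N * (N : ℝ) ^ (-σ) - σ * J by ring]
  calc |R N * (N : ℝ) ^ (-σ) - σ * J|
      ≤ |R N * (N : ℝ) ^ (-σ)| + |σ * J| := abs_sub _ _
    _ ≤ 5 * Real.sqrt A * (N : ℝ) ^ (-(σ + 1 / 2 - 1)) +
          σ * (5 * Real.sqrt A * (N : ℝ) ^ (-(σ + 1 / 2 - 1)) / (σ + 1 / 2 - 1)) := by
        refine add_le_add hT1 ?_
        rw [abs_mul, abs_of_nonneg hσ0]
        exact mul_le_mul_of_nonneg_left hT2 hσ0
    _ ≤ 5 * Real.sqrt A * (N : ℝ) ^ (-(σ + 1 / 2 - 1)) +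
          1 * (5 * Real.sqrt A * (N : ℝ) ^ (-(σ + 1 / 2 - 1)) / (σ + 1 / 2 - 1)) := by
        have hX : 0 ≤ 5 * Real.sqrt A * (N : ℝ) ^ (-(σ + 1 / 2 - 1)) / (σ + 1 / 2 - 1) :=
          div_nonneg (mul_nonneg hsA0 (Real.rpow_nonneg hN0r.le _)) hα.le
        nlinarith [hX, hσ1.le]
    _ = 5 * Real.sqrt A * (N : ℝ) ^ (-(1 / 2 - τ)) * (1 + 1 / (1 / 2 - τ)) := by
        rw [hακ]; ring

/-- **(2.10)–(2.11), the weighted sum against `Σ_{n ≤ N} g(n)/n`.** With the weights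
`(k/N)^τ ∈ [N^{−τ}, 1]` and `g ≥ 0`:
`N^{−τ} Σ_{k ≤ N} g(k)/k ≤ N^{−τ} Σ_{k ≤ N} g(k) k^{−(1−τ)} ≤ Σ_{k ≤ N} g(k)/k`.
[cite: Pintz1976ElementaryII, §2 (2.10)–(2.12) pp. 281–282] -/
theorem weighted_sum_bracket (hq : χ ^ 2 = 1) {N : ℕ} (hN : 1 ≤ N) {τ : ℝ} (hτ0 : 0 ≤ τ) :
    (N : ℝ) ^ (-τ) * gSum χ (N : ℝ) ≤
        (N : ℝ) ^ (-τ) * ∑ k ∈ Icc 1 N, charDivisorSum χ k * (k : ℝ) ^ (-(1 - τ)) ∧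
      (N : ℝ) ^ (-τ) * ∑ k ∈ Icc 1 N, charDivisorSum χ k * (k : ℝ) ^ (-(1 - τ)) ≤
        gSum χ (N : ℝ) := by
  have hN0 : (0 : ℝ) < N := by exact_mod_cast (lt_of_lt_of_le zero_lt_one hN)
  have hNτ : 0 < (N : ℝ) ^ (-τ) := Real.rpow_pos_of_pos hN0 _
  rw [gSum_natCast, mul_sum, mul_sum]
  constructor
  · refine sum_le_sum fun k hk => ?_
    rw [Finset.mem_Icc] at hk
    have hk0 : (0 : ℝ) < k := by exact_mod_cast hk.1
    have hg := g_nonneg χ hq k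
    rw [g_eq_charDivisorSum] at hg ⊢
    -- `N^{−τ} g(k)/k ≤ N^{−τ} g(k) k^{−(1−τ)}` since `k^{−1} ≤ k^{−(1−τ)}` (`k ≥ 1`, `τ ≥ 0`)
    have hpow : 1 / (k : ℝ) ≤ (k : ℝ) ^ (-(1 - τ)) := by
      rw [one_div, ← Real.rpow_neg_one]
      exact Real.rpow_le_rpow_of_exponent_le (by exact_mod_cast hk.1) (by linarith)
    rw [div_eq_mul_one_div]
    exact mul_le_mul_of_nonneg_left (mul_le_mul_of_nonneg_left hpow hg) hNτ.le
  · refine sum_le_sum fun k hk => ?_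
    rw [Finset.mem_Icc] at hk
    have hk0 : (0 : ℝ) < k := by exact_mod_cast hk.1
    have hg := g_nonneg χ hq k
    rw [g_eq_charDivisorSum] at hg ⊢
    -- `N^{−τ} k^{−(1−τ)} = (k/N)^τ / k ≤ 1/k`
    have hkN : (k : ℝ) ^ τ ≤ (N : ℝ) ^ τ :=
      Real.rpow_le_rpow hk0.le (by exact_mod_cast hk.2) hτ0
    have hNτ' : (N : ℝ) ^ (-τ) * (N : ℝ) ^ τ = 1 := by
      rw [← Real.rpow_add hN0]; simp
    have hsplit : (k : ℝ) ^ (-(1 - τ)) = (k : ℝ) ^ τ * (1 / k) := by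
      rw [show -(1 - τ) = τ + (-1) by ring, Real.rpow_add hk0, Real.rpow_neg_one, one_div]
    rw [hsplit]
    calc (N : ℝ) ^ (-τ) * (charDivisorSum χ k * ((k : ℝ) ^ τ * (1 / k)))
        = charDivisorSum χ k * (1 / k) * ((N : ℝ) ^ (-τ) * (k : ℝ) ^ τ) := by ring
      _ ≤ charDivisorSum χ k * (1 / k) * ((N : ℝ) ^ (-τ) * (N : ℝ) ^ τ) := by
          refine mul_le_mul_of_nonneg_left (mul_le_mul_of_nonneg_left hkN hNτ.le) ?_
          exact mul_nonneg hg (by positivity)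
      _ = charDivisorSum χ k / k := by rw [hNτ', mul_one, mul_one_div]

end EngineAtZero

/-! ## Part D. The theorem of Hecke [11], quantitatively: `L(1) ≤ η/log D` forces a real zero in
`[1 − 2e^{3/2}η/log D, 1]` (kernel: Pintz 1977 VIII Theorem 2, `pintz1977RealZeros_theorem2_holds`)

PRINT (p. 275 / p. 282): "for the Siegel-zero `1 − δ` of `L(s)` (which exists by the theorem of
Hecke [11])"; "Since by the theorem of Hecke [11] we have `δ = o(1/log D)`, it follows (2.11)
`1 ≥ (n/x)^δ ≥ 1/x^δ = 1/D^{2δ} = 1/e^{2δ log D} = 1/e^{o(1)} = 1 − o(1)`." -/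

section Hecke

/-- **Hecke, contrapositive and quantitative.** There is `D₀` such that for `D ≥ D₀`, every real
non-principal `χ` mod `D` and every `0 < b ≤ 1/log D` with `L(1, χ) ≤ ½e^{−3/2} b`, the function
`L(s, χ)` has a real zero in `[1 − b, 1)`. (From the tree's discharge of Pintz 1977 VIII, Theorem 2:
no zero on `[1 − b, 1]` ⟹ `L(1, χ) > (1 − η)e^{−3/2} b`, here with `η = ½`.)
[cite: Pintz1976ElementaryII, Theorem 1 p. 275 ("which exists by the theorem of Hecke [11]")]
[cite: Pintz1977ElementaryVIII, Theorem 2 p. 89] -/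
theorem exists_realZero_of_lOne_le :
    ∃ D₀ : ℕ, ∀ (D : ℕ) [NeZero D], D₀ ≤ D → ∀ χ : DirichletCharacter ℂ D, χ ^ 2 = 1 → χ ≠ 1 →
      ∀ b : ℝ, 0 < b → b ≤ 1 / Real.log D →
        (χ.LFunction 1).re ≤ Real.exp (-3 / 2) / 2 * b →
          ∃ β : ℝ, 1 - b ≤ β ∧ β < 1 ∧ χ.LFunction (β : ℂ) = 0 := by
  obtain ⟨D₀, hD₀⟩ := pintz1977RealZeros_theorem2_holds (1 / 2) (by norm_num)
  refine ⟨D₀, fun D _ hD χ hq hχ b hb0 hb hL => ?_⟩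
  have hquad : χ.IsQuadratic := MulChar.isQuadratic_iff_sq_eq_one.mpr hq
  by_contra hne
  push Not at hne
  -- no zero on `[1 − b, 1]`: at `σ < 1` by `hne`, at `σ = 1` by non-vanishing
  have hfree : ∀ σ : ℝ, 1 - b ≤ σ → σ ≤ 1 → χ.LFunction (σ : ℂ) ≠ 0 := by
    intro σ h1 h2
    rcases lt_or_eq_of_le h2 with hlt | heq
    · exact hne σ h1 hlt
    · rw [heq, ofReal_one]; exact χ.LFunction_apply_one_ne_zero hχ
  have h := hD₀ D hD χ hquad hχ b hb0 hb hfree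
  have : (1 - 1 / 2 : ℝ) * Real.exp (-3 / 2) * b = Real.exp (-3 / 2) / 2 * b := by ring
  linarith

end Hecke

/-! ## Part E. Lemma 1 in the form (2.3): `Σ_{n ≤ D²} g(n)/n = L'(1) + (log D² + c) L(1) + o(1)`

PRINT (p. 280, (2.3)): "If `L(1) = o(1/log D)` then from Lemma 1 we get
`Σ_{n ≤ D²} g(n)/n = L'(1) + o(1)`." HERE the explicit form of Lemma 1 is the tree's
Montgomery–Vaughan Exercise 11.2.3(g) (`DirichletAbel.norm_sum_divisorSum_div_sub_le_polyaVinogradov`,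
see the READING NOTE on `pintz1976_lemma1` in the statement file: the printed constant `5` of (2.1)
is not what p. 280 proves, and Theorem 1 only needs the `o(1)` form), at `N = D²`, `Y = D`. -/

section LemmaOne

variable {D : ℕ} [NeZero D] (χ : DirichletCharacter ℂ D)

/-- **(2.3) with an explicit error**: for a primitive `χ` mod `D ≥ 2`,
`|Σ_{n ≤ D²} g(n)/n − L'(1) − (2 log D + γ) L(1)| ≤ 8√D(1 + log D)(2 log D + 1)/(D + 1) + 4/D`
(real parts of `L(1, χ)`, `L'(1, χ)`). [cite: Pintz1976ElementaryII, Lemma 1 (2.1) p. 279 and (2.3) p. 280]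
[cite: MontgomeryVaughan2007, §11.2.1 Exercise 3(g)] -/
theorem abs_gSum_sq_sub_le (hprim : χ.IsPrimitive) (hD : 2 ≤ D) :
    |gSum χ ((D : ℝ) ^ 2) - (deriv χ.LFunction 1).re -
        (2 * Real.log D + Real.eulerMascheroniConstant) * (χ.LFunction 1).re| ≤
      8 * (Real.sqrt D * (1 + Real.log D)) * (2 * Real.log D + 1) / ((D : ℝ) + 1) +
        4 / (D : ℝ) := by
  have hD1 : 1 ≤ D := le_trans (by norm_num) hD
  have hYN : D ≤ D ^ 2 := by nlinarith
  have h := norm_sum_divisorSum_div_sub_le_polyaVinogradov χ hD hprim (N := D ^ 2) (Y := D) hD hYN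
  have hlogN : Real.log ((D ^ 2 : ℕ) : ℝ) = 2 * Real.log D := by
    push_cast; rw [Real.log_pow]; push_cast; ring
  rw [hlogN] at h
  -- real parts
  have hre : (∑ n ∈ Icc 1 (D ^ 2), (∑ d ∈ n.divisors, χ (d : ZMod D)) / (n : ℂ)).re =
      gSum χ ((D : ℝ) ^ 2) := by
    rw [gSum_sq, Complex.re_sum]
    refine sum_congr rfl fun n _ => ?_
    rw [g, Complex.div_natCast_re]
  have hre2 : ((((2 * Real.log D + Real.eulerMascheroniConstant : ℝ) : ℂ) * χ.LFunction 1 +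
      deriv χ.LFunction 1)).re =
      (2 * Real.log D + Real.eulerMascheroniConstant) * (χ.LFunction 1).re +
        (deriv χ.LFunction 1).re := by
    rw [Complex.add_re, Complex.re_ofReal_mul]
  have hD0 : (0 : ℝ) < D := by exact_mod_cast (lt_of_lt_of_le (by norm_num) hD1)
  have hcast : (4 : ℝ) * (D : ℝ) / ((D ^ 2 : ℕ) : ℝ) = 4 / (D : ℝ) := by
    push_cast; field_simp
  calc |gSum χ ((D : ℝ) ^ 2) - (deriv χ.LFunction 1).re -
        (2 * Real.log D + Real.eulerMascheroniConstant) * (χ.LFunction 1).re|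
      = |((∑ n ∈ Icc 1 (D ^ 2), (∑ d ∈ n.divisors, χ (d : ZMod D)) / (n : ℂ)) -
          ((((2 * Real.log D + Real.eulerMascheroniConstant : ℝ) : ℂ) * χ.LFunction 1 +
            deriv χ.LFunction 1))).re| := by
        rw [Complex.sub_re, hre, hre2]; congr 1; ring
    _ ≤ ‖(∑ n ∈ Icc 1 (D ^ 2), (∑ d ∈ n.divisors, χ (d : ZMod D)) / (n : ℂ)) -
          ((((2 * Real.log D + Real.eulerMascheroniConstant : ℝ) : ℂ) * χ.LFunction 1 +
            deriv χ.LFunction 1))‖ := abs_re_le_norm _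
    _ ≤ 8 * (Real.sqrt D * (1 + Real.log D)) * (2 * Real.log D + 1) / ((D : ℝ) + 1) +
          4 * (D : ℝ) / ((D ^ 2 : ℕ) : ℝ) := h
    _ = _ := by rw [hcast]

end LemmaOne

/-! ## Part F. The elementary limits (`o(1)` terms made explicit) -/

section Limits

/-- `log x ≤ 8 x^{1/8}` (`x ≥ 0`). [folklore] -/
private theorem log_le_eight_mul_rpow {x : ℝ} (hx : 0 ≤ x) : Real.log x ≤ 8 * x ^ ((1 : ℝ) / 8) := by
  have h := Real.log_le_rpow_div hx (by norm_num : (0 : ℝ) < 1 / 8)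
  calc Real.log x ≤ x ^ ((1 : ℝ) / 8) / (1 / 8) := h
    _ = 8 * x ^ ((1 : ℝ) / 8) := by ring

/-- The two error terms of the proof are small: for every `ε > 0` there is `D₁` such that for all
`D ≥ D₁` (`D ≥ 1`), the Lemma-1 error `8√D(1+log D)(2 log D+1)/(D+1) + 4/D ≤ ε` and the Lemma-2
error `25 √(√D(1 + log D)) (D²)^{−1/4} ≤ ε`. (With `u = D^{1/8}`: both are `≤ 1228/u`.) [folklore] -/
private theorem errors_le {ε : ℝ} (hε : 0 < ε) :
    ∃ D₁ : ℕ, ∀ D : ℕ, D₁ ≤ D → 1 ≤ D →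
      8 * (Real.sqrt D * (1 + Real.log D)) * (2 * Real.log D + 1) / ((D : ℝ) + 1) + 4 / (D : ℝ)
          ≤ ε ∧
        25 * Real.sqrt (Real.sqrt D * (1 + Real.log D)) * ((D ^ 2 : ℕ) : ℝ) ^ (-(1 / 4 : ℝ))
          ≤ ε := by
  refine ⟨⌈((1228 : ℝ) / ε) ^ 8⌉₊, fun D hD hD1 => ?_⟩
  have hD1r : (1 : ℝ) ≤ D := by exact_mod_cast hD1
  have hD0 : (0 : ℝ) < D := by linarith
  set u : ℝ := (D : ℝ) ^ ((1 : ℝ) / 8) with hu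
  have hu0 : 0 < u := Real.rpow_pos_of_pos hD0 _
  have hu1 : 1 ≤ u := Real.one_le_rpow hD1r (by norm_num)
  have hu8 : u ^ 8 = (D : ℝ) := by
    rw [hu, ← Real.rpow_mul_natCast hD0.le]; norm_num
  have hsqrt : Real.sqrt D = u ^ 4 := by
    rw [← hu8, show u ^ 8 = (u ^ 4) ^ 2 by ring, Real.sqrt_sq (by positivity)]
  have hlog : Real.log D ≤ 8 * u := log_le_eight_mul_rpow hD0.le
  have hlog0 : 0 ≤ Real.log D := Real.log_nonneg hD1r
  -- `u ≥ 1228/ε`, i.e. `1228/u ≤ ε`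
  have huε : 1228 / ε ≤ u := by
    have h1 : ((1228 : ℝ) / ε) ^ 8 ≤ D := le_trans (Nat.le_ceil _) (by exact_mod_cast hD)
    rw [← hu8] at h1
    exact le_of_pow_le_pow_left₀ (by norm_num) hu0.le h1
  have hεu : 1228 / u ≤ ε := by
    rw [div_le_iff₀ hu0]; rw [div_le_iff₀ hε] at huε; linarith
  have hu2 : u ≤ u ^ 2 := by nlinarith
  have hu8' : u ≤ u ^ 8 := le_self_pow₀ hu1 (by norm_num)
  constructor
  · have h1 : 1 + Real.log D ≤ 9 * u := by linarith
    have h2 : 2 * Real.log D + 1 ≤ 17 * u := by linarith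
    have hfrac : Real.sqrt D / ((D : ℝ) + 1) ≤ 1 / u ^ 4 := by
      rw [hsqrt, ← hu8, div_le_div_iff₀ (by positivity) (by positivity)]
      nlinarith [pow_pos hu0 4]
    have hprod : (1 + Real.log D) * (2 * Real.log D + 1) ≤ (9 * u) * (17 * u) :=
      mul_le_mul h1 h2 (by linarith) (by linarith)
    have hXY : (1 + Real.log D) * (2 * Real.log D + 1) * (Real.sqrt D / ((D : ℝ) + 1)) ≤
        (9 * u) * (17 * u) * (1 / u ^ 4) :=
      mul_le_mul hprod hfrac (by positivity) (by positivity)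
    have h4 : 4 / (D : ℝ) = 4 / u ^ 8 := by rw [hu8]
    calc 8 * (Real.sqrt D * (1 + Real.log D)) * (2 * Real.log D + 1) / ((D : ℝ) + 1) + 4 / (D : ℝ)
        = 8 * ((1 + Real.log D) * (2 * Real.log D + 1) * (Real.sqrt D / ((D : ℝ) + 1))) +
            4 / (D : ℝ) := by ring
      _ ≤ 8 * ((9 * u) * (17 * u) * (1 / u ^ 4)) + 4 / u ^ 8 := by rw [h4]; linarith
      _ = 1224 / u ^ 2 + 4 / u ^ 8 := by field_simp; ring
      _ ≤ 1224 / u + 4 / u :=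
          add_le_add (div_le_div_of_nonneg_left (by norm_num) hu0 hu2)
            (div_le_div_of_nonneg_left (by norm_num) hu0 hu8')
      _ = 1228 / u := by ring
      _ ≤ ε := hεu
  · have hA : Real.sqrt D * (1 + Real.log D) ≤ (3 * u ^ 3) ^ 2 := by
      rw [hsqrt]
      have : u ^ 4 * (1 + Real.log D) ≤ u ^ 4 * (9 * u) :=
        mul_le_mul_of_nonneg_left (by linarith) (by positivity)
      nlinarith [pow_le_pow_right₀ hu1 (show 5 ≤ 6 by norm_num)]
    have hsA : Real.sqrt (Real.sqrt D * (1 + Real.log D)) ≤ 3 * u ^ 3 :=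
      Real.sqrt_le_iff.mpr ⟨by positivity, hA⟩
    have hN : ((D ^ 2 : ℕ) : ℝ) ^ (-(1 / 4 : ℝ)) = 1 / u ^ 4 := by
      push_cast
      rw [← hu8, ← pow_mul, show (8 * 2 : ℕ) = 16 by norm_num, ← Real.rpow_natCast u 16,
        ← Real.rpow_mul hu0.le, show ((16 : ℕ) : ℝ) * (-(1 / 4 : ℝ)) = -(4 : ℕ) by norm_num,
        Real.rpow_neg hu0.le, Real.rpow_natCast, one_div]
    rw [hN]
    calc 25 * Real.sqrt (Real.sqrt D * (1 + Real.log D)) * (1 / u ^ 4)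
        ≤ 25 * (3 * u ^ 3) * (1 / u ^ 4) := by gcongr
      _ = 75 / u := by field_simp; ring
      _ ≤ 1228 / u := div_le_div_of_nonneg_right (by norm_num) hu0.le
      _ ≤ ε := hεu

/-- Partial sums of `ζ(2)`: for every `ε > 0`, `Σ_{l ≤ L} 1/l² ≥ π²/6 − ε` for `L ≥ L₀(ε)`.
[cite: Pintz1976ElementaryII, §2 (2.8) p. 281 ("`Σ_{l² ≤ D} 1/l² = π²/6 − o(1)`")] -/
private theorem zeta_two_partial_ge {ε : ℝ} (hε : 0 < ε) :
    ∃ L₀ : ℕ, ∀ L : ℕ, L₀ ≤ L → Real.pi ^ 2 / 6 - ε ≤ ∑ l ∈ Icc 1 L, 1 / (l : ℝ) ^ 2 := by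
  have ht := hasSum_zeta_two.tendsto_sum_nat
  have hev := ht.eventually_const_lt (show Real.pi ^ 2 / 6 - ε < Real.pi ^ 2 / 6 by linarith)
  obtain ⟨N₀, hN₀⟩ := eventually_atTop.mp hev
  refine ⟨N₀, fun L hL => ?_⟩
  have h := hN₀ (L + 1) (by omega)
  have hre : ∑ i ∈ Finset.range (L + 1), 1 / (i : ℝ) ^ 2 = ∑ l ∈ Icc 1 L, 1 / (l : ℝ) ^ 2 := by
    rw [Finset.sum_range_succ', Icc_one_eq_Ioc_zero', sum_Ioc_eq_sum_range_succ]
    simp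
  rw [hre] at h
  exact h.le

/-- `∏_{p ∣ D} (1 + 1/p) ≥ 1`. [folklore] -/
private theorem one_le_prod_primeFactors (D : ℕ) :
    1 ≤ ∏ p ∈ D.primeFactors, (1 + 1 / (p : ℝ)) := by
  calc (1 : ℝ) = ∏ _p ∈ D.primeFactors, (1 : ℝ) := by simp
    _ ≤ ∏ p ∈ D.primeFactors, (1 + 1 / (p : ℝ)) :=
        prod_le_prod (fun _ _ => zero_le_one) fun p _ => by
          have : (0 : ℝ) ≤ 1 / (p : ℝ) := by positivity
          linarith

/-- `Σ_{l ≤ L} 1/l² ≥ 1` for `L ≥ 1` (the term `l = 1`). [folklore] -/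
private theorem one_le_sum_inv_sq {L : ℕ} (hL : 1 ≤ L) : 1 ≤ ∑ l ∈ Icc 1 L, 1 / (l : ℝ) ^ 2 := by
  have h1 : (1 : ℕ) ∈ Finset.Icc 1 L := by rw [Finset.mem_Icc]; omega
  have h := Finset.single_le_sum (f := fun l : ℕ => 1 / (l : ℝ) ^ 2) (fun l _ => by positivity) h1
  simpa using h

end Limits

/-! ## Part G. Assembly: the proof of Theorem 1 (pp. 279–282)

PRINT (p. 282): "Since by the theorem of Hecke [11] we have `δ = o(1/log D)`, it follows (2.11)
`1 ≥ (n/x)^δ ≥ … = 1 − o(1)`. Thus as `g(n) ≥ 0`, from (2.10) and (2.11) we get (2.12)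
`L(1)/δ ∼ Σ_{n ≤ D²} (g(n)/n)(n/x)^δ = Σ_{n ≤ D²} (g(n)/n)(1 − o(1)) ∼ Σ_{n ≤ D²} g(n)/n`.
The assertion of Theorem 1 follows from (2.3), (2.8) and (2.12)."
HERE with explicit budgets: `η = ½e^{−3/2} ε₁`, `ε₁ = min(ε,1)/64`; `δ log D ≤ ε₁`;
`(D²)^{−δ} ≥ 1 − 2ε₁`; Lemma-1 and Lemma-2 errors `≤ ε₁`; `Σ ≥ 1`. -/

section Assembly

/-- For `q ≥ 3`, `1 < log q`. [folklore] -/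
private theorem one_lt_log_of_three_le' {q : ℕ} (hq : 3 ≤ q) : 1 < Real.log q := by
  have hq3 : (3 : ℝ) ≤ (q : ℝ) := by exact_mod_cast hq
  have hlog3 : 1 < Real.log 3 := by
    have h := Real.exp_one_lt_d9
    rw [Real.lt_log_iff_exp_lt (by norm_num)]
    linarith
  exact lt_of_lt_of_le hlog3 (Real.log_le_log (by norm_num) hq3)

/-- (2.12) as real arithmetic: if `|w − M| ≤ e`, `tS ≤ w ≤ S` with `1 − 2e ≤ t` and `S ≥ 0`, then
`|M − S| ≤ 2eS + e`. [cite: Pintz1976ElementaryII, §2 (2.12) p. 282] -/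
private theorem abs_sub_le_of_bracket {S w M t e : ℝ} (hS : 0 ≤ S) (hw : |w - M| ≤ e)
    (h1 : t * S ≤ w) (h2 : w ≤ S) (ht : 1 - 2 * e ≤ t) : |M - S| ≤ 2 * e * S + e := by
  obtain ⟨hw1, hw2⟩ := abs_le.mp hw
  rw [abs_le]
  constructor
  · nlinarith
  · nlinarith

/-- The final budget: from `|S − L'(1) − cL(1)| ≤ e` (Lemma 1), `|L(1)/δ − S| ≤ 2eS + e` (Lemma 2
and (2.11)), `0 ≤ cL(1) ≤ 3η`, `η ≤ e/2`, `S ≥ 1` and `64e ≤ min(ε, 1)`, the two asymptotic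
relations of (1.17) with accuracy `ε`. [cite: Pintz1976ElementaryII, §2 p. 282 ("The assertion of
Theorem 1 follows from (2.3), (2.8) and (2.12).")] -/
private theorem ratios_of_budget {ε e η S L1 L1' δ c : ℝ} (hε : 0 < ε) (h64 : 64 * e ≤ ε)
    (h64' : 64 * e ≤ 1) (hS : 1 ≤ S) (hL1 : 0 < L1) (hδ : 0 < δ)
    (h23 : |S - L1' - c * L1| ≤ e) (hc0 : 0 ≤ c * L1) (hc : c * L1 ≤ 3 * η) (hη : η ≤ e / 2)
    (hMS : |L1 / δ - S| ≤ 2 * e * S + e) :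
    |δ * L1' / L1 - 1| ≤ ε ∧ |L1 / δ / S - 1| ≤ ε := by
  have hM : 0 < L1 / δ := div_pos hL1 hδ
  have hS0 : 0 < S := by linarith
  obtain ⟨hMS1, hMS2⟩ := abs_le.mp hMS
  obtain ⟨h231, h232⟩ := abs_le.mp h23
  constructor
  · -- `|L'(1) − L(1)/δ| ≤ e + (2eS + e) + 3η ≤ 8eS`, and `L(1)/δ ≥ S/2`
    have hkey : |L1' - L1 / δ| ≤ 8 * e * S := by
      rw [abs_le]; constructor <;> nlinarith
    have hMlow : S / 2 ≤ L1 / δ := by nlinarith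
    have hratio : δ * L1' / L1 - 1 = (L1' - L1 / δ) / (L1 / δ) := by
      field_simp
    rw [hratio, abs_div, abs_of_pos hM, div_le_iff₀ hM]
    calc |L1' - L1 / δ| ≤ 8 * e * S := hkey
      _ ≤ ε * (S / 2) := by nlinarith
      _ ≤ ε * (L1 / δ) := mul_le_mul_of_nonneg_left hMlow hε.le
  · have hratio : L1 / δ / S - 1 = (L1 / δ - S) / S := by field_simp
    rw [hratio, abs_div, abs_of_pos hS0, div_le_iff₀ hS0]
    calc |L1 / δ - S| ≤ 2 * e * S + e := hMS
      _ ≤ 3 * e * S := by nlinarith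
      _ ≤ ε * S := by nlinarith

/-- **Pintz 1976 (II), Theorem 1 — PROVED.** [cite: Pintz1976ElementaryII, Theorem 1 p. 275
(1.16)–(1.17); proof §2 pp. 279–282] -/
theorem theorem1 : pintz1976_theorem1 := by
  intro ε hε
  -- budgets: `e = min(ε,1)/64`, `η = ½e^{−3/2} e`
  obtain ⟨e, he⟩ : ∃ e : ℝ, e = min ε 1 / 64 := ⟨_, rfl⟩
  have he0 : 0 < e := by rw [he]; positivity
  have heε : 64 * e ≤ ε := by rw [he]; linarith [min_le_left ε 1]
  have he1 : 64 * e ≤ 1 := by rw [he]; linarith [min_le_right ε 1]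
  have hcH0 : 0 < Real.exp (-3 / 2) / 2 := by positivity
  have hcH1 : Real.exp (-3 / 2) / 2 ≤ 1 / 2 := by
    have : Real.exp (-3 / 2) ≤ 1 := Real.exp_le_one_iff.mpr (by norm_num)
    linarith
  obtain ⟨η, hη⟩ : ∃ η : ℝ, η = Real.exp (-3 / 2) / 2 * e := ⟨_, rfl⟩
  have hη0 : 0 < η := by rw [hη]; exact mul_pos hcH0 he0
  have hηe : η ≤ e / 2 := by rw [hη]; nlinarith
  -- thresholds
  obtain ⟨DH, hDH⟩ := exists_realZero_of_lOne_le
  obtain ⟨D₁, hD₁⟩ := errors_le he0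
  obtain ⟨L₀, hL₀⟩ := zeta_two_partial_ge hε
  refine ⟨η, hη0, max (max DH D₁) (max 3 (L₀ ^ 2)), fun D _ hD χ hquad hprim hL1 => ?_⟩
  have hDH' : DH ≤ D := le_trans (le_trans (le_max_left _ _) (le_max_left _ _)) hD
  have hD₁' : D₁ ≤ D := le_trans (le_trans (le_max_right _ _) (le_max_left _ _)) hD
  have hD3 : 3 ≤ D := le_trans (le_trans (le_max_left _ _) (le_max_right _ _)) hD
  have hDL : L₀ ^ 2 ≤ D := le_trans (le_trans (le_max_right _ _) (le_max_right _ _)) hD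
  have hD2 : 2 ≤ D := le_trans (by norm_num) hD3
  have hD1 : 1 ≤ D := le_trans (by norm_num) hD3
  have hD1r : (1 : ℝ) ≤ D := by exact_mod_cast hD1
  have hD0r : (0 : ℝ) < D := by linarith only [hD1r]
  -- the character
  have hq : χ ^ 2 = 1 := MulChar.IsQuadratic.sq_eq_one hquad
  have hχ : χ ≠ 1 := by
    rintro rfl
    rw [DirichletCharacter.isPrimitive_def, DirichletCharacter.conductor_one] at hprim
    omega
  have hlogD : 1 < Real.log D := one_lt_log_of_three_le' hD3
  have hlogD0 : 0 < Real.log D := by linarith only [hlogD]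
  have hL1pos : 0 < (χ.LFunction 1).re := Siegel.LFunction_one_re_pos χ hχ hq
  have hL1le : (χ.LFunction 1).re ≤ η / Real.log D := by rw [le_div_iff₀ hlogD0]; exact hL1
  -- Hecke: a zero in `[1 − b, 1)`, `b = e/log D ≤ 1/log D`
  obtain ⟨b, hb⟩ : ∃ b : ℝ, b = e / Real.log D := ⟨_, rfl⟩
  have hb0 : 0 < b := by rw [hb]; exact div_pos he0 hlogD0
  have hb1 : b ≤ 1 / Real.log D := by
    rw [hb]; exact div_le_div_of_nonneg_right (by linarith only [he1, he0]) hlogD0.le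
  have hL1b : (χ.LFunction 1).re ≤ Real.exp (-3 / 2) / 2 * b := by
    rw [hb, mul_div_assoc', ← hη]; exact hL1le
  obtain ⟨β₀, hβ₀1, hβ₀2, hβ₀z⟩ := hDH D hDH' χ hq hχ b hb0 hb1 hL1b
  refine ⟨⟨β₀, by linarith only [hβ₀1, hb1], hβ₀2, hβ₀z⟩, fun β hβ => ?_⟩
  -- the greatest real zero `β = 1 − δ`, `0 < δ ≤ b`
  have hβ0β : β₀ ≤ β := by
    by_contra hlt
    exact hβ.2.2 β₀ (lt_of_not_ge hlt) hβ₀2 hβ₀z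
  have hδ0 : 0 < 1 - β := by linarith only [hβ.1]
  have hδlog : (1 - β) * Real.log D ≤ e := by
    have h1 : 1 - β ≤ b := by linarith only [hβ0β, hβ₀1]
    calc (1 - β) * Real.log D ≤ b * Real.log D := mul_le_mul_of_nonneg_right h1 hlogD0.le
      _ = e := by rw [hb]; field_simp
  have hδe : 1 - β ≤ e := by nlinarith only [hδlog, hlogD, hδ0]
  have hδ4 : 1 - β ≤ 1 / 4 := by linarith only [hδe, he1]
  have hz : χ.LFunction ((1 - (1 - β) : ℝ) : ℂ) = 0 := by
    rw [sub_sub_cancel]; exact hβ.2.1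
  -- (2.8): the sum `S = Σ_{n ≤ D²} g(n)/n ≥ ∏(1+1/p) Σ_{l ≤ √D} 1/l² ≥ 1`
  have hsqrt1 : 1 ≤ Nat.sqrt D := Nat.le_sqrt'.mpr (by simpa using hD1)
  have h28 := prod_mul_sum_inv_sq_le_gSum χ hq
  have hP1 := one_le_prod_primeFactors D
  have hsum1 := one_le_sum_inv_sq hsqrt1
  have hS1 : 1 ≤ gSum χ ((D : ℝ) ^ 2) := le_trans (by nlinarith only [hP1, hsum1]) h28
  -- (2.3): Lemma 1
  obtain ⟨hE₁, hE₂⟩ := hD₁ D hD₁' hD1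
  have h23 := (abs_gSum_sq_sub_le χ hprim hD2).trans hE₁
  -- (2.9)–(2.10): Lemma 2 at the zero, `N = D²`
  have hN1 : 1 ≤ D ^ 2 := Nat.one_le_pow _ _ hD1
  have hNr : ((D ^ 2 : ℕ) : ℝ) = (D : ℝ) ^ 2 := by push_cast; ring
  have hN1r : (1 : ℝ) ≤ ((D ^ 2 : ℕ) : ℝ) := by exact_mod_cast hN1
  have hN0r : (0 : ℝ) < ((D ^ 2 : ℕ) : ℝ) := by linarith only [hN1r]
  have hNA : Real.sqrt D * (1 + Real.log D) ≤ ((D ^ 2 : ℕ) : ℝ) := by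
    rw [hNr]
    have hlogle : Real.log D ≤ (D : ℝ) - 1 := by
      have := Real.add_one_le_exp (Real.log D)
      rw [Real.exp_log hD0r] at this; linarith only [this]
    have hsD : Real.sqrt D ≤ D := by
      rw [Real.sqrt_le_left (by linarith only [hD1r])]; nlinarith only [hD1r]
    calc Real.sqrt D * (1 + Real.log D) ≤ D * D :=
          mul_le_mul hsD (by linarith only [hlogle]) (by linarith only [Real.log_nonneg hD1r])
            hD0r.le
      _ = (D : ℝ) ^ 2 := by ring
  have heng := sum_charDivisorSum_rpow_of_zero χ hprim hq hD2 hNA hδ0 (by linarith only [hδ4]) hz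
  -- the Lemma-2 error is `≤ 25 √A (D²)^{−1/4} ≤ e`
  have hA0 : 0 ≤ Real.sqrt D * (1 + Real.log D) :=
    mul_nonneg (Real.sqrt_nonneg _) (by linarith only [Real.log_nonneg hD1r])
  have hErr : 5 * Real.sqrt (Real.sqrt D * (1 + Real.log D)) *
      ((D ^ 2 : ℕ) : ℝ) ^ (-(1 / 2 - (1 - β))) * (1 + 1 / (1 / 2 - (1 - β))) ≤ e := by
    have h1 : ((D ^ 2 : ℕ) : ℝ) ^ (-(1 / 2 - (1 - β))) ≤ ((D ^ 2 : ℕ) : ℝ) ^ (-(1 / 4 : ℝ)) :=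
      Real.rpow_le_rpow_of_exponent_le hN1r (by linarith only [hδ4])
    have h2 : 1 + 1 / (1 / 2 - (1 - β)) ≤ 5 := by
      have h14 : (1 : ℝ) / 4 ≤ 1 / 2 - (1 - β) := by linarith only [hδ4]
      have : 1 / (1 / 2 - (1 - β)) ≤ 1 / (1 / 4 : ℝ) :=
        one_div_le_one_div_of_le (by norm_num) h14
      linarith only [this]
    have h3 : 0 ≤ 5 * Real.sqrt (Real.sqrt D * (1 + Real.log D)) := by positivity
    have h4 : 0 ≤ ((D ^ 2 : ℕ) : ℝ) ^ (-(1 / 4 : ℝ)) := Real.rpow_nonneg hN0r.le _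
    have h5 : 0 ≤ 1 + 1 / (1 / 2 - (1 - β)) := by
      have : 0 ≤ 1 / (1 / 2 - (1 - β)) := by
        apply div_nonneg zero_le_one; linarith only [hδ4]
      linarith only [this]
    calc 5 * Real.sqrt (Real.sqrt D * (1 + Real.log D)) *
          ((D ^ 2 : ℕ) : ℝ) ^ (-(1 / 2 - (1 - β))) * (1 + 1 / (1 / 2 - (1 - β)))
        ≤ 5 * Real.sqrt (Real.sqrt D * (1 + Real.log D)) *
          ((D ^ 2 : ℕ) : ℝ) ^ (-(1 / 4 : ℝ)) * 5 :=
          mul_le_mul (mul_le_mul_of_nonneg_left h1 h3) h2 h5 (mul_nonneg h3 h4)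
      _ = 25 * Real.sqrt (Real.sqrt D * (1 + Real.log D)) * ((D ^ 2 : ℕ) : ℝ) ^ (-(1 / 4 : ℝ)) := by
          ring
      _ ≤ e := hE₂
  have hWM := heng.trans hErr
  -- (2.11): the weights `(n/x)^δ ∈ [N^{−δ}, 1]`, `N^{−δ} ≥ 1 − 2δ log D ≥ 1 − 2e`
  have hNδpos : 0 < ((D ^ 2 : ℕ) : ℝ) ^ (-(1 - β)) := Real.rpow_pos_of_pos hN0r _
  have hNδ1 : ((D ^ 2 : ℕ) : ℝ) ^ (-(1 - β)) ≤ 1 :=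
    Real.rpow_le_one_of_one_le_of_nonpos hN1r (by linarith only [hδ0])
  have hNδ : 1 - 2 * e ≤ ((D ^ 2 : ℕ) : ℝ) ^ (-(1 - β)) := by
    rw [Real.rpow_def_of_pos hN0r, hNr, Real.log_pow, Nat.cast_ofNat]
    have h := Real.add_one_le_exp (2 * Real.log D * -(1 - β))
    nlinarith only [h, hδlog]
  obtain ⟨hbr1, hbr2⟩ := weighted_sum_bracket χ hq hN1 hδ0.le
  rw [gSum_natCast] at hbr1 hbr2
  rw [← gSum_sq χ] at hbr1 hbr2
  -- `|N^{−δ} W − L(1)/δ| ≤ N^{−δ} e ≤ e`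
  have hWM' : |((D ^ 2 : ℕ) : ℝ) ^ (-(1 - β)) *
      (∑ k ∈ Icc 1 (D ^ 2), charDivisorSum χ k * (k : ℝ) ^ (-(1 - (1 - β)))) -
        (χ.LFunction 1).re / (1 - β)| ≤ e := by
    have hid : ((D ^ 2 : ℕ) : ℝ) ^ (-(1 - β)) *
        ((χ.LFunction 1).re * ((D ^ 2 : ℕ) : ℝ) ^ (1 - β) / (1 - β)) =
          (χ.LFunction 1).re / (1 - β) := by
      have : ((D ^ 2 : ℕ) : ℝ) ^ (-(1 - β)) * ((D ^ 2 : ℕ) : ℝ) ^ (1 - β) = 1 := by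
        rw [← Real.rpow_add hN0r]; simp
      calc ((D ^ 2 : ℕ) : ℝ) ^ (-(1 - β)) *
            ((χ.LFunction 1).re * ((D ^ 2 : ℕ) : ℝ) ^ (1 - β) / (1 - β))
          = (((D ^ 2 : ℕ) : ℝ) ^ (-(1 - β)) * ((D ^ 2 : ℕ) : ℝ) ^ (1 - β)) *
              (χ.LFunction 1).re / (1 - β) := by ring
        _ = (χ.LFunction 1).re / (1 - β) := by rw [this, one_mul]
    rw [← hid, ← mul_sub, abs_mul, abs_of_pos hNδpos]
    calc ((D ^ 2 : ℕ) : ℝ) ^ (-(1 - β)) *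
          |(∑ k ∈ Icc 1 (D ^ 2), charDivisorSum χ k * (k : ℝ) ^ (-(1 - (1 - β)))) -
            (χ.LFunction 1).re * ((D ^ 2 : ℕ) : ℝ) ^ (1 - β) / (1 - β)|
        ≤ 1 * e := mul_le_mul hNδ1 hWM (abs_nonneg _) zero_le_one
      _ = e := one_mul _
  -- (2.12): `|L(1)/δ − S| ≤ 2eS + e`
  have hMS := abs_sub_le_of_bracket (by linarith only [hS1]) hWM' hbr1 hbr2 hNδ
  -- conclusions (b1), (b2) from the budget lemma; (c) from (2.8) and `ζ(2)`
  have hγ1 : Real.eulerMascheroniConstant < 1 :=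
    Real.eulerMascheroniConstant_lt_two_thirds.trans (by norm_num)
  have hγ0 : 0 < Real.eulerMascheroniConstant :=
    lt_trans (by norm_num) Real.one_half_lt_eulerMascheroniConstant
  have hc0 : 0 ≤ (2 * Real.log D + Real.eulerMascheroniConstant) * (χ.LFunction 1).re := by
    positivity
  have hc : (2 * Real.log D + Real.eulerMascheroniConstant) * (χ.LFunction 1).re ≤ 3 * η := by
    have h2 : (χ.LFunction 1).re ≤ (χ.LFunction 1).re * Real.log D :=
      le_mul_of_one_le_right hL1pos.le hlogD.le
    nlinarith only [hL1, h2, hγ1, hL1pos]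
  obtain ⟨hb1', hb2'⟩ := ratios_of_budget hε heε he1 hS1 hL1pos hδ0 h23 hc0 hc hηe hMS
  refine ⟨hb1', hb2', ?_⟩
  have hL : L₀ ≤ Nat.sqrt D := Nat.le_sqrt'.mpr hDL
  have hζ := hL₀ (Nat.sqrt D) hL
  rcases le_or_gt 0 (Real.pi ^ 2 / 6 - ε) with hpos | hneg
  · calc (∏ p ∈ D.primeFactors, (1 + 1 / (p : ℝ))) * (Real.pi ^ 2 / 6 - ε)
        ≤ (∏ p ∈ D.primeFactors, (1 + 1 / (p : ℝ))) * ∑ l ∈ Icc 1 (Nat.sqrt D), 1 / (l : ℝ) ^ 2 :=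
          mul_le_mul_of_nonneg_left hζ (by linarith only [hP1])
      _ ≤ gSum χ ((D : ℝ) ^ 2) := h28
  · have : (∏ p ∈ D.primeFactors, (1 + 1 / (p : ℝ))) * (Real.pi ^ 2 / 6 - ε) ≤ 0 :=
      mul_nonpos_of_nonneg_of_nonpos (by linarith only [hP1]) hneg.le
    linarith only [this, hS1]

end Assembly

end Pintz1976

/-- **Pintz 1976 (II), Theorem 1 — the named fact `pintz1976_theorem1` DISCHARGED** (as typed in
`GreatestRealZeroElementary.lean`: for every `ε > 0` there are `η > 0` and `D₀` such that for
`D ≥ D₀` and every primitive real `χ` mod `D` with `L(1, χ) log D ≤ η`, `L(s, χ)` has a real zero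
in `[1 − 1/log D, 1)`, and the greatest real zero `1 − δ` satisfies `|δ L'(1)/L(1) − 1| ≤ ε`,
`|(L(1)/δ)/Σ_{n ≤ D²} g(n)/n − 1| ≤ ε`, `Σ_{n ≤ D²} g(n)/n ≥ ∏_{p ∣ D}(1 + 1/p)(π²/6 − ε)`).
[cite: Pintz1976ElementaryII, Theorem 1 p. 275 (1.16)–(1.17); proof §2 pp. 279–282] -/
theorem pintz1976_theorem1_holds : pintz1976_theorem1 := Pintz1976.theorem1

/-! ## Part H. Towards Theorem 2, class-number-free step (3.5)–(3.6): the split primes in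
`(√D/2, D²]` are sparse in the `1/p`-measure when `L(1) log D` is small

PRINT (p. 283, (3.5)): "On the other hand, applying Lemma 1 with `x = D/4` and `x = D⁴` we get
`(Σ_{√D/2 < p ≤ D², χ(p)=1} 1/p)² ≤ Σ_{D/4 < n ≤ D⁴} g(n)/n = L(1) log(4D³) + O(√(√D log²D/D)) = o(1)`."
HERE: `#{(p,p′) split primes : pp′ = n} ≤ g(n)` (`card_filter_mul_eq_le_g`), so the square of the
prime sum is at most the `g(n)/n`-sum over the products (`sq_sum_inv_le_sum_g_div`), and the two
applications of Lemma 1 are the tree's Montgomery–Vaughan 11.2.3(g) at `(N, Y) = (D⁴, D²)` and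
`(⌊D/4⌋, ⌊√D⌋·⌊D^{1/4}⌋)` (`abs_gSum_natCast_sub_le`, `sum_Ioc_g_div_le`). The class-number input
(3.2)–(3.4) of Theorem 2 (the primes `p ≤ √D/2`) is Part I below. -/

namespace Pintz1976

open DirichletAbel RealChar

section SplitPrimes

variable {D : ℕ} [NeZero D] (χ : DirichletCharacter ℂ D)

/-- **Lemma 1 in `O`-form at a general `N`** (Montgomery–Vaughan 11.2.3(g), real parts): for a
primitive `χ` mod `D ≥ 2` and `2 ≤ Y ≤ N`,
`|Σ_{n ≤ N} g(n)/n − L'(1) − (log N + γ) L(1)| ≤ 8√D(1+log D)(log N+1)/(Y+1) + 4Y/N`.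
[cite: Pintz1976ElementaryII, Lemma 1 (2.1) p. 279] [cite: MontgomeryVaughan2007, §11.2.1 Exercise 3(g)] -/
theorem abs_gSum_natCast_sub_le (hprim : χ.IsPrimitive) (hD : 2 ≤ D) {N Y : ℕ} (hY : 2 ≤ Y)
    (hYN : Y ≤ N) :
    |gSum χ (N : ℝ) - (deriv χ.LFunction 1).re -
        (Real.log N + Real.eulerMascheroniConstant) * (χ.LFunction 1).re| ≤
      8 * (Real.sqrt D * (1 + Real.log D)) * (Real.log N + 1) / ((Y : ℝ) + 1) +
        4 * (Y : ℝ) / N := by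
  have h := norm_sum_divisorSum_div_sub_le_polyaVinogradov χ hD hprim hY hYN
  have hre : (∑ n ∈ Icc 1 N, (∑ d ∈ n.divisors, χ (d : ZMod D)) / (n : ℂ)).re = gSum χ (N : ℝ) := by
    rw [gSum_natCast, Complex.re_sum]
    refine sum_congr rfl fun n _ => ?_
    rw [g, Complex.div_natCast_re]
  have hre2 : ((((Real.log N + Real.eulerMascheroniConstant : ℝ) : ℂ) * χ.LFunction 1 +
      deriv χ.LFunction 1)).re =
      (Real.log N + Real.eulerMascheroniConstant) * (χ.LFunction 1).re +
        (deriv χ.LFunction 1).re := by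
    rw [Complex.add_re, Complex.re_ofReal_mul]
  calc |gSum χ (N : ℝ) - (deriv χ.LFunction 1).re -
        (Real.log N + Real.eulerMascheroniConstant) * (χ.LFunction 1).re|
      = |((∑ n ∈ Icc 1 N, (∑ d ∈ n.divisors, χ (d : ZMod D)) / (n : ℂ)) -
          ((((Real.log N + Real.eulerMascheroniConstant : ℝ) : ℂ) * χ.LFunction 1 +
            deriv χ.LFunction 1))).re| := by
        rw [Complex.sub_re, hre, hre2]; congr 1; ring
    _ ≤ ‖(∑ n ∈ Icc 1 N, (∑ d ∈ n.divisors, χ (d : ZMod D)) / (n : ℂ)) -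
          ((((Real.log N + Real.eulerMascheroniConstant : ℝ) : ℂ) * χ.LFunction 1 +
            deriv χ.LFunction 1))‖ := abs_re_le_norm _
    _ ≤ _ := h

/-- `Σ_{N₁ < n ≤ N₂} g(n)/n = Σ_{n ≤ N₂} g(n)/n − Σ_{n ≤ N₁} g(n)/n`.
[cite: Pintz1976ElementaryII, §3 (3.5) p. 283] -/
theorem sum_Ioc_g_div_eq {N₁ N₂ : ℕ} (h : N₁ ≤ N₂) :
    ∑ n ∈ Finset.Ioc N₁ N₂, g χ n / (n : ℝ) = gSum χ (N₂ : ℝ) - gSum χ (N₁ : ℝ) := by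
  rw [gSum_natCast, gSum_natCast, Icc_one_eq_Ioc_zero', Icc_one_eq_Ioc_zero',
    ← Finset.sum_Ioc_consecutive _ (Nat.zero_le N₁) h]
  ring

/-- **Lemma 1 twice ((3.5), right-hand side)**: for a primitive `χ` mod `D ≥ 2` and
`2 ≤ Y₁ ≤ N₁ ≤ N₂`, `2 ≤ Y₂ ≤ N₂`,
`Σ_{N₁ < n ≤ N₂} g(n)/n ≤ L(1)(log N₂ − log N₁) + E(N₁,Y₁) + E(N₂,Y₂)` with the errors of
`abs_gSum_natCast_sub_le`. [cite: Pintz1976ElementaryII, §3 (3.5) p. 283] -/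
theorem sum_Ioc_g_div_le (hprim : χ.IsPrimitive) (hD : 2 ≤ D) {N₁ Y₁ N₂ Y₂ : ℕ} (hY₁ : 2 ≤ Y₁)
    (hY₁N : Y₁ ≤ N₁) (hY₂ : 2 ≤ Y₂) (hY₂N : Y₂ ≤ N₂) (hN : N₁ ≤ N₂) :
    ∑ n ∈ Finset.Ioc N₁ N₂, g χ n / (n : ℝ) ≤
      (χ.LFunction 1).re * (Real.log N₂ - Real.log N₁) +
        (8 * (Real.sqrt D * (1 + Real.log D)) * (Real.log N₁ + 1) / ((Y₁ : ℝ) + 1) +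
          4 * (Y₁ : ℝ) / N₁) +
        (8 * (Real.sqrt D * (1 + Real.log D)) * (Real.log N₂ + 1) / ((Y₂ : ℝ) + 1) +
          4 * (Y₂ : ℝ) / N₂) := by
  rw [sum_Ioc_g_div_eq χ hN]
  have h1 := abs_gSum_natCast_sub_le χ hprim hD hY₁ hY₁N
  have h2 := abs_gSum_natCast_sub_le χ hprim hD hY₂ hY₂N
  obtain ⟨h1a, -⟩ := abs_le.mp h1
  obtain ⟨-, h2b⟩ := abs_le.mp h2
  linarith

/-- **The pairs of split primes with a given product are counted by `g`**: for a real `χ` and a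
finite set `P` of primes with `χ(p) = 1`, `#{(p, p′) ∈ P × P : pp′ = n} ≤ g(n)` — indeed the set
is empty, or `n = p₀p₀′` and it is contained in `{(p₀, p₀′), (p₀′, p₀)}` while
`g(p₀p₀′) = (1 + χ(p₀))(1 + χ(p₀′)) = 4` (`p₀ ≠ p₀′`), `g(p₀²) = 3`.
[cite: Pintz1976ElementaryII, §3 (3.5) p. 283] -/
theorem card_filter_mul_eq_le_g (hq : χ ^ 2 = 1) {P : Finset ℕ} (hP : ∀ p ∈ P, p.Prime)
    (hχP : ∀ p ∈ P, reChar χ p = 1) (n : ℕ) :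
    (#{x ∈ P ×ˢ P | x.1 * x.2 = n} : ℝ) ≤ g χ n := by
  classical
  set F := {x ∈ P ×ˢ P | x.1 * x.2 = n} with hF
  rcases F.eq_empty_or_nonempty with hE | ⟨x₀, hx₀⟩
  · rw [hE, Finset.card_empty, Nat.cast_zero]; exact g_nonneg χ hq n
  have hx₀' := hx₀
  simp only [hF, Finset.mem_filter, Finset.mem_product] at hx₀'
  obtain ⟨⟨hp₀, hp₀'⟩, hn⟩ := hx₀'
  have hpp : (x₀.1).Prime := hP _ hp₀
  have hpp' : (x₀.2).Prime := hP _ hp₀'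
  -- the fiber is contained in `{(p₀, p₀′), (p₀′, p₀)}`
  have hsub : F ⊆ {(x₀.1, x₀.2), (x₀.2, x₀.1)} := by
    intro y hy
    simp only [hF, Finset.mem_filter, Finset.mem_product] at hy
    obtain ⟨⟨hy1, hy2⟩, hyn⟩ := hy
    have hy1p : (y.1).Prime := hP _ hy1
    have hdvd : y.1 ∣ x₀.1 * x₀.2 := by rw [hn, ← hyn]; exact dvd_mul_right _ _
    rw [Finset.mem_insert, Finset.mem_singleton]
    rcases (Nat.Prime.dvd_mul hy1p).mp hdvd with h | h
    · have h1 : y.1 = x₀.1 := (Nat.prime_dvd_prime_iff_eq hy1p hpp).mp h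
      have h2 : y.2 = x₀.2 := by
        have := hyn.trans hn.symm
        rw [h1] at this
        exact Nat.eq_of_mul_eq_mul_left hpp.pos this
      exact Or.inl (Prod.ext h1 h2)
    · have h1 : y.1 = x₀.2 := (Nat.prime_dvd_prime_iff_eq hy1p hpp').mp h
      have h2 : y.2 = x₀.1 := by
        have := hyn.trans hn.symm
        rw [h1, mul_comm] at this
        exact Nat.eq_of_mul_eq_mul_right hpp'.pos this
      exact Or.inr (Prod.ext h1 h2)
  have hcard : #F ≤ #({(x₀.1, x₀.2), (x₀.2, x₀.1)} : Finset (ℕ × ℕ)) := card_le_card hsub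
  rw [g_eq_charDivisorSum, ← hn]
  by_cases heq : x₀.1 = x₀.2
  · -- `n = p₀²`, the fiber is `{(p₀, p₀)}`, `g(p₀²) = 1 + χ + χ² = 3`
    have hc1 : #F ≤ 1 := by
      refine hcard.trans ?_
      rw [heq, Finset.pair_eq_singleton, Finset.card_singleton]
    have hg : charDivisorSum χ (x₀.1 * x₀.2) = 3 := by
      rw [← heq, ← pow_two, charDivisorSum_prime_pow χ hq hpp 2, hχP _ hp₀]; norm_num
    rw [hg]
    have : (#F : ℝ) ≤ 1 := by exact_mod_cast hc1
    linarith
  · -- `p₀ ≠ p₀′`: the fiber has at most two elements and `g(p₀p₀′) = 4`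
    have hc2 : #F ≤ 2 := hcard.trans (Finset.card_le_two)
    have hcop : Nat.Coprime x₀.1 x₀.2 := (Nat.coprime_primes hpp hpp').mpr heq
    have hg : charDivisorSum χ (x₀.1 * x₀.2) = 4 := by
      rw [(isMultiplicative_charDivisorSum χ hq).map_mul_of_coprime hcop,
        charDivisorSum_prime χ hq hpp, charDivisorSum_prime χ hq hpp', hχP _ hp₀, hχP _ hp₀']
      norm_num
    rw [hg]
    have : (#F : ℝ) ≤ 2 := by exact_mod_cast hc2
    linarith

/-- **(3.5), left-hand side**: for a real `χ`, a finite set `P` of primes with `χ(p) = 1` whose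
pairwise products lie in `(N₁, N₂]`,
`(Σ_{p ∈ P} 1/p)² ≤ Σ_{N₁ < n ≤ N₂} g(n)/n`. [cite: Pintz1976ElementaryII, §3 (3.5) p. 283] -/
theorem sq_sum_inv_le_sum_g_div (hq : χ ^ 2 = 1) {P : Finset ℕ} (hP : ∀ p ∈ P, p.Prime)
    (hχP : ∀ p ∈ P, reChar χ p = 1) {N₁ N₂ : ℕ}
    (hprod : ∀ p ∈ P, ∀ p' ∈ P, N₁ < p * p' ∧ p * p' ≤ N₂) :
    (∑ p ∈ P, 1 / (p : ℝ)) ^ 2 ≤ ∑ n ∈ Finset.Ioc N₁ N₂, g χ n / (n : ℝ) := by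
  classical
  have hmaps : ∀ x ∈ P ×ˢ P, x.1 * x.2 ∈ Finset.Ioc N₁ N₂ := by
    intro x hx
    rw [Finset.mem_product] at hx
    rw [Finset.mem_Ioc]
    exact hprod _ hx.1 _ hx.2
  calc (∑ p ∈ P, 1 / (p : ℝ)) ^ 2
      = ∑ x ∈ P ×ˢ P, 1 / ((x.1 * x.2 : ℕ) : ℝ) := by
        rw [pow_two, sum_mul_sum, sum_product]
        refine sum_congr rfl fun p _ => sum_congr rfl fun p' _ => ?_
        push_cast; rw [one_div_mul_one_div]
    _ = ∑ n ∈ Finset.Ioc N₁ N₂, ∑ x ∈ P ×ˢ P with x.1 * x.2 = n, 1 / (n : ℝ) :=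
        (sum_fiberwise_of_maps_to' hmaps (fun n : ℕ => 1 / (n : ℝ))).symm
    _ = ∑ n ∈ Finset.Ioc N₁ N₂, (#{x ∈ P ×ˢ P | x.1 * x.2 = n} : ℝ) * (1 / (n : ℝ)) := by
        refine sum_congr rfl fun n _ => ?_
        rw [sum_const, nsmul_eq_mul]
    _ ≤ ∑ n ∈ Finset.Ioc N₁ N₂, g χ n / (n : ℝ) := by
        refine sum_le_sum fun n _ => ?_
        rw [← mul_one_div (g χ n)]
        exact mul_le_mul_of_nonneg_right (card_filter_mul_eq_le_g χ hq hP hχP n) (by positivity)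

end SplitPrimes

section SplitPrimesExplicit

variable {D : ℕ} [NeZero D] (χ : DirichletCharacter ℂ D)

/-- `log 16 < 4`. [folklore] -/
private theorem log_sixteen_lt_four : Real.log 16 < 4 := by
  have h4 : Real.exp 4 = Real.exp 1 ^ 4 := by rw [← Real.exp_nat_mul]; norm_num
  rw [Real.log_lt_iff_lt_exp (by norm_num), h4]
  have h2 : (2 : ℝ) < Real.exp 1 := lt_trans (by norm_num) Real.exp_one_gt_d9
  calc (16 : ℝ) = 2 ^ 4 := by norm_num
    _ < Real.exp 1 ^ 4 := pow_lt_pow_left₀ h2 (by norm_num) (by norm_num)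

/-- The integer fourth root `r = ⌊√⌊√D⌋⌋` controls `D`: `r⁴ ≤ D < 16 r⁴` (for `r ≥ 1`),
`√D ≤ 4r²`, `log D ≤ 4(1 + log r)`. [folklore] -/
private theorem fourthRoot_bounds {D : ℕ} (hr : 1 ≤ Nat.sqrt (Nat.sqrt D)) :
    ((Nat.sqrt (Nat.sqrt D) : ℝ)) ^ 4 ≤ D ∧ (D : ℝ) < 16 * (Nat.sqrt (Nat.sqrt D) : ℝ) ^ 4 ∧
      Real.sqrt D ≤ 4 * (Nat.sqrt (Nat.sqrt D) : ℝ) ^ 2 ∧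
      Real.log D ≤ 4 * (1 + Real.log (Nat.sqrt (Nat.sqrt D))) := by
  set s := Nat.sqrt D with hs
  set r := Nat.sqrt s with hrdef
  have hr2 : r ^ 2 ≤ s := Nat.sqrt_le' s
  have hs2 : s ^ 2 ≤ D := Nat.sqrt_le' D
  have hslt : D < (s + 1) ^ 2 := Nat.lt_succ_sqrt' D
  have hrlt : s < (r + 1) ^ 2 := Nat.lt_succ_sqrt' s
  have hr4 : r ^ 4 ≤ D := by
    calc r ^ 4 = (r ^ 2) ^ 2 := by ring
      _ ≤ s ^ 2 := Nat.pow_le_pow_left hr2 2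
      _ ≤ D := hs2
  have hs1 : s + 1 ≤ (r + 1) ^ 2 := hrlt
  have hD16 : D < 16 * r ^ 4 := by
    have h1 : (s + 1) ^ 2 ≤ ((r + 1) ^ 2) ^ 2 := Nat.pow_le_pow_left hs1 2
    have h2 : (r + 1) ^ 2 ≤ (2 * r) ^ 2 := Nat.pow_le_pow_left (by omega) 2
    have h3 : ((r + 1) ^ 2) ^ 2 ≤ ((2 * r) ^ 2) ^ 2 := Nat.pow_le_pow_left h2 2
    calc D < (s + 1) ^ 2 := hslt
      _ ≤ ((2 * r) ^ 2) ^ 2 := h1.trans h3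
      _ = 16 * r ^ 4 := by ring
  have hr4r : ((r : ℝ)) ^ 4 ≤ D := by exact_mod_cast hr4
  have hD16r : (D : ℝ) < 16 * (r : ℝ) ^ 4 := by exact_mod_cast hD16
  have hr1r : (1 : ℝ) ≤ r := by exact_mod_cast hr
  have hr0r : (0 : ℝ) < r := by linarith
  refine ⟨hr4r, hD16r, ?_, ?_⟩
  · -- `√D ≤ s + 1 ≤ (r+1)² ≤ 4r²`
    have h1 : Real.sqrt D ≤ (s : ℝ) + 1 := by
      rw [Real.sqrt_le_left (by positivity)]
      exact_mod_cast (by nlinarith [hslt] : D ≤ (s + 1) ^ 2)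
    have h2 : (s : ℝ) + 1 ≤ ((r : ℝ) + 1) ^ 2 := by exact_mod_cast hs1
    nlinarith [h1, h2]
  · -- `log D ≤ log 16 + 4 log r ≤ 4(1 + log r)`
    have hD0 : (0 : ℝ) < D := lt_of_lt_of_le (by positivity) hr4r
    calc Real.log D ≤ Real.log (16 * (r : ℝ) ^ 4) := Real.log_le_log hD0 hD16r.le
      _ = Real.log 16 + 4 * Real.log r := by
          rw [Real.log_mul (by norm_num) (by positivity), Real.log_pow]; push_cast; ring
      _ ≤ 4 * (1 + Real.log r) := by linarith [log_sixteen_lt_four]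

/-- **(3.5) for the split primes in `(√D/2, D²]`, explicit.** For a real primitive `χ` mod `D` with
`⌊D^{1/4}⌋ ≥ 4` (so `D ≥ 256`), writing `r = ⌊√⌊√D⌋⌋`:
`(Σ_{√D/2 < p ≤ D², χ(p) = 1} 1/p)² ≤ 4 L(1) log D + 3556 (1 + log r)²/r`
(Lemma 1 at `(N, Y) = (⌊D/4⌋, ⌊√D⌋·r)` and `(D⁴, D²)`).
[cite: Pintz1976ElementaryII, §3 (3.5) p. 283] -/
theorem sq_sum_inv_splitPrimes_le (hprim : χ.IsPrimitive) (hq : χ ^ 2 = 1)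
    (hr : 4 ≤ Nat.sqrt (Nat.sqrt D)) :
    (∑ p ∈ (Finset.range (D ^ 2 + 1)).filter
        (fun p : ℕ => p.Prime ∧ Real.sqrt D / 2 < (p : ℝ) ∧ χ (p : ZMod D) = 1), 1 / (p : ℝ)) ^ 2 ≤
      4 * (χ.LFunction 1).re * Real.log D +
        3556 * (1 + Real.log (Nat.sqrt (Nat.sqrt D))) ^ 2 / (Nat.sqrt (Nat.sqrt D)) := by
  classical
  set s := Nat.sqrt D with hsdef
  set r := Nat.sqrt s with hrdef
  obtain ⟨hr4, hD16, hsqrtD, hlogD⟩ := fourthRoot_bounds (D := D) (le_trans (by norm_num) hr)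
  rw [← hsdef, ← hrdef] at hr4 hD16 hsqrtD hlogD
  have hr2s : r ^ 2 ≤ s := Nat.sqrt_le' s
  have hs2 : s ^ 2 ≤ D := Nat.sqrt_le' D
  have hr1 : 1 ≤ r := le_trans (by norm_num) hr
  have hrr : (4 : ℝ) ≤ r := by exact_mod_cast hr
  have hr0 : (0 : ℝ) < r := by linarith only [hrr]
  have hr1r : (1 : ℝ) ≤ r := by linarith only [hrr]
  have hD256 : 256 ≤ D := by
    have : 4 ^ 4 ≤ r ^ 4 := Nat.pow_le_pow_left hr 4
    have h' : r ^ 4 ≤ D := by exact_mod_cast (show ((r : ℝ)) ^ 4 ≤ D from hr4)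
    omega
  have hD2 : 2 ≤ D := le_trans (by norm_num) hD256
  have hD1r : (1 : ℝ) ≤ D := by exact_mod_cast (le_trans (by norm_num) hD256)
  have hD0r : (0 : ℝ) < D := by linarith only [hD1r]
  have hlogD0 : 0 ≤ Real.log D := Real.log_nonneg hD1r
  have hlogr0 : 0 ≤ Real.log r := Real.log_nonneg hr1r
  -- the character is non-principal and `L(1) > 0`
  have hχ : χ ≠ 1 := by
    rintro rfl
    rw [DirichletCharacter.isPrimitive_def, DirichletCharacter.conductor_one] at hprim
    omega
  have hL1 : 0 < (χ.LFunction 1).re := Siegel.LFunction_one_re_pos χ hχ hq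
  -- the prime set and its products
  set P := (Finset.range (D ^ 2 + 1)).filter
    (fun p : ℕ => p.Prime ∧ Real.sqrt D / 2 < (p : ℝ) ∧ χ (p : ZMod D) = 1) with hPdef
  have hPp : ∀ p ∈ P, p.Prime := fun p hp => by
    rw [hPdef, Finset.mem_filter] at hp; exact hp.2.1
  have hχP : ∀ p ∈ P, reChar χ p = 1 := fun p hp => by
    rw [hPdef, Finset.mem_filter] at hp
    rw [reChar_apply χ hp.2.1.ne_zero, hp.2.2.2, Complex.one_re]
  set N₁ := D / 4 with hN₁
  set Y₁ := s * r with hY₁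
  have hprod : ∀ p ∈ P, ∀ p' ∈ P, N₁ < p * p' ∧ p * p' ≤ D ^ 4 := by
    intro p hp p' hp'
    rw [hPdef, Finset.mem_filter, Finset.mem_range] at hp hp'
    constructor
    · -- `pp′ > D/4 ≥ ⌊D/4⌋`
      have h1 : (D : ℝ) / 4 < (p : ℝ) * p' := by
        have hs0 : 0 ≤ Real.sqrt D / 2 := by positivity
        have := mul_lt_mul'' hp.2.2.1 hp'.2.2.1 hs0 hs0
        rw [show Real.sqrt D / 2 * (Real.sqrt D / 2) = (D : ℝ) / 4 by
          rw [div_mul_div_comm, Real.mul_self_sqrt hD0r.le]; norm_num] at this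
        exact this
      have h2 : ((N₁ : ℕ) : ℝ) ≤ (D : ℝ) / 4 := by
        rw [hN₁]; exact Nat.cast_div_le
      exact_mod_cast (show ((N₁ : ℕ) : ℝ) < ((p * p' : ℕ) : ℝ) by push_cast; linarith only [h1, h2])
    · have h1 : p ≤ D ^ 2 := by omega
      have h2 : p' ≤ D ^ 2 := by omega
      calc p * p' ≤ D ^ 2 * D ^ 2 := Nat.mul_le_mul h1 h2
        _ = D ^ 4 := by ring
  have hsq := sq_sum_inv_le_sum_g_div χ hq hPp hχP hprod
  -- parameters of the two Lemma-1 applications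
  have hY₁2 : 2 ≤ Y₁ := by
    rw [hY₁]; calc 2 ≤ 4 * 4 := by norm_num
      _ ≤ s * r := Nat.mul_le_mul (le_trans (by nlinarith only [hr]) hr2s) hr
  have hY₁N : Y₁ ≤ N₁ := by
    rw [hY₁, hN₁, Nat.le_div_iff_mul_le (by norm_num)]
    -- `4 s r ≤ s · r² ≤ s · s ≤ D`
    have h1 : 4 * r ≤ r ^ 2 := by nlinarith only [hr]
    calc s * r * 4 = s * (4 * r) := by ring
      _ ≤ s * r ^ 2 := Nat.mul_le_mul_left _ h1
      _ ≤ s * s := Nat.mul_le_mul_left _ hr2s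
      _ = s ^ 2 := by ring
      _ ≤ D := hs2
  have hY₂2 : 2 ≤ D ^ 2 := le_trans (by norm_num) (Nat.pow_le_pow_left hD2 2)
  have hY₂N : D ^ 2 ≤ D ^ 4 := Nat.pow_le_pow_right (by omega) (by norm_num)
  have hN₁N₂ : N₁ ≤ D ^ 4 := by
    rw [hN₁]; exact le_trans (Nat.div_le_self _ _) (by
      calc D = D ^ 1 := (pow_one D).symm
        _ ≤ D ^ 4 := Nat.pow_le_pow_right (by omega) (by norm_num))
  have hmv := sum_Ioc_g_div_le χ hprim hD2 hY₁2 hY₁N hY₂2 hY₂N hN₁N₂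
  -- numerics: casts of the parameters
  have hN₁r : (D : ℝ) / 8 ≤ (N₁ : ℝ) := by
    have h : (D : ℝ) / 4 - 1 ≤ ((D / 4 : ℕ) : ℝ) := by
      have := Nat.lt_div_mul_add (a := D) (b := 4) (by norm_num)
      have h' : ((D : ℕ) : ℝ) < ((D / 4 * 4 + 4 : ℕ) : ℝ) := by exact_mod_cast this
      push_cast at h'
      linarith
    rw [hN₁]
    have hD8 : (8 : ℝ) ≤ D := by exact_mod_cast (le_trans (by norm_num) hD256)
    linarith
  have hN₁pos : (0 : ℝ) < N₁ := lt_of_lt_of_le (by positivity) hN₁r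
  have hN₁1 : (1 : ℝ) ≤ N₁ := by
    have : 1 ≤ N₁ := by rw [hN₁, Nat.le_div_iff_mul_le (by norm_num)]; omega
    exact_mod_cast this
  have hlogN₁ : Real.log N₁ ≤ Real.log D :=
    Real.log_le_log hN₁pos (by rw [hN₁]; exact le_trans Nat.cast_div_le (by linarith))
  have hlogN₁0 : 0 ≤ Real.log N₁ := Real.log_nonneg hN₁1
  have hsr : (r : ℝ) ^ 2 ≤ s := by exact_mod_cast hr2s
  have hsD : (s : ℝ) ^ 2 ≤ D := by exact_mod_cast hs2
  have hs0 : (0 : ℝ) < s := lt_of_lt_of_le (by positivity) hsr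
  have hY₁r : (Y₁ : ℝ) = s * r := by rw [hY₁]; push_cast; ring
  have hN₂r : ((D ^ 4 : ℕ) : ℝ) = (D : ℝ) ^ 4 := by push_cast; ring
  have hY₂r : ((D ^ 2 : ℕ) : ℝ) = (D : ℝ) ^ 2 := by push_cast; ring
  rw [hN₂r, hY₂r, hY₁r] at hmv
  -- the main term: `L(1)(log D⁴ − log N₁) ≤ 4 L(1) log D`
  have hmain : (χ.LFunction 1).re * (Real.log ((D : ℝ) ^ 4) - Real.log N₁) ≤
      4 * (χ.LFunction 1).re * Real.log D := by
    rw [Real.log_pow]; push_cast; nlinarith only [hlogN₁0, hL1, hlogD0]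
  -- the error terms, in terms of `r` and `ℓ = 1 + log r`
  obtain ⟨ℓ, hℓ⟩ : ∃ ℓ : ℝ, ℓ = 1 + Real.log r := ⟨_, rfl⟩
  have hℓ1 : 1 ≤ ℓ := by rw [hℓ]; linarith only [hlogr0]
  have hℓ0 : 0 ≤ ℓ := by linarith only [hℓ1]
  rw [← hℓ] at hlogD
  obtain ⟨A, hAdef⟩ : ∃ A : ℝ, A = Real.sqrt D * (1 + Real.log D) := ⟨_, rfl⟩
  have hA : A ≤ 20 * (r : ℝ) ^ 2 * ℓ := by
    rw [hAdef]
    calc Real.sqrt D * (1 + Real.log D) ≤ (4 * (r : ℝ) ^ 2) * (5 * ℓ) :=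
          mul_le_mul hsqrtD (by linarith only [hlogD, hℓ1]) (by linarith only [hlogD0])
            (by positivity)
      _ = 20 * (r : ℝ) ^ 2 * ℓ := by ring
  have hA0 : 0 ≤ A := by rw [hAdef]; positivity
  rw [← hAdef] at hmv
  -- E₁ first term: `8A(log N₁+1)/(Y₁+1) ≤ 800 ℓ²/r`
  have hE1a : 8 * A * (Real.log N₁ + 1) / ((s : ℝ) * r + 1) ≤ 800 * ℓ ^ 2 / r := by
    have hnum : 8 * A * (Real.log N₁ + 1) ≤ 8 * (20 * (r : ℝ) ^ 2 * ℓ) * (5 * ℓ) := by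
      have h1 : Real.log N₁ + 1 ≤ 5 * ℓ := by linarith only [hlogN₁, hlogD, hℓ1]
      exact mul_le_mul (mul_le_mul_of_nonneg_left hA (by norm_num)) h1 (by linarith only [hlogN₁0])
        (by positivity)
    have hden : (r : ℝ) ^ 3 ≤ (s : ℝ) * r + 1 := by nlinarith only [hsr, hr0]
    calc 8 * A * (Real.log N₁ + 1) / ((s : ℝ) * r + 1)
        ≤ 8 * (20 * (r : ℝ) ^ 2 * ℓ) * (5 * ℓ) / (r : ℝ) ^ 3 :=
          div_le_div₀ (by positivity) hnum (by positivity) hden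
      _ = 800 * ℓ ^ 2 / r := by field_simp; ring
  -- E₁ second term: `4Y₁/N₁ ≤ 32/r`
  have hE1b : 4 * ((s : ℝ) * r) / N₁ ≤ 32 / r := by
    rw [div_le_div_iff₀ hN₁pos hr0]
    -- `4 s r · r ≤ 32 N₁`, from `s r² ≤ s·s ≤ D ≤ 8 N₁`
    have h1 : (s : ℝ) * (r : ℝ) ^ 2 ≤ s * s := mul_le_mul_of_nonneg_left hsr hs0.le
    have h2 : (s : ℝ) * s ≤ D := by rw [← pow_two]; exact hsD
    calc 4 * ((s : ℝ) * r) * r = 4 * ((s : ℝ) * (r : ℝ) ^ 2) := by ring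
      _ ≤ 4 * (D : ℝ) := by linarith only [h1, h2]
      _ ≤ 32 * (N₁ : ℝ) := by linarith only [hN₁r]
  -- E₂ first term: `8A(4 log D + 1)/(D²+1) ≤ 2720 ℓ²/r`
  have hE2a : 8 * A * (Real.log ((D : ℝ) ^ 4) + 1) / ((D : ℝ) ^ 2 + 1) ≤ 2720 * ℓ ^ 2 / r := by
    have hnum : 8 * A * (Real.log ((D : ℝ) ^ 4) + 1) ≤ 8 * (20 * (r : ℝ) ^ 2 * ℓ) * (17 * ℓ) := by
      have h1 : Real.log ((D : ℝ) ^ 4) + 1 ≤ 17 * ℓ := by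
        rw [Real.log_pow]; push_cast; linarith only [hlogD, hℓ1]
      exact mul_le_mul (mul_le_mul_of_nonneg_left hA (by norm_num)) h1
        (by rw [Real.log_pow]; push_cast; positivity) (by positivity)
    have hden : (r : ℝ) ^ 3 ≤ (D : ℝ) ^ 2 + 1 := by
      have h3 : (r : ℝ) ^ 3 ≤ (r : ℝ) ^ 4 := pow_le_pow_right₀ hr1r (by norm_num)
      have h4 : (D : ℝ) ≤ (D : ℝ) ^ 2 := by nlinarith only [hD1r]
      linarith only [h3, hr4, h4]
    calc 8 * A * (Real.log ((D : ℝ) ^ 4) + 1) / ((D : ℝ) ^ 2 + 1)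
        ≤ 8 * (20 * (r : ℝ) ^ 2 * ℓ) * (17 * ℓ) / (r : ℝ) ^ 3 :=
          div_le_div₀ (by positivity) hnum (by positivity) hden
      _ = 2720 * ℓ ^ 2 / r := by field_simp; ring
  -- E₂ second term: `4D²/D⁴ ≤ 4/r`
  have hE2b : 4 * (D : ℝ) ^ 2 / (D : ℝ) ^ 4 = 4 / (D : ℝ) ^ 2 := by
    field_simp
  have hE2b' : 4 / (D : ℝ) ^ 2 ≤ 4 / r :=
    div_le_div_of_nonneg_left (by norm_num) hr0 (by
      have h3 : (r : ℝ) ≤ (r : ℝ) ^ 4 := le_self_pow₀ hr1r (by norm_num)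
      have h4 : (D : ℝ) ≤ (D : ℝ) ^ 2 := by nlinarith only [hD1r]
      linarith only [h3, hr4, h4])
  -- collect: `ℓ² ≥ 1`, so `32/r + 4/r ≤ 36 ℓ²/r`
  have hcollect : 800 * ℓ ^ 2 / r + 32 / r + (2720 * ℓ ^ 2 / r + 4 / r) ≤ 3556 * ℓ ^ 2 / r := by
    have e : 800 * ℓ ^ 2 / r + 32 / r + (2720 * ℓ ^ 2 / r + 4 / r) = (3520 * ℓ ^ 2 + 36) / (r : ℝ) := by
      field_simp; ring
    rw [e]
    exact div_le_div_of_nonneg_right (by nlinarith only [hℓ1]) hr0.le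
  rw [hE2b] at hmv
  calc (∑ p ∈ P, 1 / (p : ℝ)) ^ 2 ≤ ∑ n ∈ Finset.Ioc N₁ (D ^ 4), g χ n / (n : ℝ) := hsq
    _ ≤ _ := hmv
    _ ≤ 4 * (χ.LFunction 1).re * Real.log D + 3556 * ℓ ^ 2 / r := by
        linarith only [hmain, hE1a, hE1b, hE2a, hE2b', hcollect]
    _ = _ := by rw [hℓ]

/-- The remainder `3556(1 + log r)²/r` is small: for every `ε > 0` there is `R₀` with
`3556(1 + log r)²/r ≤ ε` for all naturals `r ≥ R₀`. [folklore] -/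
private theorem remainder_le {ε : ℝ} (hε : 0 < ε) :
    ∃ R₀ : ℕ, ∀ r : ℕ, R₀ ≤ r → 1 ≤ r → 3556 * (1 + Real.log r) ^ 2 / (r : ℝ) ≤ ε := by
  refine ⟨⌈((288036 : ℝ) / ε) ^ 8⌉₊, fun r hr hr1 => ?_⟩
  have hr1r : (1 : ℝ) ≤ r := by exact_mod_cast hr1
  have hr0 : (0 : ℝ) < r := by linarith
  set u : ℝ := (r : ℝ) ^ ((1 : ℝ) / 8) with hu
  have hu0 : 0 < u := Real.rpow_pos_of_pos hr0 _
  have hu1 : 1 ≤ u := Real.one_le_rpow hr1r (by norm_num)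
  have hu8 : u ^ 8 = (r : ℝ) := by
    rw [hu, ← Real.rpow_mul_natCast hr0.le]; norm_num
  have hlog : Real.log r ≤ 8 * u := log_le_eight_mul_rpow hr0.le
  have hlog0 : 0 ≤ Real.log r := Real.log_nonneg hr1r
  have huε : 288036 / ε ≤ u := by
    have h1 : ((288036 : ℝ) / ε) ^ 8 ≤ r := le_trans (Nat.le_ceil _) (by exact_mod_cast hr)
    rw [← hu8] at h1
    exact le_of_pow_le_pow_left₀ (by norm_num) hu0.le h1
  have hεu : 288036 / u ≤ ε := by
    rw [div_le_iff₀ hu0]; rw [div_le_iff₀ hε] at huε; linarith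
  have h1 : (1 + Real.log r) ^ 2 ≤ 81 * u ^ 2 := by nlinarith
  have hu6 : u ≤ u ^ 6 := le_self_pow₀ hu1 (by norm_num)
  calc 3556 * (1 + Real.log r) ^ 2 / (r : ℝ) ≤ 3556 * (81 * u ^ 2) / (r : ℝ) :=
        div_le_div_of_nonneg_right (by nlinarith [h1]) hr0.le
    _ = 3556 * (81 * u ^ 2) / u ^ 8 := by rw [hu8]
    _ = 288036 / u ^ 6 := by field_simp; ring
    _ ≤ 288036 / u := div_le_div_of_nonneg_left (by norm_num) hu0 hu6
    _ ≤ ε := hεu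

/-- **Pintz 1976 (II), (3.5)–(3.6) without the class-number input — PROVED.** For every `ε > 0`
there are `η > 0` and `D₀` such that for `D ≥ D₀` and every primitive real `χ` mod `D` with
`L(1, χ) log D ≤ η`: `Σ_{√D/2 < p ≤ D², χ(p) = 1} 1/p ≤ ε` — under (1.16), almost all primes in
`(√D/2, D²]` are inert or ramified, in the `1/p`-measure. (The complementary range `p ≤ √D/2` is
(3.2)–(3.4), which uses `h(−D) ≤ log D/(2 log log D)`.)
[cite: Pintz1976ElementaryII, §3 (3.5)–(3.6) p. 283] -/
theorem sum_inv_splitPrimes_le :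
    ∀ ε : ℝ, 0 < ε → ∃ η : ℝ, 0 < η ∧ ∃ D₀ : ℕ, ∀ (D : ℕ) [NeZero D], D₀ ≤ D →
      ∀ χ : DirichletCharacter ℂ D, χ.IsQuadratic → χ.IsPrimitive →
        (χ.LFunction 1).re * Real.log D ≤ η →
          ∑ p ∈ (Finset.range (D ^ 2 + 1)).filter
              (fun p : ℕ => p.Prime ∧ Real.sqrt D / 2 < (p : ℝ) ∧ χ (p : ZMod D) = 1),
            1 / (p : ℝ) ≤ ε := by
  intro ε hε
  obtain ⟨R₀, hR₀⟩ := remainder_le (show 0 < ε ^ 2 / 2 by positivity)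
  refine ⟨ε ^ 2 / 8, by positivity, max (R₀ ^ 4) 256, fun D _ hD χ hquad hprim hL => ?_⟩
  classical
  have hq : χ ^ 2 = 1 := MulChar.IsQuadratic.sq_eq_one hquad
  have hD256 : 256 ≤ D := le_trans (le_max_right _ _) hD
  have hDR : R₀ ^ 4 ≤ D := le_trans (le_max_left _ _) hD
  -- `r = ⌊√⌊√D⌋⌋ ≥ max(R₀, 4)`
  have hr4 : 4 ≤ Nat.sqrt (Nat.sqrt D) := by
    rw [Nat.le_sqrt', Nat.le_sqrt']; exact le_trans (by norm_num) hD256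
  have hrR : R₀ ≤ Nat.sqrt (Nat.sqrt D) := by
    rw [Nat.le_sqrt', Nat.le_sqrt']
    calc (R₀ ^ 2) ^ 2 = R₀ ^ 4 := by ring
      _ ≤ D := hDR
  have hmain := sq_sum_inv_splitPrimes_le χ hprim hq hr4
  have hrem := hR₀ (Nat.sqrt (Nat.sqrt D)) hrR (le_trans (by norm_num) hr4)
  set T := ∑ p ∈ (Finset.range (D ^ 2 + 1)).filter
      (fun p : ℕ => p.Prime ∧ Real.sqrt D / 2 < (p : ℝ) ∧ χ (p : ZMod D) = 1), 1 / (p : ℝ) with hT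
  have hT0 : 0 ≤ T := by rw [hT]; exact sum_nonneg fun p _ => by positivity
  have hsq : T ^ 2 ≤ ε ^ 2 := by
    calc T ^ 2 ≤ 4 * (χ.LFunction 1).re * Real.log D +
          3556 * (1 + Real.log (Nat.sqrt (Nat.sqrt D))) ^ 2 / (Nat.sqrt (Nat.sqrt D)) := hmain
      _ ≤ 4 * (ε ^ 2 / 8) + ε ^ 2 / 2 := by linarith
      _ = ε ^ 2 := by ring
  exact (pow_le_pow_iff_left₀ hT0 hε.le two_ne_zero).mp hsq

end SplitPrimesExplicit

open scoped NumberTheorySymbols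

/-! ## Part I. (3.2)–(3.4): the split primes `p ≤ √D/2` under `h(−D) ≤ log D/(2 log log D)` -/

section ClassNumberCount

open Literature.NumberTheory.QuadraticFields

variable {K : Type*} [Field K] [NumberField K] {D : ℕ} [NeZero D]

/-- **(3.2) — Davenport's Hilfssatz 1 in the tree's form (Lenstra–Pomerance 1992, Lemma 2.10),
counting version.** Let `K` be an imaginary quadratic field, `D = |d_K|`, and `χ` the odd real
primitive character mod `D` (so `χ(p) = (d_K/p)`, `Quadratic.kroneckerValues_of_odd_primitive`). If
`T` is a set of integers `1 ≤ n ≤ √D/2` (`4n² ≤ D`) all of whose prime factors `p` have `χ(p) = 1`,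
then `#T ≤ h(−D) = h_K`: each such `n` is the first coefficient of a reduced primitive form
`(n, b, c)` of discriminant `d_K` (`BinaryQuadraticForm.exists_mem_reducedForms_fst_eq`), and
`#(reduced forms of discriminant d_K) = h_K` (`Quadratic.card_reducedForms_eq_classNumber`).
[cite: Pintz1976ElementaryII, §3 (3.2) p. 282] -/
theorem card_le_classNumber_of_splitFactors (h2 : Module.finrank ℚ K = 2)
    (hd : NumberField.discr K < 0) (hKD : (NumberField.discr K).natAbs = D)
    {χ : DirichletCharacter ℂ D} (hprim : χ.IsPrimitive) (hquad : χ.IsQuadratic) (hodd : χ.Odd)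
    (T : Finset ℕ)
    (hT : ∀ n ∈ T, 0 < n ∧ 4 * n ^ 2 ≤ D ∧ ∀ p ∈ n.primeFactors, χ (p : ZMod D) = 1) :
    T.card ≤ NumberField.classNumber K := by
  classical
  have hΔ : NumberField.discr K = -(D : ℤ) := by rw [← hKD]; omega
  obtain ⟨hoddp, htwo⟩ := Quadratic.kroneckerValues_of_odd_primitive hprim hquad hodd
  rw [← hΔ] at hoddp htwo
  have h4 : NumberField.discr K % 4 = 0 ∨ NumberField.discr K % 4 = 1 := by
    have := PrimitiveQuadratic.neg_emod_four_of_odd hprim hquad hodd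
    rwa [← hΔ] at this
  -- each `n ∈ T` is the first coefficient of a reduced form of discriminant `d_K`
  have hex : ∀ n : ℕ, ∃ bc : ℤ × ℤ, n ∈ T →
      ((n : ℤ), bc.1, bc.2) ∈ BinaryQuadraticForm.reducedForms (NumberField.discr K) := by
    intro n
    by_cases hn : n ∈ T
    · obtain ⟨hn0, hle, hsplit⟩ := hT n hn
      have hale : 4 * n ^ 2 ≤ (NumberField.discr K).natAbs := by rw [hKD]; exact hle
      have h8 : 2 ∣ n → NumberField.discr K % 8 = 1 := by
        intro h2n
        have h2mem : 2 ∈ n.primeFactors :=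
          Nat.mem_primeFactors.mpr ⟨Nat.prime_two, h2n, hn0.ne'⟩
        have hχ2 : χ 2 = 1 := by have := hsplit 2 h2mem; simpa using this
        rw [hχ2] at htwo
        by_contra h81
        rw [if_neg h81] at htwo
        split_ifs at htwo <;> norm_num at htwo
      have hoddT : ∀ p ∈ n.primeFactors, p ≠ 2 →
          ¬ (p : ℤ) ∣ NumberField.discr K ∧ ∃ x : ℤ, (p : ℤ) ∣ x ^ 2 - NumberField.discr K := by
        intro p hp hp2
        have hpp : p.Prime := Nat.prime_of_mem_primeFactors hp
        haveI := Fact.mk hpp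
        have hJ : J(NumberField.discr K | p) = 1 := by
          have h1 := hsplit p hp
          rw [hoddp p hpp hp2] at h1
          exact_mod_cast h1
        rw [← jacobiSym.legendreSym.to_jacobiSym] at hJ
        have hndvd : ¬ (p : ℤ) ∣ NumberField.discr K := by
          intro hdvd
          have h0 : legendreSym p (NumberField.discr K) = 0 :=
            (legendreSym.eq_zero_iff p _).mpr
              ((ZMod.intCast_zmod_eq_zero_iff_dvd _ p).mpr hdvd)
          rw [h0] at hJ
          exact zero_ne_one hJ
        exact ⟨hndvd, (Quadratic.legendreSym_eq_one_iff_exists_dvd_sq_sub hndvd).1 hJ⟩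
      obtain ⟨b, c, hbc⟩ :=
        BinaryQuadraticForm.exists_mem_reducedForms_fst_eq hd h4 hn0 hale h8 hoddT
      exact ⟨(b, c), fun _ => hbc⟩
    · exact ⟨(0, 0), fun h => absurd h hn⟩
  choose bc hbc using hex
  rw [← Quadratic.card_reducedForms_eq_classNumber h2 hd, BinaryQuadraticForm.classNumber]
  refine Finset.card_le_card_of_injOn (fun n => ((n : ℤ), (bc n).1, (bc n).2))
    (fun n hn => hbc n hn) ?_
  intro x _ y _ hxy
  have := congrArg Prod.fst hxy
  simp only at this
  exact_mod_cast this

/-- **(3.3).** With `h = h_K`, a prime `p` with `χ(p) = 1` satisfies `p^h > √D/2`, i.e.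
`D < 4 p^{2h}`: otherwise `1, p, …, p^h` would be `h + 1` integers `≤ √D/2` composed of primes with
`χ(p) = 1`, against (3.2). [cite: Pintz1976ElementaryII, §3 (3.3) p. 282] -/
theorem lt_four_mul_pow_classNumber_sq (h2 : Module.finrank ℚ K = 2)
    (hd : NumberField.discr K < 0) (hKD : (NumberField.discr K).natAbs = D)
    {χ : DirichletCharacter ℂ D} (hprim : χ.IsPrimitive) (hquad : χ.IsQuadratic) (hodd : χ.Odd)
    {p : ℕ} (hp : p.Prime) (hχp : χ (p : ZMod D) = 1) :
    D < 4 * (p ^ NumberField.classNumber K) ^ 2 := by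
  classical
  by_contra hle
  push Not at hle
  have hT := card_le_classNumber_of_splitFactors h2 hd hKD hprim hquad hodd
    ((Finset.range (NumberField.classNumber K + 1)).image (fun j => p ^ j)) ?_
  · rw [Finset.card_image_of_injective _ (Nat.pow_right_injective hp.two_le),
      Finset.card_range] at hT
    omega
  · intro n hn
    obtain ⟨j, hj, rfl⟩ := Finset.mem_image.mp hn
    have hjh : j ≤ NumberField.classNumber K := Nat.lt_succ_iff.mp (Finset.mem_range.mp hj)
    refine ⟨pow_pos hp.pos j, ?_, fun q hq => ?_⟩
    · exact le_trans (Nat.mul_le_mul_left 4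
        (Nat.pow_le_pow_left (Nat.pow_le_pow_right hp.pos hjh) 2)) hle
    · obtain ⟨hqp, hqdvd, -⟩ := Nat.mem_primeFactors.mp hq
      rw [(Nat.prime_dvd_prime_iff_eq hqp hp).mp (hqp.dvd_of_dvd_pow hqdvd)]
      exact hχp

/-- **(3.4).** `Σ_{p ≤ √D/2, χ(p) = 1} 1/p ≤ h · (4/D)^{1/(2h)}` (`h = h_K`): there are at most
`h` such primes by (3.2), each `> (D/4)^{1/(2h)}` by (3.3).
[cite: Pintz1976ElementaryII, §3 (3.4) p. 282] -/
theorem sum_inv_smallSplitPrimes_le (h2 : Module.finrank ℚ K = 2)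
    (hd : NumberField.discr K < 0) (hKD : (NumberField.discr K).natAbs = D)
    {χ : DirichletCharacter ℂ D} (hprim : χ.IsPrimitive) (hquad : χ.IsQuadratic) (hodd : χ.Odd)
    (P : Finset ℕ) (hP : ∀ p ∈ P, p.Prime ∧ 4 * p ^ 2 ≤ D ∧ χ (p : ZMod D) = 1) :
    ∑ p ∈ P, 1 / (p : ℝ) ≤
      (NumberField.classNumber K : ℝ) *
        (4 / (D : ℝ)) ^ (1 / (2 * (NumberField.classNumber K : ℝ))) := by
  have hh0 : 0 < NumberField.classNumber K := NumberField.classNumber_pos K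
  have hD0 : (0 : ℝ) < D := by exact_mod_cast NeZero.pos D
  have hz : 0 < 1 / (2 * (NumberField.classNumber K : ℝ)) := by positivity
  have hb0 : 0 ≤ (4 / (D : ℝ)) ^ (1 / (2 * (NumberField.classNumber K : ℝ))) :=
    Real.rpow_nonneg (by positivity) _
  -- at most `h` primes
  have hcard : P.card ≤ NumberField.classNumber K := by
    refine card_le_classNumber_of_splitFactors h2 hd hKD hprim hquad hodd P fun p hp => ?_
    obtain ⟨hpp, hle, hχ⟩ := hP p hp
    refine ⟨hpp.pos, hle, fun q hq => ?_⟩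
    obtain ⟨hqp, hqdvd, -⟩ := Nat.mem_primeFactors.mp hq
    rw [(Nat.prime_dvd_prime_iff_eq hqp hpp).mp hqdvd]
    exact hχ
  -- each `1/p ≤ (4/D)^{1/(2h)}`
  have hterm : ∀ p ∈ P, 1 / (p : ℝ) ≤
      (4 / (D : ℝ)) ^ (1 / (2 * (NumberField.classNumber K : ℝ))) := by
    intro p hp
    obtain ⟨hpp, -, hχ⟩ := hP p hp
    have hlt := lt_four_mul_pow_classNumber_sq h2 hd hKD hprim hquad hodd hpp hχ
    have hp0 : (0 : ℝ) < p := by exact_mod_cast hpp.pos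
    have hltr : (D : ℝ) / 4 < (p : ℝ) ^ (2 * NumberField.classNumber K) := by
      have : (D : ℝ) < 4 * ((p : ℝ) ^ NumberField.classNumber K) ^ 2 := by exact_mod_cast hlt
      rw [pow_mul']; linarith
    have h2h : 2 * NumberField.classNumber K ≠ 0 := by omega
    have hexq : (1 : ℝ) / (2 * (NumberField.classNumber K : ℝ)) =
        ((2 * NumberField.classNumber K : ℕ) : ℝ)⁻¹ := by push_cast; ring
    have hroot : ((D : ℝ) / 4) ^ (1 / (2 * (NumberField.classNumber K : ℝ))) < p := by
      have := Real.rpow_lt_rpow (by positivity) hltr hz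
      rw [hexq, Real.pow_rpow_inv_natCast hp0.le h2h] at this
      rwa [hexq]
    have hpos : 0 < ((D : ℝ) / 4) ^ (1 / (2 * (NumberField.classNumber K : ℝ))) :=
      Real.rpow_pos_of_pos (by positivity) _
    calc 1 / (p : ℝ) ≤ 1 / ((D : ℝ) / 4) ^ (1 / (2 * (NumberField.classNumber K : ℝ))) :=
          one_div_le_one_div_of_le hpos hroot.le
      _ = (4 / (D : ℝ)) ^ (1 / (2 * (NumberField.classNumber K : ℝ))) := by
          rw [one_div, ← Real.inv_rpow (by positivity), inv_div]
  calc ∑ p ∈ P, 1 / (p : ℝ)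
      ≤ P.card • (4 / (D : ℝ)) ^ (1 / (2 * (NumberField.classNumber K : ℝ))) :=
        Finset.sum_le_card_nsmul _ _ _ hterm
    _ = (P.card : ℝ) * (4 / (D : ℝ)) ^ (1 / (2 * (NumberField.classNumber K : ℝ))) := by
        rw [nsmul_eq_mul]
    _ ≤ (NumberField.classNumber K : ℝ) *
        (4 / (D : ℝ)) ^ (1 / (2 * (NumberField.classNumber K : ℝ))) :=
        mul_le_mul_of_nonneg_right (by exact_mod_cast hcard) hb0

omit [NeZero D] in
/-- **(3.4), the size of the bound.** For `D ≥ 16` and `1 ≤ h ≤ log D/(2 log log D)`: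
`h · (4/D)^{1/(2h)} ≤ 2/log log D`. [cite: Pintz1976ElementaryII, §3 (3.4) p. 282] -/
theorem mul_rpow_le_two_div_loglog {h x : ℝ} (hx : 16 ≤ x) (h1 : 1 ≤ h)
    (hh : h ≤ Real.log x / (2 * Real.log (Real.log x))) :
    h * (4 / x) ^ (1 / (2 * h)) ≤ 2 / Real.log (Real.log x) := by
  have hx0 : 0 < x := by linarith
  have hL : 1 < Real.log x := by
    rw [Real.lt_log_iff_exp_lt hx0]
    have := Real.exp_one_lt_d9; linarith
  have hL0 : 0 < Real.log x := by linarith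
  have hLL0 : 0 < Real.log (Real.log x) := Real.log_pos hL
  have hh0 : 0 < h := by linarith
  have hlog4 : Real.log 4 ≤ Real.log x := Real.log_le_log (by norm_num) (by linarith)
  have hlog4pos : 0 < Real.log 4 := Real.log_pos (by norm_num)
  have hexp : (4 / x) ^ (1 / (2 * h)) = Real.exp (-(Real.log x - Real.log 4) / (2 * h)) := by
    rw [Real.rpow_def_of_pos (by positivity), Real.log_div (by norm_num) hx0.ne']
    congr 1; ring
  have hkey : -(Real.log x - Real.log 4) / (2 * h) ≤ -Real.log (Real.log x) + Real.log 4 := by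
    have h1' : Real.log (Real.log x) * (2 * h) ≤ Real.log x := by
      have := hh; rw [le_div_iff₀ (by positivity)] at this; linarith
    rw [div_le_iff₀ (by positivity)]
    nlinarith [mul_nonneg (by linarith : (0 : ℝ) ≤ 2 * h - 1) hlog4pos.le]
  have hb : (4 / x) ^ (1 / (2 * h)) ≤ 4 / Real.log x := by
    rw [hexp]
    calc Real.exp (-(Real.log x - Real.log 4) / (2 * h))
        ≤ Real.exp (-Real.log (Real.log x) + Real.log 4) := Real.exp_le_exp.mpr hkey
      _ = 4 / Real.log x := by
          rw [Real.exp_add, Real.exp_neg, Real.exp_log hL0, Real.exp_log (by norm_num)]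
          ring
  calc h * (4 / x) ^ (1 / (2 * h)) ≤ h * (4 / Real.log x) :=
        mul_le_mul_of_nonneg_left hb hh0.le
    _ ≤ Real.log x / (2 * Real.log (Real.log x)) * (4 / Real.log x) :=
        mul_le_mul_of_nonneg_right hh (by positivity)
    _ = 2 / Real.log (Real.log x) := by field_simp; ring

end ClassNumberCount

/-! ## Part J. The upper bound `Σ_{n ≤ D²} g(n)/n ≤ ∏_{p ≤ D²} Σ_ν g(p^ν)/p^ν
  = ∏_{p ≤ D²}(1 − p^{−2})^{−1} · ∏_{p ∣ D}(1 + 1/p) · ∏_{p ≤ D², χ(p) = 1}(1 + 1/p)/(1 − 1/p)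
  ≤ (π²/6) ∏_{p ∣ D}(1 + 1/p) · exp(4 Σ_{p ≤ D², χ(p)=1} 1/p)`

PRINT (p. 282, proof of Theorem 2): "we shall prove the inequality
`S = Σ_{n ≤ D²} g(n)/n ≤ (1 + o(1)) (π²/6) ∏_{p∣D}(1 + 1/p)` (3.1) … Thus [(3.4), (3.6)] we have
`S ≤ ∏_{p ≤ D²}(1 + g(p)/p + g(p²)/p² + …) = ∏_{(−D/p)=1}(1 − 1/p)^{−2} ∏_{p∣D}(1 − 1/p)^{−1}
∏_{(−D/p)=−1}(1 − 1/p²)^{−1} ≤ ∏_{(−D/p)=1}(1 − 1/p)^{−2} (π²/6) ∏_{p∣D}(1 + 1/p)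
≤ e^{4 Σ_{(−D/p)=1, p ≤ D²} 1/p} (π²/6) ∏_{p∣D}(1 + 1/p) ≤ e^{o(1)} (π²/6) ∏_{p∣D}(1 + 1/p)` (3.7)."
HERE: the first inequality is the Euler product over the `(D²+1)`-smooth numbers (Mathlib
`EulerProduct.summable_and_hasSum_smoothNumbers_prod_primesBelow_tsum`, all terms `≥ 0`); the local
factor at `p` is `(1 − p^{−2})^{−1} · E_p` with `E_p = (1 + 1/p)/(1 − 1/p), 1 + 1/p, 1` for
`χ(p) = 1, 0, −1`; `∏_{p ≤ D²}(1 − p^{−2})^{−1} ≤ ζ(2) = π²/6` (Euler product of `Σ 1/n²` over the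
smooth numbers, `hasSum_zeta_two`); `χ(p) = 0 ⟺ p ∣ D`; and `(1 + x)/(1 − x) ≤ e^{4x}` for
`0 ≤ x ≤ 1/2`. -/

section EulerUpper

variable {D : ℕ} [NeZero D] (χ : DirichletCharacter ℂ D)

omit [NeZero D] in
/-- `(1 + x)/(1 − x) ≤ e^{4x}` for `0 ≤ x ≤ 1/2`. [folklore] -/
private theorem one_add_div_one_sub_le_exp {x : ℝ} (h0 : 0 ≤ x) (h2 : x ≤ 1 / 2) :
    (1 + x) / (1 - x) ≤ Real.exp (4 * x) := by
  have h1 : 0 < 1 - x := by linarith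
  rw [div_le_iff₀ h1]
  have he : 1 + 4 * x ≤ Real.exp (4 * x) := by have := Real.add_one_le_exp (4 * x); linarith
  nlinarith [mul_le_mul_of_nonneg_right he h1.le, mul_nonneg h0 (by linarith : (0 : ℝ) ≤ 1 - 2 * x)]

omit [NeZero D] in
/-- For a real character `χ` mod `D` and a prime `p`: `χ(p) = 0 ⟺ p ∣ D`. [folklore] -/
private theorem reChar_prime_eq_zero_iff (hq : χ ^ 2 = 1) {p : ℕ} (hp : p.Prime) :
    reChar χ p = 0 ↔ p ∣ D := by
  rw [reChar_apply χ hp.ne_zero]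
  constructor
  · intro h0
    by_contra hnd
    have hu : IsUnit ((p : ℕ) : ZMod D) := (ZMod.isUnit_prime_iff_not_dvd hp).mpr hnd
    have hne : χ (p : ZMod D) ≠ 0 := (hu.map χ).ne_zero
    rcases MulChar.isQuadratic_iff_sq_eq_one.mpr hq (p : ZMod D) with h | h | h
    · exact hne h
    · rw [h] at h0; norm_num at h0
    · rw [h] at h0; norm_num at h0
  · intro hdvd
    have hunit : ¬ IsUnit ((p : ℕ) : ZMod D) := by
      rw [ZMod.isUnit_prime_iff_not_dvd hp]; exact not_not.mpr hdvd
    rw [χ.map_nonunit hunit, Complex.zero_re]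

omit [NeZero D] in
/-- For a real character: `Re χ(n) = 1 ⟺ χ(n) = 1` (`n ≥ 1`). [folklore] -/
private theorem reChar_eq_one_iff (hq : χ ^ 2 = 1) {n : ℕ} (hn : n ≠ 0) :
    reChar χ n = 1 ↔ χ (n : ZMod D) = 1 := by
  rw [← ofReal_reChar χ hq hn, Complex.ofReal_eq_one]

omit [NeZero D] in
/-- The values of the local factors: for `0 ≤ x < 1`, `(1 − x²)^{−1}(1 + x) = (1 − x)^{−1}` and
`(1 − x²)^{−1}(1 + x)/(1 − x) = x/(1 − x)² + (1 − x)^{−1}` (`= 1/(1 − x)²`). [folklore] -/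
private theorem localFactor_values {x : ℝ} (hx0 : 0 ≤ x) (hx1 : x < 1) :
    (1 - x ^ 2)⁻¹ * (1 + x) = (1 - x)⁻¹ ∧
      (1 - x ^ 2)⁻¹ * ((1 + x) / (1 - x)) = x / (1 - x) ^ 2 + (1 - x)⁻¹ := by
  have h1 : 1 - x ≠ 0 := by linarith
  have h2 : 1 + x ≠ 0 := by linarith
  have h3 : 1 - x ^ 2 ≠ 0 := by
    have : 0 < 1 - x ^ 2 := by nlinarith
    exact this.ne'
  constructor
  · rw [show 1 - x ^ 2 = (1 - x) * (1 + x) by ring, mul_inv, mul_assoc, inv_mul_cancel₀ h2,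
      mul_one]
  · field_simp
    ring

omit [NeZero D] in
/-- **The local factor of `Σ g(n)/n` at a prime `p`**: with `x = 1/p`,
`Σ_ν g(p^ν)/p^ν = 1/(1 − x)², 1/(1 − x), 1/(1 − x²)` according as `χ(p) = 1, 0, −1` — written
`(1 − x²)^{−1} · E_p` with `E_p = (1 + x)/(1 − x), 1 + x, 1`.
[cite: Pintz1976ElementaryII, §3 (3.7) p. 283] -/
theorem hasSum_charDivisorSum_primePow_div (hq : χ ^ 2 = 1) {p : ℕ} (hp : p.Prime) :
    HasSum (fun n : ℕ => charDivisorSum χ (p ^ n) / ((p ^ n : ℕ) : ℝ))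
      ((1 - (1 / (p : ℝ)) ^ 2)⁻¹ *
        (if reChar χ p = 1 then (1 + 1 / (p : ℝ)) / (1 - 1 / (p : ℝ))
         else if reChar χ p = 0 then 1 + 1 / (p : ℝ) else 1)) := by
  have hp1 : (1 : ℝ) < p := by exact_mod_cast hp.one_lt
  have hx0 : 0 ≤ 1 / (p : ℝ) := by positivity
  have hx1 : 1 / (p : ℝ) < 1 := by rw [div_lt_one (by linarith)]; exact hp1
  have hxn : ‖1 / (p : ℝ)‖ < 1 := by rw [Real.norm_of_nonneg hx0]; exact hx1
  have h1x : (1 : ℝ) - 1 / p ≠ 0 := by linarith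
  have h1x' : (1 : ℝ) + 1 / p ≠ 0 := by linarith
  have hterm : ∀ n : ℕ, charDivisorSum χ (p ^ n) / ((p ^ n : ℕ) : ℝ) =
      (∑ j ∈ Finset.range (n + 1), reChar χ p ^ j) * (1 / (p : ℝ)) ^ n := by
    intro n
    rw [charDivisorSum_prime_pow χ hq hp, Nat.cast_pow, one_div_pow, div_eq_mul_one_div]
  simp_rw [hterm]
  rcases reChar_trichotomy χ hq p with hc | hc | hc
  · -- `χ(p) = 0`: `Σ_n x^n = 1/(1 − x) = (1 − x²)^{−1}(1 + x)`
    rw [if_neg (by rw [hc]; norm_num), if_pos hc]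
    have hf : (fun n : ℕ => (∑ j ∈ Finset.range (n + 1), reChar χ p ^ j) * (1 / (p : ℝ)) ^ n) =
        fun n : ℕ => (1 / (p : ℝ)) ^ n := by
      funext n; rw [hc, zero_geom_sum, if_neg (Nat.succ_ne_zero n), one_mul]
    rw [hf, (localFactor_values hx0 hx1).1]
    exact hasSum_geometric_of_lt_one hx0 hx1
  · -- `χ(p) = 1`: `Σ_n (n+1) x^n = 1/(1 − x)² = (1 − x²)^{−1}(1 + x)/(1 − x)`
    rw [if_pos hc]
    have hf : (fun n : ℕ => (∑ j ∈ Finset.range (n + 1), reChar χ p ^ j) * (1 / (p : ℝ)) ^ n) =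
        fun n : ℕ => n * (1 / (p : ℝ)) ^ n + (1 / (p : ℝ)) ^ n := by
      funext n; rw [hc]; simp; ring
    have h3 : HasSum (fun n : ℕ => n * (1 / (p : ℝ)) ^ n + (1 / (p : ℝ)) ^ n)
        ((1 / (p : ℝ)) / (1 - 1 / (p : ℝ)) ^ 2 + (1 - 1 / (p : ℝ))⁻¹) :=
      (hasSum_coe_mul_geometric_of_norm_lt_one hxn).add (hasSum_geometric_of_lt_one hx0 hx1)
    rw [hf, (localFactor_values hx0 hx1).2]
    exact h3
  · -- `χ(p) = −1`: `Σ_{n even} x^n = (1 − x²)^{−1}`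
    rw [if_neg (by rw [hc]; norm_num), if_neg (by rw [hc]; norm_num), mul_one]
    have he : HasSum (fun k : ℕ => (∑ j ∈ Finset.range (2 * k + 1), reChar χ p ^ j) *
        (1 / (p : ℝ)) ^ (2 * k)) ((1 - (1 / (p : ℝ)) ^ 2)⁻¹) := by
      have hf : (fun k : ℕ => (∑ j ∈ Finset.range (2 * k + 1), reChar χ p ^ j) *
          (1 / (p : ℝ)) ^ (2 * k)) = fun k : ℕ => ((1 / (p : ℝ)) ^ 2) ^ k := by
        funext k
        have hne : ¬ Even (2 * k + 1) := by rw [Nat.even_add_one, not_not]; exact even_two_mul k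
        rw [hc, neg_one_geom_sum, if_neg hne, one_mul, pow_mul]
      rw [hf]
      exact hasSum_geometric_of_lt_one (pow_nonneg hx0 2) (pow_lt_one₀ hx0 hx1 two_ne_zero)
    have ho : HasSum (fun k : ℕ => (∑ j ∈ Finset.range (2 * k + 1 + 1), reChar χ p ^ j) *
        (1 / (p : ℝ)) ^ (2 * k + 1)) 0 := by
      have hf : (fun k : ℕ => (∑ j ∈ Finset.range (2 * k + 1 + 1), reChar χ p ^ j) *
          (1 / (p : ℝ)) ^ (2 * k + 1)) = fun _ : ℕ => (0 : ℝ) := by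
        funext k
        have hev : Even (2 * k + 1 + 1) := by
          rw [Nat.even_add_one, Nat.even_add_one, not_not]; exact even_two_mul k
        rw [hc, neg_one_geom_sum, if_pos hev, zero_mul]
      rw [hf]
      exact hasSum_zero
    have := HasSum.even_add_odd
      (f := fun n : ℕ => (∑ j ∈ Finset.range (n + 1), reChar χ p ^ j) * (1 / (p : ℝ)) ^ n) he ho
    rwa [add_zero] at this

omit [NeZero D] in
/-- `∏_{p < N}(1 − p^{−2})^{−1} ≤ ζ(2) = π²/6` (the Euler product of `Σ 1/n²` over the `N`-smooth
numbers is a sub-sum of `ζ(2)`). [folklore] -/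
private theorem prod_primesBelow_inv_one_sub_sq_le (N : ℕ) :
    ∏ p ∈ N.primesBelow, (1 - (1 / (p : ℝ)) ^ 2)⁻¹ ≤ Real.pi ^ 2 / 6 := by
  have hgeom : ∀ {p : ℕ}, p.Prime →
      HasSum (fun n : ℕ => 1 / (((p ^ n : ℕ) : ℝ)) ^ 2) (1 - (1 / (p : ℝ)) ^ 2)⁻¹ := by
    intro p hp
    have hp1 : (1 : ℝ) < p := by exact_mod_cast hp.one_lt
    have h0 : 0 ≤ (1 / (p : ℝ)) ^ 2 := by positivity
    have hx1 : 1 / (p : ℝ) < 1 := by rw [div_lt_one (by linarith)]; exact hp1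
    have h1 : (1 / (p : ℝ)) ^ 2 < 1 := by nlinarith [show 0 ≤ 1 / (p : ℝ) by positivity]
    have hf : (fun n : ℕ => 1 / (((p ^ n : ℕ) : ℝ)) ^ 2) = fun n : ℕ => ((1 / (p : ℝ)) ^ 2) ^ n := by
      funext n; rw [Nat.cast_pow, ← pow_mul, one_div_pow, one_div_pow, pow_mul']
    rw [hf]
    exact hasSum_geometric_of_lt_one h0 h1
  have hE := EulerProduct.summable_and_hasSum_smoothNumbers_prod_primesBelow_tsum
    (f := fun n : ℕ => 1 / (n : ℝ) ^ 2) (by simp)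
    (fun {m n} _ => by rw [Nat.cast_mul, mul_pow, one_div_mul_one_div]) (fun {p} hp => by
      refine (hgeom hp).summable.congr fun n => ?_
      rw [Real.norm_of_nonneg (by positivity)]) N
  have hfac : ∀ p ∈ N.primesBelow, ∑' n : ℕ, 1 / (((p ^ n : ℕ) : ℝ)) ^ 2 =
      (1 - (1 / (p : ℝ)) ^ 2)⁻¹ := fun p hp => (hgeom (Nat.prime_of_mem_primesBelow hp)).tsum_eq
  calc ∏ p ∈ N.primesBelow, (1 - (1 / (p : ℝ)) ^ 2)⁻¹
      = ∏ p ∈ N.primesBelow, ∑' n : ℕ, 1 / (((p ^ n : ℕ) : ℝ)) ^ 2 :=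
        (Finset.prod_congr rfl hfac).symm
    _ = ∑' m : N.smoothNumbers, 1 / ((m : ℕ) : ℝ) ^ 2 := hE.2.tsum_eq.symm
    _ ≤ ∑' m : ℕ, 1 / (m : ℝ) ^ 2 :=
        Summable.tsum_subtype_le (fun n : ℕ => 1 / (n : ℝ) ^ 2) _ (fun n => by positivity)
          hasSum_zeta_two.summable
    _ = Real.pi ^ 2 / 6 := hasSum_zeta_two.tsum_eq

/-- **The upper bound for `S = Σ_{n ≤ D²} g(n)/n` (3.7), PROVED**: for a real character `χ` mod `D`,
`Σ_{n ≤ D²} g(n)/n ≤ exp(4 Σ_{p ≤ D², χ(p)=1} 1/p) · (π²/6) ∏_{p ∣ D}(1 + 1/p)`.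
[cite: Pintz1976ElementaryII, §3 (3.7) p. 283] -/
theorem gSum_sq_le_exp_mul_prod (hq : χ ^ 2 = 1) :
    gSum χ ((D : ℝ) ^ 2) ≤
      Real.exp (4 * ∑ p ∈ (Finset.range (D ^ 2 + 1)).filter
          (fun p : ℕ => p.Prime ∧ χ (p : ZMod D) = 1), 1 / (p : ℝ)) *
        (Real.pi ^ 2 / 6 * ∏ p ∈ D.primeFactors, (1 + 1 / (p : ℝ))) := by
  classical
  have hf0 : ∀ n : ℕ, 0 ≤ charDivisorSum χ n / (n : ℝ) := fun n =>
    div_nonneg (charDivisorSum_nonneg χ hq n) (Nat.cast_nonneg n)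
  have hE := (EulerProduct.summable_and_hasSum_smoothNumbers_prod_primesBelow_tsum
    (f := fun n : ℕ => charDivisorSum χ n / (n : ℝ)) (by simp)
    (fun {m n} hmn => by
      rw [(isMultiplicative_charDivisorSum χ hq).map_mul_of_coprime hmn, Nat.cast_mul,
        mul_div_mul_comm])
    (fun {p} hp => by
      refine (hasSum_charDivisorSum_primePow_div χ hq hp).summable.congr fun n => ?_
      rw [Real.norm_of_nonneg (hf0 _)]) (D ^ 2 + 1)).2
  -- Step 1: the finite sum is a sub-sum of the sum over the `(D²+1)`-smooth numbers
  have hS : gSum χ ((D : ℝ) ^ 2) ≤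
      ∏ p ∈ Nat.primesBelow (D ^ 2 + 1), ∑' n : ℕ, charDivisorSum χ (p ^ n) / ((p ^ n : ℕ) : ℝ) := by
    rw [gSum_sq]
    have hsub : ∀ n ∈ Finset.Icc 1 (D ^ 2), n ∈ Nat.smoothNumbers (D ^ 2 + 1) := fun n hn => by
      rw [Finset.mem_Icc] at hn
      exact Nat.mem_smoothNumbers_of_lt hn.1 (by omega)
    have hE' := (hasSum_subtype_iff_indicator
      (f := fun n : ℕ => charDivisorSum χ n / (n : ℝ))).mp hE
    have heq : ∑ n ∈ Finset.Icc 1 (D ^ 2), g χ n / (n : ℝ) =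
        ∑ n ∈ Finset.Icc 1 (D ^ 2),
          (Nat.smoothNumbers (D ^ 2 + 1)).indicator (fun n : ℕ => charDivisorSum χ n / (n : ℝ)) n :=
      Finset.sum_congr rfl fun n hn => by rw [Set.indicator_of_mem (hsub n hn), g_eq_charDivisorSum]
    rw [heq]
    exact sum_le_hasSum _ (fun n _ => Set.indicator_nonneg (fun m _ => hf0 m) _) hE'
  -- Step 2: the local factors
  have hfac : ∀ p ∈ Nat.primesBelow (D ^ 2 + 1),
      ∑' n : ℕ, charDivisorSum χ (p ^ n) / ((p ^ n : ℕ) : ℝ) =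
        (1 - (1 / (p : ℝ)) ^ 2)⁻¹ *
          (if reChar χ p = 1 then (1 + 1 / (p : ℝ)) / (1 - 1 / (p : ℝ))
           else if reChar χ p = 0 then 1 + 1 / (p : ℝ) else 1) := fun p hp =>
    (hasSum_charDivisorSum_primePow_div χ hq (Nat.prime_of_mem_primesBelow hp)).tsum_eq
  rw [Finset.prod_congr rfl hfac, Finset.prod_mul_distrib] at hS
  -- Step 3: `∏ (1 − p^{−2})^{−1} ≤ π²/6`
  have hZ := prod_primesBelow_inv_one_sub_sq_le (D ^ 2 + 1)
  have hZ0 : 0 ≤ ∏ p ∈ Nat.primesBelow (D ^ 2 + 1), (1 - (1 / ((p : ℕ) : ℝ)) ^ 2)⁻¹ := by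
    refine Finset.prod_nonneg fun p hp => inv_nonneg.mpr ?_
    have hp1 : (1 : ℝ) < p := by exact_mod_cast (Nat.prime_of_mem_primesBelow hp).one_lt
    have hx1 : 1 / (p : ℝ) < 1 := by rw [div_lt_one (by linarith)]; exact hp1
    nlinarith [show 0 ≤ 1 / (p : ℝ) by positivity]
  -- Step 4: `∏ E_p = ∏_{p ∣ D}(1 + 1/p) · ∏_{χ(p)=1}(1 + 1/p)/(1 − 1/p)`
  have hEprod : ∏ p ∈ Nat.primesBelow (D ^ 2 + 1),
      (if reChar χ p = 1 then (1 + 1 / (p : ℝ)) / (1 - 1 / (p : ℝ))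
       else if reChar χ p = 0 then 1 + 1 / (p : ℝ) else 1) =
      (∏ p ∈ D.primeFactors, (1 + 1 / (p : ℝ))) *
        ∏ p ∈ (Finset.range (D ^ 2 + 1)).filter (fun p : ℕ => p.Prime ∧ χ (p : ZMod D) = 1),
          (1 + 1 / (p : ℝ)) / (1 - 1 / (p : ℝ)) := by
    have hsplit : ∀ p ∈ Nat.primesBelow (D ^ 2 + 1),
        (if reChar χ p = 1 then (1 + 1 / (p : ℝ)) / (1 - 1 / (p : ℝ))
         else if reChar χ p = 0 then 1 + 1 / (p : ℝ) else 1) =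
        (if p ∣ D then 1 + 1 / (p : ℝ) else 1) *
          (if χ (p : ZMod D) = 1 then (1 + 1 / (p : ℝ)) / (1 - 1 / (p : ℝ)) else 1) := by
      intro p hp
      have hpp := Nat.prime_of_mem_primesBelow hp
      have h01 := reChar_prime_eq_zero_iff χ hq hpp
      have h11 := reChar_eq_one_iff χ hq hpp.ne_zero
      rcases reChar_trichotomy χ hq p with hc | hc | hc
      · have hdvd : p ∣ D := h01.mp hc
        have hn1 : ¬ χ (p : ZMod D) = 1 := fun h => by rw [← h11, hc] at h; norm_num at h
        rw [if_neg (by rw [hc]; norm_num), if_pos hc, if_pos hdvd, if_neg hn1, mul_one]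
      · have hnd : ¬ p ∣ D := fun h => by rw [h01.mpr h] at hc; norm_num at hc
        rw [if_pos hc, if_neg hnd, if_pos (h11.mp hc), one_mul]
      · have hnd : ¬ p ∣ D := fun h => by rw [h01.mpr h] at hc; norm_num at hc
        have hn1 : ¬ χ (p : ZMod D) = 1 := fun h => by rw [← h11, hc] at h; norm_num at h
        rw [if_neg (by rw [hc]; norm_num), if_neg (by rw [hc]; norm_num), if_neg hnd, if_neg hn1,
          mul_one]
    rw [Finset.prod_congr rfl hsplit, Finset.prod_mul_distrib, ← Finset.prod_filter,
      ← Finset.prod_filter]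
    congr 1
    · congr 1
      ext p
      simp only [Finset.mem_filter, Nat.mem_primesBelow, Nat.mem_primeFactors]
      constructor
      · rintro ⟨⟨-, hp⟩, hd⟩; exact ⟨hp, hd, NeZero.ne D⟩
      · rintro ⟨hp, hd, hD⟩
        exact ⟨⟨Nat.lt_succ_of_le (le_trans (Nat.le_of_dvd (NeZero.pos D) hd)
          (Nat.le_self_pow two_ne_zero D)), hp⟩, hd⟩
    · congr 1
      ext p
      simp only [Finset.mem_filter, Nat.mem_primesBelow, Finset.mem_range]
      tauto
  -- Step 5: `∏_{χ(p)=1}(1 + 1/p)/(1 − 1/p) ≤ exp(4 Σ 1/p)`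
  have hB0 : ∀ p ∈ (Finset.range (D ^ 2 + 1)).filter (fun p : ℕ => p.Prime ∧ χ (p : ZMod D) = 1),
      0 ≤ (1 + 1 / (p : ℝ)) / (1 - 1 / (p : ℝ)) := by
    intro p hp
    have hpp : p.Prime := ((Finset.mem_filter.mp hp).2).1
    have hp1 : (1 : ℝ) < p := by exact_mod_cast hpp.one_lt
    have hx1 : 1 / (p : ℝ) < 1 := by rw [div_lt_one (by linarith)]; exact hp1
    exact div_nonneg (by positivity) (by linarith)
  have hB : ∏ p ∈ (Finset.range (D ^ 2 + 1)).filter (fun p : ℕ => p.Prime ∧ χ (p : ZMod D) = 1),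
      (1 + 1 / (p : ℝ)) / (1 - 1 / (p : ℝ)) ≤
      Real.exp (4 * ∑ p ∈ (Finset.range (D ^ 2 + 1)).filter
          (fun p : ℕ => p.Prime ∧ χ (p : ZMod D) = 1), 1 / (p : ℝ)) := by
    rw [Finset.mul_sum, Real.exp_sum]
    refine Finset.prod_le_prod hB0 fun p hp => ?_
    · have hpp : p.Prime := ((Finset.mem_filter.mp hp).2).1
      have hp2 : (2 : ℝ) ≤ p := by exact_mod_cast hpp.two_le
      refine one_add_div_one_sub_le_exp (by positivity) ?_
      rw [div_le_div_iff₀ (by linarith) (by norm_num)]; linarith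
  have hP0 : 0 ≤ ∏ p ∈ D.primeFactors, (1 + 1 / (p : ℝ)) :=
    Finset.prod_nonneg fun p _ => by positivity
  -- combine
  calc gSum χ ((D : ℝ) ^ 2)
      ≤ (∏ p ∈ Nat.primesBelow (D ^ 2 + 1), (1 - (1 / ((p : ℕ) : ℝ)) ^ 2)⁻¹) *
          ((∏ p ∈ D.primeFactors, (1 + 1 / (p : ℝ))) *
            ∏ p ∈ (Finset.range (D ^ 2 + 1)).filter
                (fun p : ℕ => p.Prime ∧ χ (p : ZMod D) = 1),
              (1 + 1 / (p : ℝ)) / (1 - 1 / (p : ℝ))) := by rw [← hEprod]; exact hS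
    _ ≤ (Real.pi ^ 2 / 6) * ((∏ p ∈ D.primeFactors, (1 + 1 / (p : ℝ))) *
          Real.exp (4 * ∑ p ∈ (Finset.range (D ^ 2 + 1)).filter
            (fun p : ℕ => p.Prime ∧ χ (p : ZMod D) = 1), 1 / (p : ℝ))) :=
        mul_le_mul hZ (mul_le_mul_of_nonneg_left hB hP0)
          (mul_nonneg hP0 (Finset.prod_nonneg hB0)) (by positivity)
    _ = _ := by ring

end EulerUpper

/-! ## Part K. Theorem 2: assembly

PRINT (Theorem 2, p. 276): "If `−D < 0` is a fundamental discriminant, for which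
`h(−D) ≤ log D/(2 log log D)` (1.18), then for the Siegel zero of `L(s, χ_D)` (which exists
according to Theorem 7 of [14]) we have
`L(1)/δ ∼ (π²/6) ∏_{p∣D}(1 + 1/p) ⟺ δ ∼ (6/π²) L(1) ∏_{p∣D}(1 + 1/p)^{−1} = 6h(−D)/(π ∏_{p∣D}(1 + 1/p) √D)`
(1.19)." Proof (pp. 282–283): "Owing to Theorem 1 it is sufficient to show (1.19) for the greatest
real zero … and … to prove `S ≤ (1 + o(1))(π²/6)∏_{p∣D}(1 + 1/p)` (3.1) [by (3.2)–(3.7)]."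
HERE: with `e = min(ε,1)/42`, Theorem 1 (`pintz1976_theorem1_holds` at `e`) gives
`|L(1)/(δS) − 1| ≤ e` and `S ≥ P(π²/6 − e)` (`P = ∏_{p∣D}(1 + 1/p)`), once `L(1) log D ≤ η`; the
latter follows from `h ≤ log D/(2 log log D)` by the class number formula `L(1) = π h/√D`
(`Quadratic.LFunction_one_eq_of_discr_neg_of_eq`, `w = 2`; `classNumber_budget`). Parts I, H, J give
`S ≤ exp(4(e/4 + e)) (π²/6) P ≤ (1 + 10e)(π²/6)P`. Hence `L(1)/(δ (π²/6) P) ∈ [1 − 21e, 1 + 21e]`,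
and the second form of (1.19) is the reciprocal ratio (`L(1) = π h/√D`). -/

section TheoremTwo

open Literature.NumberTheory.QuadraticFields

/-- **The class-number budget.** For every `η > 0` there is `D₃` such that for `D ≥ D₃`, `D ≥ 16`
and `0 ≤ h ≤ log D/(2 log log D)`: `π h log D/√D ≤ η` — so, by the class number formula
`L(1) = π h/√D`, hypothesis (1.18) puts `χ_D` in the range `L(1) log D ≤ η` of Theorem 1 ("which
exists according to Theorem 7 of [14]", p. 276). [cite: Pintz1976ElementaryII, Theorem 2 p. 276] -/
private theorem classNumber_budget {η : ℝ} (hη : 0 < η) :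
    ∃ D₃ : ℕ, ∀ D : ℕ, D₃ ≤ D → 16 ≤ D → ∀ h : ℝ, 0 ≤ h →
      h ≤ Real.log D / (2 * Real.log (Real.log D)) →
        Real.pi * h / Real.sqrt D * Real.log D ≤ η := by
  refine ⟨⌈(64 * Real.pi / η) ^ 8⌉₊, fun D hD hD16 h h0 hh => ?_⟩
  have hD16r : (16 : ℝ) ≤ D := by exact_mod_cast hD16
  have hD0 : (0 : ℝ) < D := by linarith
  have hπ := Real.pi_pos
  -- `u = D^{1/8}`: `log D ≤ 8u`, `√D = u⁴`
  obtain ⟨u, hu⟩ : ∃ u : ℝ, u = (D : ℝ) ^ ((1 : ℝ) / 8) := ⟨_, rfl⟩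
  have hu0 : 0 < u := by rw [hu]; exact Real.rpow_pos_of_pos hD0 _
  have hu1 : 1 ≤ u := by rw [hu]; exact Real.one_le_rpow (by linarith) (by norm_num)
  have hu8 : u ^ 8 = (D : ℝ) := by rw [hu, ← Real.rpow_mul_natCast hD0.le]; norm_num
  have hsqrt : Real.sqrt D = u ^ 4 := by
    rw [← hu8, show u ^ 8 = (u ^ 4) ^ 2 by ring, Real.sqrt_sq (by positivity)]
  have hlog : Real.log D ≤ 8 * u := by rw [hu]; exact log_le_eight_mul_rpow hD0.le
  have hlog0 : 0 < Real.log D := Real.log_pos (by linarith)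
  -- `log log D ≥ 1/2`, so `h ≤ log D`
  have hlog2 : 2 ≤ Real.log D := by
    rw [Real.le_log_iff_exp_le hD0]
    have h1 := Real.exp_one_lt_d9
    have h2 : Real.exp 2 = Real.exp 1 * Real.exp 1 := by rw [← Real.exp_add]; norm_num
    nlinarith [Real.exp_pos 1]
  have hLL : 1 / 2 ≤ Real.log (Real.log D) :=
    calc (1 : ℝ) / 2 ≤ Real.log 2 := by linarith [Real.log_two_gt_d9]
      _ ≤ Real.log (Real.log D) := Real.log_le_log two_pos hlog2
  have hhlog : h ≤ Real.log D :=
    calc h ≤ Real.log D / (2 * Real.log (Real.log D)) := hh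
      _ ≤ Real.log D / 1 := div_le_div_of_nonneg_left hlog0.le one_pos (by linarith)
      _ = Real.log D := div_one _
  -- `u ≥ 64π/η`
  have huη : 64 * Real.pi / η ≤ u := by
    have h1 : ((64 * Real.pi / η) ^ 8 : ℝ) ≤ D := le_trans (Nat.le_ceil _) (by exact_mod_cast hD)
    rw [← hu8] at h1
    exact le_of_pow_le_pow_left₀ (by norm_num) hu0.le h1
  have hhl : h * Real.log D ≤ (8 * u) ^ 2 :=
    calc h * Real.log D ≤ Real.log D * Real.log D := mul_le_mul_of_nonneg_right hhlog hlog0.le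
      _ ≤ (8 * u) * (8 * u) := mul_le_mul hlog hlog hlog0.le (by positivity)
      _ = (8 * u) ^ 2 := by ring
  calc Real.pi * h / Real.sqrt D * Real.log D
      = Real.pi * (h * Real.log D) / u ^ 4 := by rw [hsqrt]; ring
    _ ≤ Real.pi * (8 * u) ^ 2 / u ^ 4 := by gcongr
    _ = 64 * Real.pi / u ^ 2 := by field_simp; ring
    _ ≤ 64 * Real.pi / u := div_le_div_of_nonneg_left (by positivity) hu0 (by nlinarith)
    _ ≤ η := by rw [div_le_iff₀ hu0]; rw [div_le_iff₀ hη] at huη; linarith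

/-- **Theorem 2 with the modulus as a separate variable** (`D = |d_K|`, `χ` the odd real primitive
character mod `D`): under `h_K ≤ log D/(2 log log D)`, for the greatest real zero `β = 1 − δ` of
`L(s, χ)`, `|L(1)/(δ (π²/6)∏_{p∣D}(1 + 1/p)) − 1| ≤ ε` and
`|δ/(6h_K/(π ∏_{p∣D}(1 + 1/p) √D)) − 1| ≤ ε` for `D ≥ D₀(ε)`.
[cite: Pintz1976ElementaryII, Theorem 2 p. 276, proof §3 pp. 282–283] -/
theorem theorem2_aux {ε : ℝ} (hε : 0 < ε) :
    ∃ D₀ : ℕ, ∀ (D : ℕ) [NeZero D] (K : Type) [Field K] [NumberField K],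
      Module.finrank ℚ K = 2 → NumberField.discr K < 0 → (NumberField.discr K).natAbs = D →
      D₀ ≤ D →
      (NumberField.classNumber K : ℝ) ≤ Real.log D / (2 * Real.log (Real.log D)) →
      ∀ χ : DirichletCharacter ℂ D, χ.IsQuadratic → χ.IsPrimitive → χ.Odd →
        ∀ β : ℝ, IsGreatestRealZero χ β →
          |(χ.LFunction 1).re / (1 - β) /
                (Real.pi ^ 2 / 6 * ∏ p ∈ D.primeFactors, (1 + 1 / (p : ℝ))) - 1| ≤ ε ∧
          |(1 - β) /
                (6 * (NumberField.classNumber K : ℝ) /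
                  (Real.pi * (∏ p ∈ D.primeFactors, (1 + 1 / (p : ℝ))) * Real.sqrt D)) -
              1| ≤ ε := by
  -- the budget `e = min(ε, 1)/42`
  obtain ⟨e, he_def⟩ : ∃ e : ℝ, e = min ε 1 / 42 := ⟨_, rfl⟩
  have hmin0 : 0 < min ε 1 := lt_min hε one_pos
  have he : 0 < e := by rw [he_def]; positivity
  have he42 : 42 * e = min ε 1 := by rw [he_def]; ring
  have hm1 : min ε 1 ≤ 1 := min_le_right _ _
  have hmε : min ε 1 ≤ ε := min_le_left _ _
  have he1 : 42 * e ≤ 1 := by rw [he42]; exact hm1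
  obtain ⟨η₁, hη₁, D₁, hD₁⟩ := pintz1976_theorem1_holds e he
  obtain ⟨η₂, hη₂, D₂, hD₂⟩ := sum_inv_splitPrimes_le e he
  obtain ⟨D₃, hD₃⟩ := classNumber_budget (lt_min hη₁ hη₂)
  refine ⟨max (max D₁ D₂) (max D₃ (max 16 ⌈Real.exp (Real.exp (8 / e))⌉₊)), ?_⟩
  intro D _ K _ _ h2 hd hKD hD0 hh χ hquad hprim hodd β hβ
  have hDD₁ : D₁ ≤ D := le_trans (le_trans (le_max_left _ _) (le_max_left _ _)) hD0
  have hDD₂ : D₂ ≤ D := le_trans (le_trans (le_max_right _ _) (le_max_left _ _)) hD0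
  have hDD₃ : D₃ ≤ D := le_trans (le_trans (le_max_left _ _) (le_max_right _ _)) hD0
  have hD16 : 16 ≤ D :=
    le_trans (le_trans (le_trans (le_max_left _ _) (le_max_right _ _)) (le_max_right _ _)) hD0
  have hDexp : ⌈Real.exp (Real.exp (8 / e))⌉₊ ≤ D :=
    le_trans (le_trans (le_trans (le_max_right _ _) (le_max_right _ _)) (le_max_right _ _)) hD0
  have hD16r : (16 : ℝ) ≤ D := by exact_mod_cast hD16
  have hD0r : (0 : ℝ) < D := by linarith only [hD16r]
  have hq : χ ^ 2 = 1 := MulChar.IsQuadratic.sq_eq_one hquad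
  have hΔ : NumberField.discr K = -(D : ℤ) := by rw [← hKD]; omega
  -- the class number formula `L(1) = π h/√D` (`w = 2` as `d_K < −4`)
  have hne : χ ≠ 1 := by
    intro h1
    have h := hodd
    rw [DirichletCharacter.Odd, h1, MulChar.one_apply isUnit_one.neg] at h
    norm_num at h
  have hd4 : NumberField.discr K < -4 := by omega
  have hcnf := Quadratic.LFunction_one_eq_of_discr_neg_of_eq h2 hd hne (fun s hs => by
    rw [← DirichletCharacter.LFunction_eq_LSeries χ (show 1 < (s : ℂ).re by simpa using hs)]
    exact Quadratic.dedekindZeta_eq_riemannZeta_mul_LFunction_of_odd_primitive hprim hquad hodd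
      h2 hΔ (by simpa using hs))
  have hw : (NumberField.Units.torsionOrder K : ℝ) = 2 := by
    exact_mod_cast Quadratic.torsionOrder_eq_two_of_discr_lt_neg_four h2 hd4
  have habs : |(NumberField.discr K : ℝ)| = (D : ℝ) := by
    rw [← hKD, Nat.cast_natAbs, Int.cast_abs]
  obtain ⟨h, hh_def⟩ : ∃ h : ℝ, h = (NumberField.classNumber K : ℝ) := ⟨_, rfl⟩
  rw [← hh_def] at hh ⊢
  have hh1 : 1 ≤ h := by rw [hh_def]; exact_mod_cast NumberField.classNumber_pos K
  have hsqrtD : 0 < Real.sqrt D := Real.sqrt_pos.2 hD0r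
  have hπ := Real.pi_pos
  have hL1 : (χ.LFunction 1).re = Real.pi * h / Real.sqrt D := by
    rw [hcnf, Complex.ofReal_re, hw, habs, hh_def, mul_assoc,
      mul_div_mul_left _ _ (two_ne_zero' ℝ)]
  -- the budget `L(1) log D ≤ min η₁ η₂`
  have hbudget : (χ.LFunction 1).re * Real.log D ≤ min η₁ η₂ := by
    rw [hL1]; exact hD₃ D hDD₃ hD16 h (by linarith only [hh1]) hh
  -- Theorem 1 at `e`: `|L(1)/(δ S) − 1| ≤ e` and `S ≥ P(π²/6 − e)`
  obtain ⟨-, hall⟩ := hD₁ D hDD₁ χ hquad hprim (hbudget.trans (min_le_left _ _))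
  obtain ⟨-, hA2, hA3⟩ := hall β hβ
  -- (3.5)–(3.6): the split primes in `(√D/2, D²]`
  have hS2 := hD₂ D hDD₂ χ hquad hprim (hbudget.trans (min_le_right _ _))
  -- (3.2)–(3.4): the split primes `≤ √D/2`
  have hLL : 8 / e ≤ Real.log (Real.log D) := by
    have h1 : Real.exp (Real.exp (8 / e)) ≤ D :=
      le_trans (Nat.le_ceil _) (by exact_mod_cast hDexp)
    have h2 : Real.exp (8 / e) ≤ Real.log D := by
      rw [Real.le_log_iff_exp_le hD0r]; exact h1
    rw [Real.le_log_iff_exp_le (lt_of_lt_of_le (Real.exp_pos _) h2)]; exact h2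
  have hLLpos : 0 < Real.log (Real.log D) := lt_of_lt_of_le (by positivity) hLL
  have hS1 : ∑ p ∈ (Finset.range (D ^ 2 + 1)).filter
      (fun p : ℕ => p.Prime ∧ ¬ (Real.sqrt D / 2 < (p : ℝ)) ∧ χ (p : ZMod D) = 1), 1 / (p : ℝ) ≤
      e / 4 := by
    have hP : ∀ p ∈ (Finset.range (D ^ 2 + 1)).filter
        (fun p : ℕ => p.Prime ∧ ¬ (Real.sqrt D / 2 < (p : ℝ)) ∧ χ (p : ZMod D) = 1),
        p.Prime ∧ 4 * p ^ 2 ≤ D ∧ χ (p : ZMod D) = 1 := by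
      intro p hp
      obtain ⟨-, hpp, hle, hχ⟩ := Finset.mem_filter.mp hp
      refine ⟨hpp, ?_, hχ⟩
      push Not at hle
      have h2p : 2 * (p : ℝ) ≤ Real.sqrt D := by linarith only [hle]
      have h4 : (4 * (p : ℝ) ^ 2) ≤ D :=
        calc 4 * (p : ℝ) ^ 2 = (2 * p) ^ 2 := by ring
          _ ≤ (Real.sqrt D) ^ 2 := pow_le_pow_left₀ (by positivity) h2p 2
          _ = D := Real.sq_sqrt hD0r.le
      exact_mod_cast h4
    calc _ ≤ h * (4 / (D : ℝ)) ^ (1 / (2 * h)) := by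
          rw [hh_def]; exact sum_inv_smallSplitPrimes_le h2 hd hKD hprim hquad hodd _ hP
      _ ≤ 2 / Real.log (Real.log D) := mul_rpow_le_two_div_loglog hD16r hh1 hh
      _ ≤ e / 4 := by
          rw [div_le_div_iff₀ hLLpos (by norm_num : (0 : ℝ) < 4)]
          have := mul_le_mul_of_nonneg_left hLL he.le
          rw [mul_div_cancel₀ _ he.ne'] at this
          linarith only [this]
  -- all the split primes `≤ D²`
  have hSall : ∑ p ∈ (Finset.range (D ^ 2 + 1)).filter
      (fun p : ℕ => p.Prime ∧ χ (p : ZMod D) = 1), 1 / (p : ℝ) ≤ e / 4 + e := by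
    rw [← Finset.sum_filter_add_sum_filter_not _ (fun p : ℕ => Real.sqrt D / 2 < (p : ℝ)),
      Finset.filter_filter, Finset.filter_filter, add_comm]
    refine add_le_add (Eq.trans_le ?_ hS1) (Eq.trans_le ?_ hS2)
    · refine Finset.sum_congr (Finset.filter_congr fun p _ => ?_) fun _ _ => rfl
      tauto
    · refine Finset.sum_congr (Finset.filter_congr fun p _ => ?_) fun _ _ => rfl
      tauto
  -- Part J: `S ≤ exp(4Σ) (π²/6) P ≤ exp(5e) (π²/6) P ≤ (1 + 10e)(π²/6) P`
  obtain ⟨P, hP_def⟩ : ∃ P : ℝ, P = ∏ p ∈ D.primeFactors, (1 + 1 / (p : ℝ)) := ⟨_, rfl⟩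
  obtain ⟨S, hS_def⟩ : ∃ S : ℝ, S = gSum χ ((D : ℝ) ^ 2) := ⟨_, rfl⟩
  rw [← hP_def] at hA3 ⊢
  rw [← hS_def] at hA2 hA3
  have hP1 : 1 ≤ P := by rw [hP_def]; exact one_le_prod_primeFactors D
  have hP0 : 0 < P := by linarith
  have hπ3 : 3 < Real.pi := Real.pi_gt_three
  have hZpos : 0 < Real.pi ^ 2 / 6 * P := by positivity
  have hSup : S ≤ Real.exp (5 * e) * (Real.pi ^ 2 / 6 * P) := by
    calc S ≤ Real.exp (4 * ∑ p ∈ (Finset.range (D ^ 2 + 1)).filter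
          (fun p : ℕ => p.Prime ∧ χ (p : ZMod D) = 1), 1 / (p : ℝ)) * (Real.pi ^ 2 / 6 * P) := by
          rw [hS_def, hP_def]; exact gSum_sq_le_exp_mul_prod χ hq
      _ ≤ Real.exp (5 * e) * (Real.pi ^ 2 / 6 * P) :=
          mul_le_mul_of_nonneg_right (Real.exp_le_exp.mpr (by linarith only [hSall])) hZpos.le
  have hexp : Real.exp (5 * e) ≤ 1 + 10 * e := by
    have h5 : |5 * e| ≤ 1 := by rw [abs_of_pos (by positivity)]; linarith only [he1]
    have h' := Real.abs_exp_sub_one_le h5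
    rw [abs_of_pos (by positivity : (0 : ℝ) < 5 * e)] at h'
    have := (abs_le.mp h').2
    linarith only [this]
  -- the two ratios: `r₁ = L(1)/(δ S) ∈ [1 − e, 1 + e]`, `ρ = S/((π²/6)P) ∈ [1 − e, 1 + 10e]`
  have hβ1 : β < 1 := hβ.1
  have hδ : 0 < 1 - β := by linarith only [hβ1]
  have hπ6 : 1 ≤ Real.pi ^ 2 / 6 := by
    have : (9 : ℝ) < Real.pi ^ 2 := by nlinarith only [hπ3]
    linarith only [this]
  have hSpos : 0 < S := by
    have h1 : P * (Real.pi ^ 2 / 6 - e) ≥ 1 * (1 - e) :=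
      mul_le_mul hP1 (by linarith only [hπ6]) (by linarith only [he1]) (by linarith only [hP1])
    linarith only [h1, hA3, he1]
  have hρup : S / (Real.pi ^ 2 / 6 * P) ≤ 1 + 10 * e := by
    rw [div_le_iff₀ hZpos]
    exact hSup.trans (mul_le_mul_of_nonneg_right hexp hZpos.le)
  have hρlow : 1 - e ≤ S / (Real.pi ^ 2 / 6 * P) := by
    rw [le_div_iff₀ hZpos]
    have h1 : e * P * 1 ≤ e * P * (Real.pi ^ 2 / 6) :=
      mul_le_mul_of_nonneg_left hπ6 (mul_nonneg he.le hP0.le)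
    linarith only [h1, hA3]
  obtain ⟨r, hr_def⟩ :
      ∃ r : ℝ, r = (χ.LFunction 1).re / (1 - β) / (Real.pi ^ 2 / 6 * P) := ⟨_, rfl⟩
  have hr21 : |r - 1| ≤ 21 * e := by
    obtain ⟨r₁, hr₁⟩ : ∃ r₁ : ℝ, r₁ = (χ.LFunction 1).re / (1 - β) / S := ⟨_, rfl⟩
    obtain ⟨ρ, hρ⟩ : ∃ ρ : ℝ, ρ = S / (Real.pi ^ 2 / 6 * P) := ⟨_, rfl⟩
    have hr_eq : r = r₁ * ρ := by
      rw [hr_def, hr₁, hρ]; field_simp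
    rw [← hr₁] at hA2
    rw [← hρ] at hρup hρlow
    have h1 := abs_le.mp hA2
    have hρ0 : 0 < ρ := by linarith only [hρlow, he1]
    have hup : r₁ * ρ ≤ (1 + e) * ρ := mul_le_mul_of_nonneg_right (by linarith only [h1.2]) hρ0.le
    have hup2 : (1 + e) * ρ ≤ (1 + e) * (1 + 10 * e) :=
      mul_le_mul_of_nonneg_left hρup (by linarith only [he])
    have hlow : (1 - e) * ρ ≤ r₁ * ρ := mul_le_mul_of_nonneg_right (by linarith only [h1.1]) hρ0.le
    have hlow2 : (1 - e) * (1 - e) ≤ (1 - e) * ρ := mul_le_mul_of_nonneg_left hρlow (by linarith only [he1])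
    have hee : e * e ≤ e * 1 := mul_le_mul_of_nonneg_left (by linarith only [he1]) he.le
    rw [hr_eq, abs_le]
    constructor
    · linarith only [sq_nonneg e, hlow, hlow2, he]
    · linarith only [hup, hup2, hee]
  have h21 : 21 * e = min ε 1 / 2 := by linarith only [he42]
  constructor
  · -- (1.19), first form
    rw [← hr_def]
    calc |r - 1| ≤ 21 * e := hr21
      _ ≤ ε := by rw [h21]; linarith only [hmε, hmin0]
  · -- (1.19), second form: the quantity is `1/r` (`L(1) = π h/√D`)
    have hr_pos : 0 < r := by have := (abs_le.mp hr21).1; linarith only [this, he1]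
    have hr0 : r ≠ 0 := hr_pos.ne'
    have hq_eq : (1 - β) / (6 * h / (Real.pi * P * Real.sqrt D)) = 1 / r := by
      rw [hr_def, hL1]
      field_simp
    have hid : -(r - 1) / r = 1 / r - 1 := by rw [neg_sub, sub_div, div_self hr0]
    rw [hq_eq, ← hid, abs_div, abs_neg, abs_of_pos hr_pos, div_le_iff₀ hr_pos]
    have hrm : |r - 1| ≤ min ε 1 / 2 := by rw [← h21]; exact hr21
    have hrlow : 1 - min ε 1 / 2 ≤ r := by have := (abs_le.mp hrm).1; linarith only [this]
    rcases le_total ε 1 with hε1 | hε1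
    · rw [min_eq_left hε1] at hrm hrlow
      have p1 : ε * (1 - ε / 2) ≤ ε * r := mul_le_mul_of_nonneg_left hrlow hε.le
      have p2 : ε * ε ≤ ε * 1 := mul_le_mul_of_nonneg_left hε1 hε.le
      linarith only [hrm, p1, p2]
    · rw [min_eq_right hε1] at hrm hrlow
      have p3 : 1 * r ≤ ε * r := mul_le_mul_of_nonneg_right hε1 hr_pos.le
      linarith only [hrm, hrlow, p3]

end TheoremTwo

/-! ## Part L. (6.1): `Σ_{n ≤ D²} g(n)/n ≪ exp(Σ_{p ≤ D²} (1 + χ(p))/p)`, and Theorem 5 from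
Theorems 1 and 4

PRINT (p. 288, §6 "Proof of Theorem 5"): "As for an arbitrary `u, v`, `g(uv) ≤ g(u)d(v)`, and
`g(q) = ∏_{p∣q}(1 + χ(p))` if `μ(q) ≠ 0`, considering `Σ_m d(m²)/m² = (Σ 1/n²)² ∏_p(1 + 1/p²) < ζ³(2)
= O(1)` we have (6.1) `Σ_{n≤D²} g(n)/n ≤ Σ_{q≤D², μ(q)≠0} g(q)/q · Σ_{m²≤D²/q} d(m²)/m² ≪ Σ_q g(q)/q
≤ ∏_{p≤D²}(1 + (1 + χ(p))/p) < exp(Σ_{p≤D²}(1 + χ(p))/p)`. Now Theorem 1 and Theorem 4 give that in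
case of `L(1) ≤ 1/log²D` for the Siegel-zero `1 − δ` of `L(s)` (which exists by the theorem of Hecke
[11]) (1.31) holds, i.e., `L(1)/δ ∼ L'(1) ∼ Σ_{n≤D²} g(n)/n ≪ (log D log log D/log(1/(5L(1) log D)))²`."
HERE: (6.1) is obtained from the Euler product of Part J instead of the `d(m²)` majorant: the local
factor `(1 − p^{−2})^{−1} E_p` has `E_p ≤ exp((1 + χ(p))/p + 4/p²)` (`(1+x)/(1−x) ≤ 1 + 2x + 4x²`
for `x ≤ 1/2`), so `Σ_{n≤D²} g(n)/n ≤ (π²/6) e^{2π²/3} exp(Σ_{p≤D²}(1 + χ(p))/p)` (explicit `≪`);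
and Theorem 5 follows from Theorem 1 (PROVED, at `ε = 1/2`) and Theorem 4 (a named fact of the
statement file) — `theorem5_of_theorem4`. -/

section SixOne

variable {D : ℕ} [NeZero D] (χ : DirichletCharacter ℂ D)

omit [NeZero D] in
/-- `(1 + x)/(1 − x) ≤ exp(2x + 4x²)` for `0 ≤ x ≤ 1/2` (`(1+x)/(1−x) = 1 + 2x/(1−x) ≤ 1 + 2x + 4x²`).
[folklore] -/
private theorem one_add_div_one_sub_le_exp' {x : ℝ} (h0 : 0 ≤ x) (h2 : x ≤ 1 / 2) :
    (1 + x) / (1 - x) ≤ Real.exp (2 * x + 4 * x ^ 2) := by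
  have h1 : 0 < 1 - x := by linarith
  have hA : 0 ≤ x * (1 - 2 * x) := mul_nonneg h0 (by linarith)
  have hB : 0 ≤ x ^ 2 * x := mul_nonneg (sq_nonneg x) h0
  have hle : (1 + x) / (1 - x) ≤ 1 + (2 * x + 4 * x ^ 2) := by
    rw [div_le_iff₀ h1]
    nlinarith [hA, hB]
  exact hle.trans (by linarith [Real.add_one_le_exp (2 * x + 4 * x ^ 2)])

/-- **(6.1), PROVED (explicit form):** for a real character `χ` mod `D`,
`Σ_{n ≤ D²} g(n)/n ≤ (π²/6) e^{2π²/3} · exp(Σ_{p ≤ D²} (1 + χ(p))/p)`.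
[cite: Pintz1976ElementaryII, §6 (6.1) p. 288] -/
theorem gSum_sq_le_exp_sum_one_add_re (hq : χ ^ 2 = 1) :
    gSum χ ((D : ℝ) ^ 2) ≤
      Real.pi ^ 2 / 6 * Real.exp (2 * Real.pi ^ 2 / 3) *
        Real.exp (∑ p ∈ (Finset.range (D ^ 2 + 1)).filter Nat.Prime,
          (1 + (χ (p : ZMod D)).re) / p) := by
  classical
  have hf0 : ∀ n : ℕ, 0 ≤ charDivisorSum χ n / (n : ℝ) := fun n =>
    div_nonneg (charDivisorSum_nonneg χ hq n) (Nat.cast_nonneg n)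
  have hE := (EulerProduct.summable_and_hasSum_smoothNumbers_prod_primesBelow_tsum
    (f := fun n : ℕ => charDivisorSum χ n / (n : ℝ)) (by simp)
    (fun {m n} hmn => by
      rw [(isMultiplicative_charDivisorSum χ hq).map_mul_of_coprime hmn, Nat.cast_mul,
        mul_div_mul_comm])
    (fun {p} hp => by
      refine (hasSum_charDivisorSum_primePow_div χ hq hp).summable.congr fun n => ?_
      rw [Real.norm_of_nonneg (hf0 _)]) (D ^ 2 + 1)).2
  -- Step 1: the finite sum is a sub-sum of the sum over the `(D²+1)`-smooth numbers
  have hS : gSum χ ((D : ℝ) ^ 2) ≤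
      ∏ p ∈ Nat.primesBelow (D ^ 2 + 1),
        ∑' n : ℕ, charDivisorSum χ (p ^ n) / ((p ^ n : ℕ) : ℝ) := by
    rw [gSum_sq]
    have hsub : ∀ n ∈ Finset.Icc 1 (D ^ 2), n ∈ Nat.smoothNumbers (D ^ 2 + 1) := fun n hn => by
      rw [Finset.mem_Icc] at hn
      exact Nat.mem_smoothNumbers_of_lt hn.1 (by omega)
    have hE' := (hasSum_subtype_iff_indicator
      (f := fun n : ℕ => charDivisorSum χ n / (n : ℝ))).mp hE
    have heq : ∑ n ∈ Finset.Icc 1 (D ^ 2), g χ n / (n : ℝ) =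
        ∑ n ∈ Finset.Icc 1 (D ^ 2),
          (Nat.smoothNumbers (D ^ 2 + 1)).indicator
            (fun n : ℕ => charDivisorSum χ n / (n : ℝ)) n :=
      Finset.sum_congr rfl fun n hn => by rw [Set.indicator_of_mem (hsub n hn), g_eq_charDivisorSum]
    rw [heq]
    exact sum_le_hasSum _ (fun n _ => Set.indicator_nonneg (fun m _ => hf0 m) _) hE'
  have hfac : ∀ p ∈ Nat.primesBelow (D ^ 2 + 1),
      ∑' n : ℕ, charDivisorSum χ (p ^ n) / ((p ^ n : ℕ) : ℝ) =
        (1 - (1 / (p : ℝ)) ^ 2)⁻¹ *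
          (if reChar χ p = 1 then (1 + 1 / (p : ℝ)) / (1 - 1 / (p : ℝ))
           else if reChar χ p = 0 then 1 + 1 / (p : ℝ) else 1) := fun p hp =>
    (hasSum_charDivisorSum_primePow_div χ hq (Nat.prime_of_mem_primesBelow hp)).tsum_eq
  rw [Finset.prod_congr rfl hfac, Finset.prod_mul_distrib] at hS
  have hZ := prod_primesBelow_inv_one_sub_sq_le (D ^ 2 + 1)
  -- Step 2: `E_p ≤ exp((1 + χ(p))/p + 4/p²)`
  have hEle : ∀ p ∈ Nat.primesBelow (D ^ 2 + 1),
      (if reChar χ p = 1 then (1 + 1 / (p : ℝ)) / (1 - 1 / (p : ℝ))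
        else if reChar χ p = 0 then 1 + 1 / (p : ℝ) else 1) ≤
        Real.exp ((1 + (χ (p : ZMod D)).re) / p + 4 * (1 / (p : ℝ)) ^ 2) := by
    intro p hp
    have hpp := Nat.prime_of_mem_primesBelow hp
    have hp2 : (2 : ℝ) ≤ p := by exact_mod_cast hpp.two_le
    have hx0 : 0 ≤ 1 / (p : ℝ) := by positivity
    have hx2 : 1 / (p : ℝ) ≤ 1 / 2 := by
      rw [div_le_div_iff₀ (by linarith) (by norm_num)]; linarith
    have hre : (χ (p : ZMod D)).re = reChar χ p := (reChar_apply χ hpp.ne_zero).symm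
    rw [hre]
    rcases reChar_trichotomy χ hq p with hc | hc | hc
    · rw [if_neg (by rw [hc]; norm_num), if_pos hc, hc]
      calc 1 + 1 / (p : ℝ) ≤ Real.exp (1 / (p : ℝ)) := by
            have := Real.add_one_le_exp (1 / (p : ℝ)); linarith
        _ ≤ Real.exp ((1 + 0) / p + 4 * (1 / (p : ℝ)) ^ 2) :=
            Real.exp_le_exp.mpr (by rw [add_zero]; nlinarith [sq_nonneg (1 / (p : ℝ))])
    · rw [if_pos hc, hc]
      calc (1 + 1 / (p : ℝ)) / (1 - 1 / (p : ℝ)) ≤ Real.exp (2 * (1 / (p : ℝ)) + 4 * (1 / (p : ℝ)) ^ 2) :=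
            one_add_div_one_sub_le_exp' hx0 hx2
        _ = Real.exp ((1 + 1) / p + 4 * (1 / (p : ℝ)) ^ 2) := by congr 1; ring
    · rw [if_neg (by rw [hc]; norm_num), if_neg (by rw [hc]; norm_num), hc]
      calc (1 : ℝ) = Real.exp 0 := (Real.exp_zero).symm
        _ ≤ Real.exp ((1 + -1) / p + 4 * (1 / (p : ℝ)) ^ 2) :=
            Real.exp_le_exp.mpr (by rw [show (1 + -1 : ℝ) / p = 0 by ring]; positivity)
  have hE0 : ∀ p ∈ Nat.primesBelow (D ^ 2 + 1),
      0 ≤ (if reChar χ p = 1 then (1 + 1 / (p : ℝ)) / (1 - 1 / (p : ℝ))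
        else if reChar χ p = 0 then 1 + 1 / (p : ℝ) else 1) := by
    intro p hp
    have hpp := Nat.prime_of_mem_primesBelow hp
    have hp1 : (1 : ℝ) < p := by exact_mod_cast hpp.one_lt
    have hx1 : 1 / (p : ℝ) < 1 := by rw [div_lt_one (by linarith)]; exact hp1
    split_ifs
    · exact div_nonneg (by positivity) (by linarith)
    · positivity
    · norm_num
  have hEprod : ∏ p ∈ Nat.primesBelow (D ^ 2 + 1),
      (if reChar χ p = 1 then (1 + 1 / (p : ℝ)) / (1 - 1 / (p : ℝ))
        else if reChar χ p = 0 then 1 + 1 / (p : ℝ) else 1) ≤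
      Real.exp (∑ p ∈ Nat.primesBelow (D ^ 2 + 1),
        ((1 + (χ (p : ZMod D)).re) / p + 4 * (1 / (p : ℝ)) ^ 2)) := by
    rw [Real.exp_sum]
    exact Finset.prod_le_prod hE0 hEle
  -- Step 3: `Σ_{p ≤ D²} 4/p² ≤ 4 ζ(2) = 2π²/3`
  have hsq : ∑ p ∈ Nat.primesBelow (D ^ 2 + 1), 4 * (1 / (p : ℝ)) ^ 2 ≤ 2 * Real.pi ^ 2 / 3 := by
    rw [← Finset.mul_sum]
    have h1 : ∑ p ∈ Nat.primesBelow (D ^ 2 + 1), (1 / (p : ℝ)) ^ 2 ≤ Real.pi ^ 2 / 6 := by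
      have h := sum_le_hasSum (Nat.primesBelow (D ^ 2 + 1)) (fun n _ => by positivity) hasSum_zeta_two
      refine le_trans (le_of_eq (Finset.sum_congr rfl fun p _ => by rw [one_div_pow])) h
    linarith
  -- combine
  calc gSum χ ((D : ℝ) ^ 2)
      ≤ (∏ p ∈ Nat.primesBelow (D ^ 2 + 1), (1 - (1 / ((p : ℕ) : ℝ)) ^ 2)⁻¹) *
          ∏ p ∈ Nat.primesBelow (D ^ 2 + 1),
            (if reChar χ p = 1 then (1 + 1 / (p : ℝ)) / (1 - 1 / (p : ℝ))
              else if reChar χ p = 0 then 1 + 1 / (p : ℝ) else 1) := hS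
    _ ≤ (Real.pi ^ 2 / 6) * Real.exp (∑ p ∈ Nat.primesBelow (D ^ 2 + 1),
          ((1 + (χ (p : ZMod D)).re) / p + 4 * (1 / (p : ℝ)) ^ 2)) :=
        mul_le_mul hZ hEprod (Finset.prod_nonneg hE0) (by positivity)
    _ ≤ Real.pi ^ 2 / 6 * Real.exp (2 * Real.pi ^ 2 / 3) *
          Real.exp (∑ p ∈ (Finset.range (D ^ 2 + 1)).filter Nat.Prime,
            (1 + (χ (p : ZMod D)).re) / p) := by
        rw [mul_assoc, ← Real.exp_add, Finset.sum_add_distrib, Nat.primesBelow_eq_filter_range]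
        refine mul_le_mul_of_nonneg_left (Real.exp_le_exp.mpr ?_) (by positivity)
        rw [← Nat.primesBelow_eq_filter_range]
        linarith [hsq]

end SixOne

/-! ### Theorem 5 from Theorem 1 (PROVED) and Theorem 4 (named fact of the statement file) -/

section TheoremFive

/-- **Theorem 5 ⇐ Theorem 4** (the printed deduction, §6 p. 288, PROVED): Theorem 1 at `ε = ½`
(its hypothesis `L(1) log D ≤ η` follows from (1.30) `L(1) ≤ 1/log²D` for `D ≥ e^{1/η}`) gives the
Siegel zero and `L(1)/δ ≤ (3/2) Σ_{n≤D²} g(n)/n`; (6.1) (`gSum_sq_le_exp_sum_one_add_re`) and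
Theorem 4 bound the latter by `C (log D log log D/log(1/(5L(1) log D)))²`.
[cite: Pintz1976ElementaryII, Theorem 5 pp. 278–279 (1.30)–(1.31), proof §6 p. 288] -/
theorem theorem5_of_theorem4 (h4 : pintz1976_theorem4) : pintz1976_theorem5 := by
  obtain ⟨C₄, D₄, hD₄⟩ := h4
  obtain ⟨η, hη, D₁, hD₁⟩ := pintz1976_theorem1_holds (1 / 2) (by norm_num)
  refine ⟨3 / 2 * (Real.pi ^ 2 / 6 * Real.exp (2 * Real.pi ^ 2 / 3)) * C₄,
    max (max D₄ D₁) (max 2 ⌈Real.exp (1 / η)⌉₊), ?_⟩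
  intro D _ hD χ hquad hprim hL
  have hDD₄ : D₄ ≤ D := le_trans (le_trans (le_max_left _ _) (le_max_left _ _)) hD
  have hDD₁ : D₁ ≤ D := le_trans (le_trans (le_max_right _ _) (le_max_left _ _)) hD
  have hD2 : 2 ≤ D := le_trans (le_trans (le_max_left _ _) (le_max_right _ _)) hD
  have hDη : ⌈Real.exp (1 / η)⌉₊ ≤ D := le_trans (le_trans (le_max_right _ _) (le_max_right _ _)) hD
  have hD2r : (2 : ℝ) ≤ D := by exact_mod_cast hD2
  have hlog0 : 0 < Real.log D := Real.log_pos (by linarith)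
  have hq : χ ^ 2 = 1 := MulChar.IsQuadratic.sq_eq_one hquad
  -- `L(1) log D ≤ 1/log D ≤ η`
  have hlogη : 1 / η ≤ Real.log D := by
    rw [Real.le_log_iff_exp_le (by linarith)]
    exact le_trans (Nat.le_ceil _) (by exact_mod_cast hDη)
  have hbudget : (χ.LFunction 1).re * Real.log D ≤ η := by
    calc (χ.LFunction 1).re * Real.log D ≤ 1 / Real.log D ^ 2 * Real.log D :=
          mul_le_mul_of_nonneg_right hL hlog0.le
      _ = 1 / Real.log D := by field_simp
      _ ≤ η := by rw [div_le_iff₀ hlog0]; rw [div_le_iff₀ hη] at hlogη; linarith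
  obtain ⟨hex, hall⟩ := hD₁ D hDD₁ χ hquad hprim hbudget
  refine ⟨hex, fun β hβ => ?_⟩
  obtain ⟨-, hA2, hA3⟩ := hall β hβ
  have h4D := hD₄ D hDD₄ χ hquad hprim hL
  have h61 := gSum_sq_le_exp_sum_one_add_re χ hq
  -- `S > 0` and `L(1)/δ ≤ (3/2) S`
  have hP1 : 1 ≤ ∏ p ∈ D.primeFactors, (1 + 1 / (p : ℝ)) := by
    calc (1 : ℝ) = ∏ _p ∈ D.primeFactors, (1 : ℝ) := by simp
      _ ≤ ∏ p ∈ D.primeFactors, (1 + 1 / (p : ℝ)) :=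
          prod_le_prod (fun _ _ => zero_le_one) fun p _ => by
            have : (0 : ℝ) ≤ 1 / (p : ℝ) := by positivity
            linarith
  have hπ3 : 3 < Real.pi := Real.pi_gt_three
  have hSpos : 0 < gSum χ ((D : ℝ) ^ 2) := by
    have h1 : (1 : ℝ) * (1 - 1 / 2) ≤ (∏ p ∈ D.primeFactors, (1 + 1 / (p : ℝ))) * (Real.pi ^ 2 / 6 - 1 / 2) :=
      mul_le_mul hP1 (by nlinarith) (by norm_num) (by linarith)
    linarith
  have hratio : (χ.LFunction 1).re / (1 - β) ≤ 3 / 2 * gSum χ ((D : ℝ) ^ 2) := by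
    have h := (abs_le.mp hA2).2
    have h' : (χ.LFunction 1).re / (1 - β) / gSum χ ((D : ℝ) ^ 2) ≤ 3 / 2 := by linarith
    rwa [div_le_iff₀ hSpos] at h'
  calc (χ.LFunction 1).re / (1 - β) ≤ 3 / 2 * gSum χ ((D : ℝ) ^ 2) := hratio
    _ ≤ 3 / 2 * (Real.pi ^ 2 / 6 * Real.exp (2 * Real.pi ^ 2 / 3) *
          Real.exp (∑ p ∈ (Finset.range (D ^ 2 + 1)).filter Nat.Prime,
            (1 + (χ (p : ZMod D)).re) / p)) := by linarith
    _ ≤ 3 / 2 * (Real.pi ^ 2 / 6 * Real.exp (2 * Real.pi ^ 2 / 3) *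
          (C₄ * (Real.log D * Real.log (Real.log D) /
            Real.log (1 / (5 * (χ.LFunction 1).re * Real.log D))) ^ 2)) := by
        gcongr
    _ = _ := by ring

end TheoremFive

end Pintz1976

/-- **Pintz 1976 (II), Theorem 2 — PROVED** (`pintz1976_theorem2_holds : pintz1976_theorem2`): for an
imaginary quadratic field `K` with `D = |d_K| ≥ D₀(ε)` and `h_K ≤ log D/(2 log log D)` (1.18),
and `χ` the odd real primitive character mod `D`, the greatest real zero `1 − δ` of `L(s, χ)`
satisfies `L(1)/δ ∼ (π²/6)∏_{p∣D}(1 + 1/p)` and `δ ∼ 6h(−D)/(π ∏_{p∣D}(1 + 1/p) √D)` (1.19),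
quantified with `ε`/`D₀`. The road is the printed one: Theorem 1 (`pintz1976_theorem1_holds`),
(3.2) via Lenstra–Pomerance Lemma 2.10 (= Davenport's Hilfssatz 1 [3]) and `h(d_K) = h_K`,
(3.3)–(3.4), (3.5)–(3.6) (`Pintz1976.sum_inv_splitPrimes_le`), and the Euler-product bound (3.7).
[cite: Pintz1976ElementaryII, Theorem 2 p. 276 (1.18)–(1.19), proof §3 pp. 282–283] -/
theorem pintz1976_theorem2_holds : pintz1976_theorem2 := by
  intro ε hε
  obtain ⟨D₀, hD₀⟩ := Pintz1976.theorem2_aux hε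
  exact ⟨D₀, fun K _ _ _ h2 hd hD hh χ hquad hprim hodd β hβ =>
    hD₀ _ K h2 hd rfl hD hh χ hquad hprim hodd β hβ⟩

end Literature.NumberTheory.LFunctions

end
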